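import Mathlib.Data.List.Basic
import Mathlib.Data.List.InsertIdx
import Mathlib.Tactic

/-!
# `Lines/toric_sgame_allchains.lean` — the ALL-CHAINS KERNEL THEOREMS of the toric S-game (res-B-lens-2 g8, G9/G10; rev 2; split off
`Lines/toric_sgame.lean` at rev 9/10 because a crux workfile is capped at 200 000 bytes)

Crux `stmt-ResolutionOfSingularities-0549` (`Theses.Descent.DescentPerfectToAll`), sub-line `giraud-weak-normal-form`.
LABELS: bears_on LADDER-RESOLUTION:B · [OURS · CANDIDATE] counted 0 · de-risking scaffolding for the Giraud-normal-form sub-line,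
NOT rung-B progress · nothing here proves resolution in char p · resolution in char p NOT proved · AI-written, weaker than expert
review · PURE COMBINATORICS: this file formalises the b-graded toric S-GAME of loop note `giraud-weak-normal-form-RFINE-loop.md` §9 /
sheet `giraud-double-cubic-Tpp-sheet.md` §2 (a MODEL of the S-visible part of a resolution engine on ONE local normal form,
`f = z³/3 + y³/3 + y²g₂ + yg₁ + g₀` near a smooth surface `S` with snc boundary), NOT any statement about schemes. It is a crux
WORKFILE, not a skeleton: it has no `sorry`, registers no stub, and must never be `ledger skeleton check`ed against 0549/0550.

RELATION TO `Lines/toric_sgame.lean`: that file keeps §A (strong convergence of abelian move systems), §B (the computable model with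
its all-orders exploration / event census machinery) and §C (the `decide` / `native_decide` box certificates). THIS file re-declares
the MODEL CORE of its §B VERBATIM (the definitions `Wt … applyMoves`, 160 lines, no exploration machinery; namespace `….ToricSGame.AllChains`,
so nothing clashes) and proves over it the theorems FOR ALL CHAINS AND ALL LEGAL PLAYS, §B′–§B⁶ below (formerly §B′–§B⁵ of that file,
revs 4–8, plus the new §B⁶). Plain tactic proofs, no `sorry`, no axioms beyond the three standard ones, no custom syntax.

## Contents
* §B (copy) the model core: grade weights, curves `(w, w₃, bd)`, chains, node orders, the classes deep / borderline / light, the legal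
  move generator `legalMoves topj` (modes: `topj = 0` loop-note rev 2, `1`, `2 = G_mult`; in mode `uv` all curves are boundary), the
  moves `D/A/AL` (accepts) and `I/P` (blow-ups, exponent 3 at top points else 2), `applyMove(s)`, `isLegalPlay`.
* §B′ (rev 4) the load-bearing fact (F2) of loop note §9.15 as KERNEL THEOREMS FOR ALL CHAINS (no box, no `native_decide`):
  `F2_A` (an `A`-accepted centre has `w₀ = 2`, any rule set), `F2_A_node` / `F2_AL` (under `G_mult`, indeed any `topj ≥ 2` resp. `≥ 1`:
  the centre has `w₀ = 2` and every Sing₂ point of it has node order `o₀ = 2`, i.e. partner `w₀ = 0`, at a T-node `c₀ = 0`),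
  `F2_AL_bd` / `F2_A_node_bd` (the same in mode `uv` — all curves boundary — for ANY `topj`, since jump = top at 𝒟-nodes), `F2_P`
  (a legal isolated point blow-up at a non-top point has `o₀ = 2` and its newborn `w₀ = 0`); via `A_mem_legalMoves` /
  `AL_mem_legalMoves` / `P_mem_legalMoves` (what the move generator can emit) and the threshold arithmetic `o0_of_sing2_not_top`.
* §B″ (rev 5) LEMMA (3) of loop note §9.15 — «no α = 3 blow-up at a point with o₃ ≥ 1; every cubic-weighted curve has w₀ = 0» — and
  the CENTRES half of THEOREM (4) — «every accepted centre has w₃ = 0» — as KERNEL THEOREMS FOR ALL CHAINS AND ALL LEGAL PLAYS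
  (`lemma3_gmult` / `cubic_w0_gmult` / `monic_centres_gmult` under `G_mult`, indeed any `topj ≥ 2`; `lemma3_uv` / `monic_centres_uv` in
  mode `uv` for any rule set), by an INDUCTIVE STATE INVARIANT `Inv3` (cubic-weighted curves have `w₀ = 0`; at every node a cubic-weighted
  branch faces a non-Sing₂ node or a partner with `w₀ ≤ 2`) preserved by every legal move (`Inv3_step`, via the generic transport lemmas
  `Inv3_modify` / `Inv3_insert` through `List.modify` / `List.insertIdx` and the monotonicity `sing2N_mono_left|right`) — replacing the
  birth-order («first event») argument of the note by a history-free invariant.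
* §B‴ (rev 6) the NEIGHBOURS half of THEOREM (4) as KERNEL THEOREMS FOR ALL CHAINS AND ALL LEGAL PLAYS (`monic_neighbours_gmult`, any
  `topj ≥ 2`; `monic_neighbours_uv`, mode `uv`, any rule set): at every `D`/`A`-accept both branches at each of the centre's points have
  `w₃ = 0`, at every `AL`-accept the same at each Sing₂ point of the centre — by a second inductive invariant `Inv4` (a cubic-weighted
  branch never faces a Sing₂-class boundary branch, and faces a class-𝒞 boundary branch only across a non-Sing₂ point; `Inv4_step` via
  the generic node-relation transport `NodeInv_modify` / `NodeInv_insert` and the threshold arithmetic `topN_of_singW_CW`,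
  `topN_of_CW_CW_sing2`). Left open here (closed in §B⁶, rev 9): a cubic-weighted neighbour across the NON-Sing₂ point of a light
  centre — the residual sub-case of 9.14 (5), excluded by PROPOSITION 9.15 (5) (far-side quantity w₀ − 3w₂; needs birth data).
* §B⁗ (rev 7) a third invariant `Inv6` (a cubic-weighted branch adjacent to a class-𝒞 boundary branch ⇒ both have `w₂ = 0`), giving
  `residual_shape_gmult|uv`: if an `AL`-accepted centre `K` has a cubic-weighted boundary neighbour `N` then `w₀(K) = 2`, `w₂(K) = 0`,
  `w₀(N) = 0`, `w₂(N) = 0` — so what §B‴ leaves undecided is LITERALLY the hypothesis of PROPOSITION 9.15 (5) (two light lines (2,·,0)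
  across a dry point); and `top_noCubic_gmult|uv`: no top point of any reached state carries cubic weight (S6 LEMMA clause for all chains).
* §B⁵ (rev 8) the HISTORY half: a conservative extension of the game by BIRTH RECORDS (`GCurve.par` = the two branches of the birth
  point; `proj_gApplyMoves`: the extended play projects exactly onto the play), the inductive invariant `I5` («Δ(far partner) ≥ 0» of
  loop note §9.15 (5)(ii): a boundary curve with `w₃ = 0`, `w₀ = 3w₂ + 2`, born at a point whose left/right branch was light-shaped
  `(2,·,0)`, has a right/left neighbour `G` with `3·w₂(G) ≤ w₀(G)`), and the FAR-SIDE LEMMA `farside_gmult|uv` = PROPOSITION (5)(ii)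
  in the kernel: such a centre is never `AL`-accepted through its far point.
* §B⁶ (rev 9) the GENESIS bookkeeping (5)(i) over the same extension — invariants `G1` (two adjacent curves are both initial, or one
  was born at a point of the other, whose weights changed since then by at most ONE `A/AL` accept: `Rel`), `G0` (a curve without birth
  record is an end of the chain), `B2` (born next to a cubic-weighted branch ⇒ `w₀ = 0` for ever), `I8` (a cubic-weighted boundary
  curve with `w₀ = w₂ = 0` born with a light-shaped right/left branch has a right/left neighbour with `w₀ = 0`: it was accepted through
  its near point — by the far-side lemma), `NB` (non-boundary branches keep `w₃ = 0`) — and `prop5_state`: under all invariants the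
  residual configuration of `residual_shape` is contradictory. HEADLINE `prop5_gmult|uv` = PROPOSITION 9.15 (5), and
  `monic_neighbours_all_gmult|uv` = THEOREM 9.15 (4) IN FULL (at every accept `D/A/AL`, both branches at EVERY point of the centre have
  `w₃ = 0`; S6's cubic-weight hypothesis), KERNEL-PROVED for every legal play from every cubic-free initial chain of length ≤ 2 (all
  seeds of the boxes and beyond, all weights), mode `G_mult` (`topj ≥ 2`) and mode `uv` (any rule set). Nothing of §9.15 (3)–(5) is
  left by hand; what remains by hand in the (T″) sheet is geometric (S1/S5: the dictionary engine ↔ game, E-S6(iv)), not combinatorial.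

* §B⁷ (rev 2 of this file) COROLLARY census counter a6 = 0 (E-S6(iv) IN THE MODEL): the census predicate `mult3AtEnd` (copied verbatim
  with `dbl`) needs cubic weight `2w₃(c) + w₃(nb) + 1 ≥ α`, so `no_mult3AtEnd_gmult|uv`: at every accept of every legal play from every
  seed, at every point of the centre, the multiplicity-3 test at the distinguished points over the end nodes is negative (both orders).

HEADLINE (§B⁶): `monic_neighbours_all_gmult` / `monic_neighbours_all_uv` — from every cubic-free initial chain of length ≤ 2 (every seed
`initChain uv ws wt = [⟨wt,0,uv⟩, ⟨ws,0,true⟩]` of the boxes, all weights), along every legal play, at every accept `D k / A k / AL k`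
both branches at every point of the centre have `w₃ = 0`; with `monic_centres_*` (§B″) this is S6's cubic-weight hypothesis of the
(T″) sheet in full, and loop note §9.15 (3)–(5) are kernel theorems. What the (T″) sheet still takes from outside the kernel is
geometric, not combinatorial: the dictionary engine ↔ game (S1/S5) and the chart computation behind E-S6(iv) (whose census
counter a6 is a kernel corollary for every seed, §B⁷).
-/

set_option linter.dupNamespace false
set_option linter.style.longLine false
set_option autoImplicit false

namespace Summit.ResolutionOfSingularities.ResolutionOfSingularities.Cruxes.DescentPerfectToAll.GiraudWeakNormalForm.ToricSGame.AllChains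

/-! ## §B (copy). The b-graded toric S-game — model core, VERBATIM from `Lines/toric_sgame.lean` §B. -/

/-- One grade weight `w_b = ord_C(g_b)`; `none` = ∞ (the class part `g_b` is identically zero). -/
abbrev Wt := Option ℕ

/-- `w ≥ t` for a grade weight (`∞ ≥ t` always). -/
def wge (w : Wt) (t : ℕ) : Bool := match w with | none => true | some n => Nat.ble t n

/-- `1 ≤ c < ∞`. -/
def finPos (c : Wt) : Bool := match c with | none => false | some n => Nat.ble 1 n

/-- Sum of grade weights (∞ absorbing). -/
def wadd : Wt → Wt → Wt
  | some x, some y => some (x + y)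
  | _, _ => none

/-- The weight vector `(w₀, w₁, w₂)` of a curve (orders of the three class parts `g₀, g₁, g₂`). -/
structure W3 where
  w0 : Wt
  w1 : Wt
  w2 : Wt
deriving DecidableEq, Repr, Inhabited, Hashable

namespace W3
/-- componentwise `w ≥ (t₀,t₁,t₂)` -/
def ge (w : W3) (t0 t1 t2 : ℕ) : Bool := wge w.w0 t0 && wge w.w1 t1 && wge w.w2 t2
/-- node order `o = w' + w''` -/
def add (a b : W3) : W3 := ⟨wadd a.w0 b.w0, wadd a.w1 b.w1, wadd a.w2 b.w2⟩
/-- accept: `w ↦ w − (d₀,d₁,d₂)` -/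
def sub (w : W3) (d0 d1 d2 : ℕ) : W3 := ⟨w.w0.map (· - d0), w.w1.map (· - d1), w.w2.map (· - d2)⟩
end W3

/-- thresholds: `θ = (3,2,1)` (TOP / DEEP), `(2,2,1)` (Sing₂), `(2,1,0)` (class 𝒞). -/
def isDeepW (w : W3) : Bool := w.ge 3 2 1
def isSingW (w : W3) : Bool := w.ge 2 2 1
def isCW (w : W3) : Bool := w.ge 2 1 0

/-- A curve of the chain: class weights `w`, the CUBIC weight `w3 = ord_C` of the class-3 part `(z³+y³)/3` (θ₃ = 3; it never
influences legality — bookkeeping for the (OFF-S) census of §9.12/9.14), and the flag `bd` (`true` = boundary/exceptional curve, a legal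
centre; `false` = the residual transversal branch `R` of mode `u`, never a centre; its weights are the residual exponents `c`). -/
structure Curve where
  w : W3
  w3 : ℕ
  bd : Bool
deriving DecidableEq, Repr, Inhabited, Hashable

/-- The state: the chain of curves `K₀ — K₁ — ⋯ — K_n`; point `i` is the node between `K_i` and `K_{i+1}`. -/
abbrev Chain := List Curve

/-- Moves: `D k` accept the deep curve `k` (α = 3); `A k` / `AL k` accept the borderline / relevant light curve `k` (α = 2);
`I i` blow up the jump (or, under `G_mult`, top) point `i` of a handled curve (α = 3); `P i` blow up the isolated Sing₂ point `i`
(α = 3 if top, else 2). -/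
inductive Move
  | D (k : ℕ) | A (k : ℕ) | AL (k : ℕ) | I (i : ℕ) | P (i : ℕ)
deriving DecidableEq, Repr

inductive Kind | resid | deep | borderline | light | none
deriving DecidableEq, Repr

def kindOf (c : Curve) : Kind :=
  if !c.bd then .resid else if isDeepW c.w then .deep else if isSingW c.w then .borderline
  else if isCW c.w then .light else .none

/-- the two branches at point `i` -/
def nodeAt (ch : Chain) (i : ℕ) : Option (Curve × Curve) :=
  match ch[i]?, ch[i+1]? with
  | some a, some b => some (a, b)
  | _, _ => none

/-- residual exponents at a T-point (`none` at a 𝒟-node) -/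
def resid (a b : Curve) : Option W3 := if !a.bd then some a.w else if !b.bd then some b.w else none

/-- `x ∈ Sing₂` (multiplicity / ν dictionary 9.3′, T-point rule rev 2: `c₀ ≥ 1 ⇒ o₀ ≥ 3`, `c₁ ≥ 1 ⇒ o₁ ≥ 2`, `c₂ ≥ 1 ⇒ o₂ ≥ 1`). -/
def sing2N (a b : Curve) : Bool :=
  let o := a.w.add b.w
  isSingW o &&
  (match resid a b with
   | none => true
   | some c => (!finPos c.w0 || wge o.w0 3) && (!finPos c.w1 || wge o.w1 2) && (!finPos c.w2 || wge o.w2 1))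

/-- `x` TOP (multiplicity 3): Sing₂ and `o ≥ θ`. -/
def topN (a b : Curve) : Bool := sing2N a b && isDeepW (a.w.add b.w)

/-- `x` a JUMP point of a (non-deep, class-𝒞) curve through it: top, and at a T-point `c_b ≥ 1 ⇒ o_b ≥ 4 − b`. -/
def jumpN (a b : Curve) : Bool :=
  let o := a.w.add b.w
  topN a b &&
  (match resid a b with
   | none => true
   | some c => (!finPos c.w0 || wge o.w0 4) && (!finPos c.w1 || wge o.w1 3) && (!finPos c.w2 || wge o.w2 2))

def sing2At (ch : Chain) (i : ℕ) : Bool := match nodeAt ch i with | some (a, b) => sing2N a b | none => false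
def topAt (ch : Chain) (i : ℕ) : Bool := match nodeAt ch i with | some (a, b) => topN a b | none => false
def jumpAt (ch : Chain) (i : ℕ) : Bool := match nodeAt ch i with | some (a, b) => jumpN a b | none => false
def kindAt (ch : Chain) (k : ℕ) : Kind := match ch[k]? with | some c => kindOf c | none => .none

/-- the points (node indices) of curve `k` in a chain of length `n` -/
def ptsOf (n k : ℕ) : List ℕ := (if 1 ≤ k then [k - 1] else []) ++ (if k + 1 < n then [k] else [])

/-- a light curve is RELEVANT iff one of its points is in Sing₂ -/
def relevantLight (ch : Chain) (k : ℕ) : Bool := kindAt ch k == .light && (ptsOf ch.length k).any (sing2At ch)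

/-- curves that HANDLE their points (curves first at points): deep, borderline, relevant light -/
def handled (ch : Chain) (k : ℕ) : Bool :=
  kindAt ch k == .deep || kindAt ch k == .borderline || relevantLight ch k

/-- The LEGAL MOVES under STRICT legality (deep-first; curves first at points), variant `topj`:
`topj = 0` = loop-note rev 2; `topj = 1` = rev 3 (top points on relevant light curves are blown up first);
`topj = 2` = `G_mult` (top points on borderline curves too). The list is the SET of legal moves (any order = rule `free`). -/
def legalMoves (topj : ℕ) (ch : Chain) : List Move :=
  let n := ch.length
  let idx := List.range n
  match idx.filter (fun k => kindAt ch k == .deep) with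
  | k :: _ => [Move.D k]
  | [] =>
    let curveMoves := idx.flatMap (fun k =>
      match kindAt ch k with
      | .borderline =>
          let js := (ptsOf n k).filter (fun i => jumpAt ch i || (Nat.ble 2 topj && topAt ch i))
          if js.isEmpty then [Move.A k] else js.map Move.I
      | .light =>
          if (ptsOf n k).any (sing2At ch) then
            let js := (ptsOf n k).filter (fun i => jumpAt ch i || (Nat.ble 1 topj && topAt ch i))
            if js.isEmpty then [Move.AL k] else js.map Move.I
          else []
      | _ => [])
    let pMoves := ((List.range (n - 1)).filter
      (fun i => sing2At ch i && !handled ch i && !handled ch (i + 1))).map Move.P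
    curveMoves ++ pMoves

/-- LOOSE legality (for contrast only; = `coupled_sim3`'s `free2`): isolated point blow-ups are also allowed at points of
relevant light curves. It admits an infinite legal play (§C). -/
def looseMoves (topj : ℕ) (ch : Chain) : List Move :=
  let n := ch.length
  legalMoves topj ch ++ ((List.range (n - 1)).filter
      (fun i => sing2At ch i && relevantLight ch i || sing2At ch i && relevantLight ch (i + 1))).map Move.P

/-- TERMINAL: no deep/borderline curve and no Sing₂ point. -/
def terminalB (ch : Chain) : Bool :=
  (List.range ch.length).all (fun k => kindAt ch k != .deep && kindAt ch k != .borderline) &&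
  (List.range (ch.length - 1)).all (fun i => !sing2At ch i)

/-- blow up point `i` with exponent `α`: newborn curve with `w_b = o_b + b − α`, inserted between the two branches. -/
def blowup (ch : Chain) (i α : ℕ) : Chain :=
  match nodeAt ch i with
  | none => ch
  | some (a, b) =>
    let o := a.w.add b.w
    ch.insertIdx (i + 1) ⟨⟨o.w0.map (· - α), o.w1.map (· + 1 - α), o.w2.map (· + 2 - α)⟩, a.w3 + b.w3 + 3 - α, true⟩

/-- play one move -/
def applyMove (ch : Chain) : Move → Chain
  | .D k => ch.modify k (fun c => { c with w := c.w.sub 3 2 1 })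
  | .A k => ch.modify k (fun c => { c with w := c.w.sub 2 1 0, w3 := c.w3 + 1 })
  | .AL k => ch.modify k (fun c => { c with w := c.w.sub 2 1 0, w3 := c.w3 + 1 })
  | .I i => blowup ch i 3
  | .P i => blowup ch i (if topAt ch i then 3 else 2)

/-- play a list of moves -/
def applyMoves (ch : Chain) (l : List Move) : Chain := l.foldl applyMove ch

/-- is `l` a legal play from `ch` (every move legal when played)? -/
def isLegalPlay (topj : ℕ) : Chain → List Move → Bool
  | _, [] => true
  | ch, m :: l => (legalMoves topj ch).contains m && isLegalPlay topj (applyMove ch m) l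


/-! ## §B′. (F2) of loop note §9.15 for ALL chains — kernel theorems (rev 4, g8) -/

/-! ## (F2) kernel version — arithmetic of the thresholds -/

theorem wge_some (n t : ℕ) : wge (some n) t = decide (t ≤ n) := by
  simp only [wge]
  rw [Bool.eq_iff_iff, Nat.ble_eq, decide_eq_true_eq]
theorem wge_none (t : ℕ) : wge none t = true := rfl
theorem wadd_some (x y : ℕ) : wadd (some x) (some y) = some (x + y) := rfl
theorem wadd_none_l (y : Wt) : wadd none y = none := by cases y <;> rfl
theorem wadd_none_r (x : Wt) : wadd x none = none := by cases x <;> rfl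

/- the controlled simp set used below turns the threshold Booleans into linear arithmetic (disjunctive normal form for `= false`) -/

/-- a borderline curve has `w₀ = 2` -/
theorem w0_of_borderline (c : Curve) (h : kindOf c = .borderline) : c.w.w0 = some 2 := by
  rcases c with ⟨w, w3, bd⟩
  cases hD : isDeepW w <;> cases hS : isSingW w <;> cases hC : isCW w <;> cases bd <;> simp [kindOf, hD, hS, hC] at h
  all_goals
    rcases w with ⟨_ | a, _ | b, _ | c⟩ <;> (simp only [isDeepW, isSingW, isCW, W3.ge, W3.add, wge_some, wge_none, wadd_some, wadd_none_l, wadd_none_r, Bool.and_eq_true, Bool.and_eq_false_eq_eq_false_or_eq_false, decide_eq_true_eq, decide_eq_false_iff_not, not_le, Bool.true_and, Bool.and_true, true_and, and_true, Bool.false_eq_true, Bool.true_eq_false, false_or, or_false, Option.some.injEq, reduceCtorEq, false_and, and_false, or_true, true_or, exists_and_left, exists_and_right, exists_eq_left, exists_eq_left', exists_eq_right, exists_eq_right', exists_eq', exists_false, exists_const, false_iff, iff_false, not_false_eq_true, not_true_eq_false] at *) <;> omega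

/-- a light curve has `2 ≤ w₀` when `w₀` is finite -/
theorem w0_of_light (c : Curve) (h : kindOf c = .light) (x : ℕ) (hx : c.w.w0 = some x) : 2 ≤ x := by
  rcases c with ⟨w, w3, bd⟩
  cases hD : isDeepW w <;> cases hS : isSingW w <;> cases hC : isCW w <;> cases bd <;> simp [kindOf, hD, hS, hC] at h
  all_goals
    rcases w with ⟨_ | a, _ | b, _ | c⟩ <;> simp only at hx <;> (simp only [isDeepW, isSingW, isCW, W3.ge, W3.add, wge_some, wge_none, wadd_some, wadd_none_l, wadd_none_r, Bool.and_eq_true, Bool.and_eq_false_eq_eq_false_or_eq_false, decide_eq_true_eq, decide_eq_false_iff_not, not_le, Bool.true_and, Bool.and_true, true_and, and_true, Bool.false_eq_true, Bool.true_eq_false, false_or, or_false, Option.some.injEq, reduceCtorEq, false_and, and_false, or_true, true_or, exists_and_left, exists_and_right, exists_eq_left, exists_eq_left', exists_eq_right, exists_eq_right', exists_eq', exists_false, exists_const, false_iff, iff_false, not_false_eq_true, not_true_eq_false] at *) <;> omega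

/-- at a Sing₂ point that is NOT top the order `o₀` is exactly 2: both branches have finite `w₀`, summing to 2 -/
theorem o0_of_sing2_not_top (a b : Curve) (hs : sing2N a b = true) (ht : topN a b = false) :
    ∃ x y : ℕ, a.w.w0 = some x ∧ b.w.w0 = some y ∧ x + y = 2 := by
  have ht' : isDeepW (a.w.add b.w) = false := by
    unfold topN at ht; rw [hs] at ht; simpa using ht
  have hs' : isSingW (a.w.add b.w) = true := by
    unfold sing2N at hs; simp only [Bool.and_eq_true] at hs; exact hs.1
  clear hs ht
  rcases a with ⟨⟨_ | a0, _ | a1, _ | a2⟩, a3, abd⟩ <;> rcases b with ⟨⟨_ | b0, _ | b1, _ | b2⟩, b3, bbd⟩ <;> (simp only [isDeepW, isSingW, isCW, W3.ge, W3.add, wge_some, wge_none, wadd_some, wadd_none_l, wadd_none_r, Bool.and_eq_true, Bool.and_eq_false_eq_eq_false_or_eq_false, decide_eq_true_eq, decide_eq_false_iff_not, not_le, Bool.true_and, Bool.and_true, true_and, and_true, Bool.false_eq_true, Bool.true_eq_false, false_or, or_false, Option.some.injEq, reduceCtorEq, false_and, and_false, or_true, true_or, exists_and_left, exists_and_right,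 exists_eq_left, exists_eq_left', exists_eq_right, exists_eq_right', exists_eq', exists_false, exists_const, false_iff, iff_false, not_false_eq_true, not_true_eq_false] at *) <;> omega


/-! ## (F2) kernel version — which moves the legal-move generator can emit -/

/-- An `A k` move is emitted only for a BORDERLINE curve `k` none of whose points is a jump (or, when `2 ≤ topj`, top). -/
theorem A_mem_legalMoves (topj : ℕ) (ch : Chain) (k : ℕ) (h : Move.A k ∈ legalMoves topj ch) :
    kindAt ch k = .borderline ∧
      ∀ i ∈ ptsOf ch.length k, (jumpAt ch i || (Nat.ble 2 topj && topAt ch i)) = false := by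
  unfold legalMoves at h
  dsimp only at h
  split at h
  · simp at h
  · simp only [List.mem_append, List.mem_flatMap, List.mem_map, List.mem_filter, List.mem_range] at h
    rcases h with ⟨k', hk', hm⟩ | ⟨i, _, hi⟩
    · split at hm
      · rename_i hkind
        split at hm
        · rename_i hjs
          simp only [List.mem_singleton, Move.A.injEq] at hm
          subst hm
          refine ⟨hkind, ?_⟩
          intro i hi
          have := List.isEmpty_iff.mp hjs
          rw [List.filter_eq_nil_iff] at this
          have h2 := this i hi
          simpa using h2
        · simp at hm
      · split at hm <;> [split at hm <;> simp at hm; simp at hm]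
      · simp at hm
    · simp at hi

/-- An `AL k` move is emitted only for a RELEVANT LIGHT curve `k` none of whose points is a jump (or, when `1 ≤ topj`, top). -/
theorem AL_mem_legalMoves (topj : ℕ) (ch : Chain) (k : ℕ) (h : Move.AL k ∈ legalMoves topj ch) :
    kindAt ch k = .light ∧ (ptsOf ch.length k).any (sing2At ch) = true ∧
      ∀ i ∈ ptsOf ch.length k, (jumpAt ch i || (Nat.ble 1 topj && topAt ch i)) = false := by
  unfold legalMoves at h
  dsimp only at h
  split at h
  · simp at h
  · simp only [List.mem_append, List.mem_flatMap, List.mem_map, List.mem_filter, List.mem_range] at h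
    rcases h with ⟨k', hk', hm⟩ | ⟨i, _, hi⟩
    · split at hm
      · split at hm <;> simp at hm
      · rename_i hkind
        split at hm
        · rename_i hrel
          split at hm
          · rename_i hjs
            simp only [List.mem_singleton, Move.AL.injEq] at hm
            subst hm
            refine ⟨hkind, hrel, ?_⟩
            intro i hi
            have := List.isEmpty_iff.mp hjs
            rw [List.filter_eq_nil_iff] at this
            have h2 := this i hi
            simpa using h2
          · simp at hm
        · simp at hm
      · simp at hm
    · simp at hi


/-- A `P i` move is emitted only at a Sing₂ point `i` none of whose two branches is a handled curve. -/
theorem P_mem_legalMoves (topj : ℕ) (ch : Chain) (i : ℕ) (h : Move.P i ∈ legalMoves topj ch) :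
    sing2At ch i = true ∧ handled ch i = false ∧ handled ch (i + 1) = false := by
  unfold legalMoves at h
  dsimp only at h
  split at h
  · simp at h
  · simp only [List.mem_append, List.mem_flatMap, List.mem_map, List.mem_filter, List.mem_range] at h
    rcases h with ⟨k', hk', hm⟩ | ⟨j, hj, hji⟩
    · split at hm
      · split at hm <;> simp at hm
      · split at hm <;> [split at hm <;> simp at hm; simp at hm]
      · simp at hm
    · simp only [Move.P.injEq] at hji
      subst hji
      have h2 : (sing2At ch j = true ∧ handled ch j = false) ∧ handled ch (j + 1) = false := by simpa using hj.2
      exact ⟨h2.1.1, h2.1.2, h2.2⟩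

/-! ## (F2) kernel version — the theorem -/

theorem nodeAt_some {ch : Chain} {i : ℕ} {a b : Curve} (h : nodeAt ch i = some (a, b)) :
    ch[i]? = some a ∧ ch[i+1]? = some b := by
  unfold nodeAt at h
  cases h1 : ch[i]? <;> cases h2 : ch[i+1]? <;> simp [h1, h2] at h
  obtain ⟨rfl, rfl⟩ := h
  exact ⟨rfl, rfl⟩

theorem mem_ptsOf {n k i : ℕ} (h : i ∈ ptsOf n k) : (1 ≤ k ∧ i + 1 = k) ∨ (k + 1 < n ∧ i = k) := by
  unfold ptsOf at h
  rw [List.mem_append] at h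
  rcases h with h | h
  · split at h
    · simp at h; omega
    · simp at h
  · split at h
    · simp at h; omega
    · simp at h

theorem kindAt_some {ch : Chain} {k : ℕ} {κ : Kind} (h : kindAt ch k = κ) (hκ : κ ≠ .none) :
    ∃ c, ch[k]? = some c ∧ kindOf c = κ := by
  unfold kindAt at h
  cases hc : ch[k]? with
  | none => simp [hc] at h; exact absurd h.symm hκ
  | some c => simp [hc] at h; exact ⟨c, rfl, h⟩

theorem jumpN_of_bd {a b : Curve} (ha : a.bd = true) (hb : b.bd = true) : jumpN a b = topN a b := by
  simp [jumpN, resid, ha, hb]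

/-- CORE OF (F2): if curve `k` is light or borderline with finite `w₀ = x ≥ 2`… precisely: at a Sing₂, non-top point `i` of a curve
`k` whose `w₀` is finite and `≥ 2`, the node order is `o₀ = 2`: the curve has `w₀ = 2` and the partner `w₀ = 0`. -/
theorem node_of_sing2_not_top {ch : Chain} {k i : ℕ} {c : Curve} (hc : ch[k]? = some c) (hw : ∀ x, c.w.w0 = some x → 2 ≤ x)
    (hi : i ∈ ptsOf ch.length k) (hs : sing2At ch i = true) (ht : topAt ch i = false) :
    c.w.w0 = some 2 ∧ ∃ a b, nodeAt ch i = some (a, b) ∧ ∃ x y : ℕ, a.w.w0 = some x ∧ b.w.w0 = some y ∧ x + y = 2 := by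
  unfold sing2At at hs; unfold topAt at ht
  cases hn : nodeAt ch i with
  | none => simp [hn] at hs
  | some ab =>
    obtain ⟨a, b⟩ := ab
    simp only [hn] at hs ht
    obtain ⟨x, y, hx, hy, hxy⟩ := o0_of_sing2_not_top a b hs ht
    obtain ⟨ha, hb⟩ := nodeAt_some hn
    rcases mem_ptsOf hi with ⟨h1, hik⟩ | ⟨_, rfl⟩
    · -- i + 1 = k : the curve is `b`
      subst hik
      rw [hc] at hb
      obtain rfl : c = b := by simpa using hb
      have := hw y hy
      refine ⟨by rw [hy]; congr 1; omega, a, c, rfl, x, y, hx, hy, by omega⟩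
    · -- i = k : the curve is `a`
      rw [hc] at ha
      obtain rfl : c = a := by simpa using ha
      have := hw x hx
      refine ⟨by rw [hx]; congr 1; omega, c, b, rfl, x, y, hx, hy, by omega⟩

/-- (F2), `A`-accepts, any rule set: the centre has `w₀ = 2`. -/
theorem F2_A (topj : ℕ) (ch : Chain) (k : ℕ) (h : Move.A k ∈ legalMoves topj ch) :
    ∃ c, ch[k]? = some c ∧ c.w.w0 = some 2 := by
  obtain ⟨hk, _⟩ := A_mem_legalMoves topj ch k h
  obtain ⟨c, hc, hκ⟩ := kindAt_some hk (by decide)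
  exact ⟨c, hc, w0_of_borderline c hκ⟩

/-- (F2), `A`-accepts under `G_mult` (`2 ≤ topj`): moreover every Sing₂ point of the centre has node order `o₀ = 2`, i.e. the
partner branch has `w₀ = 0` (at a T-node: `c₀ = 0`). -/
theorem F2_A_node (topj : ℕ) (htop : 2 ≤ topj) (ch : Chain) (k : ℕ) (h : Move.A k ∈ legalMoves topj ch)
    (i : ℕ) (hi : i ∈ ptsOf ch.length k) (hs : sing2At ch i = true) :
    ∃ a b, nodeAt ch i = some (a, b) ∧ ∃ x y : ℕ, a.w.w0 = some x ∧ b.w.w0 = some y ∧ x + y = 2 := by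
  obtain ⟨hk, hjs⟩ := A_mem_legalMoves topj ch k h
  obtain ⟨c, hc, hκ⟩ := kindAt_some hk (by decide)
  have hb : Nat.ble 2 topj = true := by simpa [Nat.ble_eq] using htop
  have ht : topAt ch i = false := by have := hjs i hi; rw [hb] at this; exact ((by simpa using this) : jumpAt ch i = false ∧ topAt ch i = false).2
  have hw : ∀ x, c.w.w0 = some x → 2 ≤ x := by
    intro x hx; have := w0_of_borderline c hκ; rw [this] at hx; simp at hx; omega
  exact (node_of_sing2_not_top hc hw hi hs ht).2

/-- (F2), `AL`-accepts under `G_mult` (indeed any `topj ≥ 1`): the light centre has `w₀ = 2` and every Sing₂ point of it has node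
order `o₀ = 2` (partner `w₀ = 0`; at a T-node `c₀ = 0`). -/
theorem F2_AL (topj : ℕ) (htop : 1 ≤ topj) (ch : Chain) (k : ℕ) (h : Move.AL k ∈ legalMoves topj ch) :
    (∃ c, ch[k]? = some c ∧ c.w.w0 = some 2) ∧
    ∀ i ∈ ptsOf ch.length k, sing2At ch i = true →
      ∃ a b, nodeAt ch i = some (a, b) ∧ ∃ x y : ℕ, a.w.w0 = some x ∧ b.w.w0 = some y ∧ x + y = 2 := by
  obtain ⟨hk, hrel, hjs⟩ := AL_mem_legalMoves topj ch k h
  obtain ⟨c, hc, hκ⟩ := kindAt_some hk (by decide)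
  have hb : Nat.ble 1 topj = true := by simpa [Nat.ble_eq] using htop
  have hw : ∀ x, c.w.w0 = some x → 2 ≤ x := fun x hx => w0_of_light c hκ x hx
  have key : ∀ i ∈ ptsOf ch.length k, sing2At ch i = true →
      c.w.w0 = some 2 ∧ ∃ a b, nodeAt ch i = some (a, b) ∧ ∃ x y : ℕ, a.w.w0 = some x ∧ b.w.w0 = some y ∧ x + y = 2 := by
    intro i hi hs
    have ht : topAt ch i = false := by have := hjs i hi; rw [hb] at this; exact ((by simpa using this) : jumpAt ch i = false ∧ topAt ch i = false).2
    exact node_of_sing2_not_top hc hw hi hs ht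
  obtain ⟨i, hi, hs⟩ := List.any_eq_true.mp hrel
  exact ⟨⟨c, hc, (key i hi hs).1⟩, fun j hj hsj => (key j hj hsj).2⟩

/-- (F2) in mode `uv` (every curve a boundary curve, so jump = top at every node), ANY rule set `topj`: the same conclusions for
`AL`-accepts … -/
theorem F2_AL_bd (topj : ℕ) (ch : Chain) (hbd : ∀ c ∈ ch, c.bd = true) (k : ℕ) (h : Move.AL k ∈ legalMoves topj ch) :
    (∃ c, ch[k]? = some c ∧ c.w.w0 = some 2) ∧
    ∀ i ∈ ptsOf ch.length k, sing2At ch i = true →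
      ∃ a b, nodeAt ch i = some (a, b) ∧ ∃ x y : ℕ, a.w.w0 = some x ∧ b.w.w0 = some y ∧ x + y = 2 := by
  obtain ⟨hk, hrel, hjs⟩ := AL_mem_legalMoves topj ch k h
  obtain ⟨c, hc, hκ⟩ := kindAt_some hk (by decide)
  have hw : ∀ x, c.w.w0 = some x → 2 ≤ x := fun x hx => w0_of_light c hκ x hx
  have key : ∀ i ∈ ptsOf ch.length k, sing2At ch i = true →
      c.w.w0 = some 2 ∧ ∃ a b, nodeAt ch i = some (a, b) ∧ ∃ x y : ℕ, a.w.w0 = some x ∧ b.w.w0 = some y ∧ x + y = 2 := by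
    intro i hi hs
    have hj : jumpAt ch i = false := by have := hjs i hi; simpa using (Bool.or_eq_false_iff.mp this).1
    have ht : topAt ch i = false := by
      unfold jumpAt at hj; unfold topAt
      cases hn : nodeAt ch i with
      | none => simp [hn]
      | some ab =>
        obtain ⟨a, b⟩ := ab
        simp only [hn] at hj ⊢
        obtain ⟨ha, hb'⟩ := nodeAt_some hn
        have hab : a ∈ ch := List.mem_of_getElem? ha
        have hbb : b ∈ ch := List.mem_of_getElem? hb'
        rw [jumpN_of_bd (hbd a hab) (hbd b hbb)] at hj
        exact hj
    exact node_of_sing2_not_top hc hw hi hs ht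
  obtain ⟨i, hi, hs⟩ := List.any_eq_true.mp hrel
  exact ⟨⟨c, hc, (key i hi hs).1⟩, fun j hj hsj => (key j hj hsj).2⟩

/-- … and for `A`-accepts in mode `uv`. -/
theorem F2_A_node_bd (topj : ℕ) (ch : Chain) (hbd : ∀ c ∈ ch, c.bd = true) (k : ℕ) (h : Move.A k ∈ legalMoves topj ch)
    (i : ℕ) (hi : i ∈ ptsOf ch.length k) (hs : sing2At ch i = true) :
    ∃ a b, nodeAt ch i = some (a, b) ∧ ∃ x y : ℕ, a.w.w0 = some x ∧ b.w.w0 = some y ∧ x + y = 2 := by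
  obtain ⟨hk, hjs⟩ := A_mem_legalMoves topj ch k h
  obtain ⟨c, hc, hκ⟩ := kindAt_some hk (by decide)
  have hw : ∀ x, c.w.w0 = some x → 2 ≤ x := by
    intro x hx; have := w0_of_borderline c hκ; rw [this] at hx; simp at hx; omega
  have hj : jumpAt ch i = false := by have := hjs i hi; simpa using (Bool.or_eq_false_iff.mp this).1
  have ht : topAt ch i = false := by
    unfold jumpAt at hj; unfold topAt
    cases hn : nodeAt ch i with
    | none => simp [hn]
    | some ab =>
      obtain ⟨a, b⟩ := ab
      simp only [hn] at hj ⊢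
      obtain ⟨ha, hb'⟩ := nodeAt_some hn
      rw [jumpN_of_bd (hbd a (List.mem_of_getElem? ha)) (hbd b (List.mem_of_getElem? hb'))] at hj
      exact hj
  exact (node_of_sing2_not_top hc hw hi hs ht).2


/-- (F2), isolated point blow-ups: a legal `P i` at a NON-top point (exponent α = 2) has node order `o₀ = 2`, so the newborn curve
`blowup ch i 2` has `w₀ = o₀ − 2 = 0`. -/
theorem F2_P (topj : ℕ) (ch : Chain) (i : ℕ) (h : Move.P i ∈ legalMoves topj ch) (ht : topAt ch i = false) :
    ∃ a b, nodeAt ch i = some (a, b) ∧ ∃ x y : ℕ, a.w.w0 = some x ∧ b.w.w0 = some y ∧ x + y = 2 ∧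
      (blowup ch i 2)[i + 1]? = some ⟨⟨some 0, (a.w.add b.w).w1.map (· + 1 - 2), (a.w.add b.w).w2.map (· + 2 - 2)⟩,
        a.w3 + b.w3 + 3 - 2, true⟩ := by
  obtain ⟨hs, _, _⟩ := P_mem_legalMoves topj ch i h
  unfold sing2At at hs; unfold topAt at ht
  cases hn : nodeAt ch i with
  | none => simp [hn] at hs
  | some ab =>
    obtain ⟨a, b⟩ := ab
    simp only [hn] at hs ht
    obtain ⟨x, y, hx, hy, hxy⟩ := o0_of_sing2_not_top a b hs ht
    obtain ⟨ha, hb⟩ := nodeAt_some hn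
    refine ⟨a, b, rfl, x, y, hx, hy, hxy, ?_⟩
    have hlen : i + 1 ≤ ch.length := by
      have := List.getElem?_eq_some_iff.mp hb
      obtain ⟨hlt, _⟩ := this
      omega
    unfold blowup
    simp only [hn]
    rw [List.getElem?_insertIdx_self, if_pos hlen]
    simp [W3.add, hx, hy, wadd_some, hxy]

/-! ## §B″. LEMMA (3) of loop note §9.15 for ALL chains — an inductive invariant (rev 5, g8) -/

/-- finite `w₀ ≤ 2` -/
def W0le2 (c : Curve) : Prop := ∃ y, c.w.w0 = some y ∧ y ≤ 2

/-- THE INVARIANT behind LEMMA (3): every cubic-weighted curve has `w₀ = 0`, and at every node a cubic-weighted branch faces either a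
node that is not Sing₂ or a partner with finite `w₀ ≤ 2`. -/
def Inv3 (ch : Chain) : Prop :=
  (∀ c ∈ ch, 1 ≤ c.w3 → c.w.w0 = some 0) ∧
  (∀ i a b, nodeAt ch i = some (a, b) →
    (1 ≤ a.w3 → sing2N a b = false ∨ W0le2 b) ∧ (1 ≤ b.w3 → sing2N a b = false ∨ W0le2 a))

/-- initial states (no cubic weight anywhere) satisfy the invariant -/
theorem Inv3_of_noCubic (ch : Chain) (h : ∀ c ∈ ch, c.w3 = 0) : Inv3 ch := by
  refine ⟨fun c hc h1 => ?_, fun i a b hn => ⟨fun h1 => ?_, fun h1 => ?_⟩⟩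
  · have := h c hc; omega
  · obtain ⟨ha, _⟩ := nodeAt_some hn; have := h a (List.mem_of_getElem? ha); omega
  · obtain ⟨_, hb⟩ := nodeAt_some hn; have := h b (List.mem_of_getElem? hb); omega

/-- under the invariant a TOP point has no cubic-weighted branch (`o₃ = 0`) -/
theorem top_noCubic {ch : Chain} (hI : Inv3 ch) {i : ℕ} {a b : Curve} (hn : nodeAt ch i = some (a, b))
    (ht : topN a b = true) : a.w3 = 0 ∧ b.w3 = 0 := by
  obtain ⟨hC, hN⟩ := hI
  obtain ⟨ha, hb⟩ := nodeAt_some hn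
  have hs : sing2N a b = true := by unfold topN at ht; simp only [Bool.and_eq_true] at ht; exact ht.1
  have hd : wge (wadd a.w.w0 b.w.w0) 3 = true := by
    unfold topN isDeepW W3.ge W3.add at ht; simp only [Bool.and_eq_true] at ht; exact ht.2.1.1
  obtain ⟨h1, h2⟩ := hN i a b hn
  constructor
  · by_contra hne
    have h1' : 1 ≤ a.w3 := by omega
    have ha0 := hC a (List.mem_of_getElem? ha) h1'
    rcases h1 h1' with hdead | ⟨y, hy, hy2⟩
    · rw [hdead] at hs; exact Bool.false_ne_true hs
    · rw [ha0, hy, wadd_some, wge_some, decide_eq_true_eq] at hd; omega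
  · by_contra hne
    have h1' : 1 ≤ b.w3 := by omega
    have hb0 := hC b (List.mem_of_getElem? hb) h1'
    rcases h2 h1' with hdead | ⟨y, hy, hy2⟩
    · rw [hdead] at hs; exact Bool.false_ne_true hs
    · rw [hb0, hy, wadd_some, wge_some, decide_eq_true_eq] at hd; omega

/-! ### what the move generator can emit (continued) -/

theorem jumpN_topN {a b : Curve} (h : jumpN a b = true) : topN a b = true := by
  unfold jumpN at h; simp only [Bool.and_eq_true] at h; exact h.1

theorem topAt_of_jumpAt {ch : Chain} {i : ℕ} (h : jumpAt ch i = true) : topAt ch i = true := by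
  unfold jumpAt at h; unfold topAt
  cases hn : nodeAt ch i with
  | none => simp [hn] at h
  | some ab => obtain ⟨a, b⟩ := ab; simp only [hn] at h ⊢; exact jumpN_topN h

/-- An `I i` move is emitted only at a TOP point. -/
theorem I_mem_legalMoves (topj : ℕ) (ch : Chain) (i : ℕ) (h : Move.I i ∈ legalMoves topj ch) : topAt ch i = true := by
  unfold legalMoves at h
  dsimp only at h
  split at h
  · simp at h
  · simp only [List.mem_append, List.mem_flatMap, List.mem_map, List.mem_filter, List.mem_range] at h
    rcases h with ⟨k', hk', hm⟩ | ⟨j, hj, hji⟩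
    · split at hm
      · split at hm
        · simp at hm
        · simp only [List.mem_map, List.mem_filter, Move.I.injEq] at hm
          obtain ⟨i', ⟨_, hc⟩, rfl⟩ := hm
          rcases Bool.or_eq_true_iff.mp hc with hc | hc
          · exact topAt_of_jumpAt hc
          · exact (Bool.and_eq_true_iff.mp hc).2
      · split at hm
        · split at hm
          · simp at hm
          · simp only [List.mem_map, List.mem_filter, Move.I.injEq] at hm
            obtain ⟨i', ⟨_, hc⟩, rfl⟩ := hm
            rcases Bool.or_eq_true_iff.mp hc with hc | hc
            · exact topAt_of_jumpAt hc
            · exact (Bool.and_eq_true_iff.mp hc).2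
        · simp at hm
      · simp at hm
    · simp at hji

/-- A `D k` move is emitted only for a DEEP curve `k`. -/
theorem D_mem_legalMoves (topj : ℕ) (ch : Chain) (k : ℕ) (h : Move.D k ∈ legalMoves topj ch) : kindAt ch k = .deep := by
  unfold legalMoves at h
  dsimp only at h
  generalize hf : List.filter (fun k => kindAt ch k == Kind.deep) (List.range ch.length) = fl at h
  cases fl with
  | cons k' tl =>
    simp only [List.mem_singleton, Move.D.injEq] at h
    subst h
    have : k ∈ List.filter (fun k => kindAt ch k == Kind.deep) (List.range ch.length) := by rw [hf]; exact List.mem_cons_self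
    simpa using (List.mem_filter.mp this).2
  | nil =>
    simp only [List.mem_append, List.mem_flatMap, List.mem_map, List.mem_filter, List.mem_range] at h
    rcases h with ⟨k', hk', hm⟩ | ⟨j, hj, hji⟩
    · split at hm
      · split at hm <;> simp at hm
      · split at hm <;> [split at hm <;> simp at hm; simp at hm]
      · simp at hm
    · simp at hji

theorem kindOf_deep {c : Curve} (h : kindOf c = .deep) : c.bd = true ∧ isDeepW c.w = true := by
  unfold kindOf at h
  cases hbd : c.bd <;> cases hD : isDeepW c.w <;> cases hS : isSingW c.w <;> cases hC : isCW c.w <;> simp [hbd, hD, hS, hC] at h ⊢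

theorem kindOf_bd {c : Curve} (h : kindOf c = .borderline ∨ kindOf c = .light) : c.bd = true := by
  unfold kindOf at h
  cases hbd : c.bd <;> cases hD : isDeepW c.w <;> cases hS : isSingW c.w <;> cases hC : isCW c.w <;> simp [hbd, hD, hS, hC] at h ⊢

/-! ### monotonicity of «not Sing₂» under accepts of a boundary branch -/

theorem ble_false_iff (t n : ℕ) : Nat.ble t n = false ↔ n < t := by
  rw [Bool.eq_false_iff, Ne, Nat.ble_eq, not_le]

theorem sing2N_mono_left {a a' b : Curve} (ha : a.bd = true) (ha' : a'.bd = true) (d0 d1 d2 : ℕ) (hw : a'.w = a.w.sub d0 d1 d2)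
    (h : sing2N a b = false) : sing2N a' b = false := by
  rw [Bool.eq_false_iff] at h ⊢
  intro h'; apply h
  unfold sing2N resid at h' ⊢
  rw [hw] at h'
  rcases a with ⟨⟨_ | a0, _ | a1, _ | a2⟩, a3, abd⟩ <;> rcases a' with ⟨w', a3', abd'⟩ <;> rcases b with ⟨⟨_ | b0, _ | b1, _ | b2⟩, b3, _ | _⟩ <;>
    simp only at ha ha' hw <;> subst ha ha' hw <;> (simp only [ble_false_iff, Nat.ble_eq, isDeepW, isSingW, isCW, W3.ge, W3.add, W3.sub, finPos, wge_some, wge_none, wadd_some, wadd_none_l, wadd_none_r, Option.map_some, Option.map_none, Option.map, Bool.and_eq_true, Bool.or_eq_true, Bool.not_eq_true', Bool.not_eq_eq_eq_not, Bool.not_true, Bool.not_false, Bool.and_eq_false_eq_eq_false_or_eq_false, decide_eq_true_eq, decide_eq_false_iff_not, not_le, Bool.true_and, Bool.and_true, true_and, and_true, Bool.false_eq_true, Bool.true_eq_false, false_or, or_false, Option.some.injEq, reduceCtorEq, false_and, and_false, or_true, true_or, exists_and_left, exists_and_right, exists_eq_left, exists_eq_left', exists_eq_right, exists_eq_right', exists_eq',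 exists_false, exists_const, false_iff, iff_false, not_false_eq_true, not_true_eq_false, ite_true, ite_false, if_true, if_false, Bool.true_or, Bool.or_true, Bool.false_or, Bool.or_false, imp_false, not_lt] at *) <;> omega

theorem sing2N_mono_right {a b b' : Curve} (hb : b.bd = true) (hb' : b'.bd = true) (d0 d1 d2 : ℕ) (hw : b'.w = b.w.sub d0 d1 d2)
    (h : sing2N a b = false) : sing2N a b' = false := by
  rw [Bool.eq_false_iff] at h ⊢
  intro h'; apply h
  unfold sing2N resid at h' ⊢
  rw [hw] at h'
  rcases b with ⟨⟨_ | b0, _ | b1, _ | b2⟩, b3, bbd⟩ <;> rcases b' with ⟨w', b3', bbd'⟩ <;> rcases a with ⟨⟨_ | a0, _ | a1, _ | a2⟩, a3, _ | _⟩ <;>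
    simp only at hb hb' hw <;> subst hb hb' hw <;> (simp only [ble_false_iff, Nat.ble_eq, isDeepW, isSingW, isCW, W3.ge, W3.add, W3.sub, finPos, wge_some, wge_none, wadd_some, wadd_none_l, wadd_none_r, Option.map_some, Option.map_none, Option.map, Bool.and_eq_true, Bool.or_eq_true, Bool.not_eq_true', Bool.not_eq_eq_eq_not, Bool.not_true, Bool.not_false, Bool.and_eq_false_eq_eq_false_or_eq_false, decide_eq_true_eq, decide_eq_false_iff_not, not_le, Bool.true_and, Bool.and_true, true_and, and_true, Bool.false_eq_true, Bool.true_eq_false, false_or, or_false, Option.some.injEq, reduceCtorEq, false_and, and_false, or_true, true_or, exists_and_left, exists_and_right, exists_eq_left, exists_eq_left', exists_eq_right, exists_eq_right', exists_eq', exists_false, exists_const, false_iff, iff_false, not_false_eq_true, not_true_eq_false, ite_true, ite_false, if_true, if_false, Bool.true_or, Bool.or_true, Bool.false_or, Bool.or_false, imp_false, not_lt] at *) <;> omega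


/-! ### transport of members and nodes through `List.modify` / `List.insertIdx` -/

theorem mem_modify_cases {ch : Chain} {k : ℕ} {f : Curve → Curve} {c : Curve} (h : c ∈ ch.modify k f) :
    c ∈ ch ∨ ∃ c₀, ch[k]? = some c₀ ∧ c = f c₀ := by
  obtain ⟨j, hj⟩ := List.mem_iff_getElem?.mp h
  rw [List.getElem?_modify] at hj
  cases hc : ch[j]? with
  | none => simp [hc] at hj
  | some c₀ =>
    simp [hc] at hj
    by_cases hkj : k = j
    · subst hkj; simp at hj; exact Or.inr ⟨c₀, hc, hj.symm⟩
    · simp [hkj] at hj; subst hj; exact Or.inl (List.mem_of_getElem? hc)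

theorem nodeAt_modify_cases {ch : Chain} {k : ℕ} {f : Curve → Curve} {j : ℕ} {a' b' : Curve}
    (h : nodeAt (ch.modify k f) j = some (a', b')) :
    ∃ a b, nodeAt ch j = some (a, b) ∧ a' = (if k = j then f a else a) ∧ b' = (if k = j + 1 then f b else b) := by
  unfold nodeAt at h ⊢
  rw [List.getElem?_modify, List.getElem?_modify] at h
  cases ha : ch[j]? with
  | none => simp [ha] at h
  | some a =>
    cases hb : ch[j+1]? with
    | none => simp [ha, hb] at h
    | some b =>
      refine ⟨a, b, rfl, ?_, ?_⟩
      · by_cases h1 : k = j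
        · subst h1; simp [ha, hb] at h; rw [if_pos rfl]; exact h.1.symm
        · simp [ha, hb, h1] at h; rw [if_neg h1]; exact h.1.symm
      · by_cases h2 : k = j + 1
        · subst h2; simp [ha, hb] at h; rw [if_pos rfl]; exact h.2.symm
        · simp [ha, hb, h2] at h; rw [if_neg h2]; exact h.2.symm

theorem nodeAt_insertIdx_cases {ch : Chain} {i : ℕ} {Γ : Curve} {j : ℕ} {a' b' : Curve} (hi : i + 1 ≤ ch.length)
    (h : nodeAt (ch.insertIdx (i + 1) Γ) j = some (a', b')) :
    nodeAt ch j = some (a', b') ∨ (j = i ∧ ch[i]? = some a' ∧ b' = Γ) ∨ (j = i + 1 ∧ a' = Γ ∧ ch[i+1]? = some b') ∨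
      (i + 2 ≤ j ∧ nodeAt ch (j - 1) = some (a', b')) := by
  unfold nodeAt at h ⊢
  rw [List.getElem?_insertIdx, List.getElem?_insertIdx] at h
  rcases Nat.lt_trichotomy j i with hlt | heq | hgt
  · rw [if_pos (by omega : j < i + 1), if_pos (by omega : j + 1 < i + 1)] at h
    exact Or.inl h
  · subst heq
    rw [if_pos (by omega : j < j + 1), if_neg (lt_irrefl _), if_pos rfl, if_pos hi] at h
    cases ha : ch[j]? with
    | none => simp [ha] at h
    | some a => simp [ha] at h; exact Or.inr (Or.inl ⟨rfl, by rw [h.1], h.2.symm⟩)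
  · rcases Nat.lt_or_ge j (i + 2) with hj | hj
    · have hji : j = i + 1 := by omega
      subst hji
      rw [if_neg (lt_irrefl _), if_pos rfl, if_pos hi, if_neg (by omega : ¬ i + 1 + 1 < i + 1),
        if_neg (by omega : i + 1 + 1 ≠ i + 1), Nat.add_sub_cancel] at h
      cases hb : ch[i+1]? with
      | none => simp [hb] at h
      | some b => simp [hb] at h; exact Or.inr (Or.inr (Or.inl ⟨rfl, h.1.symm, by rw [h.2]⟩))
    · rw [if_neg (by omega : ¬ j < i + 1), if_neg (by omega : j ≠ i + 1), if_neg (by omega : ¬ j + 1 < i + 1),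
        if_neg (by omega : j + 1 ≠ i + 1), Nat.add_sub_cancel] at h
      refine Or.inr (Or.inr (Or.inr ⟨hj, ?_⟩))
      rw [Nat.sub_add_cancel (by omega : 1 ≤ j)]
      exact h

/-! ### generic preservation through one modified curve / one inserted curve -/

theorem Inv3_modify {ch : Chain} (hI : Inv3 ch) {k : ℕ} {K : Curve} (hK : ch[k]? = some K) (f : Curve → Curve)
    (hC : 1 ≤ (f K).w3 → (f K).w.w0 = some 0)
    (hL : ∀ j a, nodeAt ch j = some (a, K) → j + 1 = k →
      (1 ≤ a.w3 → sing2N a (f K) = false ∨ W0le2 (f K)) ∧ (1 ≤ (f K).w3 → sing2N a (f K) = false ∨ W0le2 a))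
    (hR : ∀ b, nodeAt ch k = some (K, b) →
      (1 ≤ (f K).w3 → sing2N (f K) b = false ∨ W0le2 b) ∧ (1 ≤ b.w3 → sing2N (f K) b = false ∨ W0le2 (f K))) :
    Inv3 (ch.modify k f) := by
  obtain ⟨hC0, hN0⟩ := hI
  constructor
  · intro c hc h1
    rcases mem_modify_cases hc with hc | ⟨c₀, hc₀, rfl⟩
    · exact hC0 c hc h1
    · have : c₀ = K := Option.some.inj (hc₀.symm.trans hK)
      subst this; exact hC h1
  · intro j a' b' hn
    obtain ⟨a, b, hn0, rfl, rfl⟩ := nodeAt_modify_cases hn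
    obtain ⟨ha, hb⟩ := nodeAt_some hn0
    by_cases h1 : k = j
    · subst h1
      have haK : a = K := Option.some.inj (ha.symm.trans hK)
      subst haK
      rw [if_pos rfl, if_neg (by omega : k ≠ k + 1)]
      exact hR b hn0
    · rw [if_neg h1]
      by_cases h2 : k = j + 1
      · subst h2
        have hbK : b = K := Option.some.inj (hb.symm.trans hK)
        subst hbK
        rw [if_pos rfl]
        exact hL j a hn0 rfl
      · rw [if_neg h2]; exact hN0 j a b hn0

theorem Inv3_insert {ch : Chain} (hI : Inv3 ch) {i : ℕ} {a b : Curve} (hn : nodeAt ch i = some (a, b)) (Γ : Curve)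
    (hΓ : 1 ≤ Γ.w3 → Γ.w.w0 = some 0)
    (h1 : 1 ≤ a.w3 → sing2N a Γ = false ∨ W0le2 Γ) (h2 : 1 ≤ Γ.w3 → sing2N a Γ = false ∨ W0le2 a)
    (h3 : 1 ≤ Γ.w3 → sing2N Γ b = false ∨ W0le2 b) (h4 : 1 ≤ b.w3 → sing2N Γ b = false ∨ W0le2 Γ) :
    Inv3 (ch.insertIdx (i + 1) Γ) := by
  obtain ⟨hC0, hN0⟩ := hI
  obtain ⟨ha, hb⟩ := nodeAt_some hn
  have hi : i + 1 ≤ ch.length := by have := (List.getElem?_eq_some_iff.mp hb).1; omega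
  constructor
  · intro c hc hc1
    rcases List.eq_or_mem_of_mem_insertIdx hc with rfl | hc
    · exact hΓ hc1
    · exact hC0 c hc hc1
  · intro j a' b' hn'
    rcases nodeAt_insertIdx_cases hi hn' with h | ⟨rfl, ha', rfl⟩ | ⟨rfl, rfl, hb'⟩ | ⟨_, h⟩
    · exact hN0 j a' b' h
    · have : a' = a := Option.some.inj (ha'.symm.trans ha)
      subst this; exact ⟨h1, h2⟩
    · have : b' = b := Option.some.inj (hb'.symm.trans hb)
      subst this; exact ⟨h3, h4⟩
    · exact hN0 (j - 1) a' b' h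

/-! ### the four kinds of move -/

theorem Inv3_blowup3 {ch : Chain} (hI : Inv3 ch) {i : ℕ} (ht : topAt ch i = true) : Inv3 (blowup ch i 3) := by
  unfold topAt at ht
  unfold blowup
  cases hn : nodeAt ch i with
  | none => simp [hn] at ht
  | some ab =>
    obtain ⟨a, b⟩ := ab
    simp only [hn] at ht ⊢
    obtain ⟨ha3, hb3⟩ := top_noCubic hI hn ht
    refine Inv3_insert hI hn _ ?_ ?_ ?_ ?_ ?_
    · intro h; exfalso; simp only at h; omega
    · intro h; exfalso; omega
    · intro h; exfalso; simp only at h; omega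
    · intro h; exfalso; simp only at h; omega
    · intro h; exfalso; omega

theorem Inv3_blowup2 {ch : Chain} (hI : Inv3 ch) {i : ℕ} (hs : sing2At ch i = true) (ht : topAt ch i = false) :
    Inv3 (blowup ch i 2) := by
  unfold sing2At at hs; unfold topAt at ht; unfold blowup
  cases hn : nodeAt ch i with
  | none => simp [hn] at hs
  | some ab =>
    obtain ⟨a, b⟩ := ab
    simp only [hn] at hs ht ⊢
    obtain ⟨x, y, hx, hy, hxy⟩ := o0_of_sing2_not_top a b hs ht
    have hΓ0 : ((a.w.add b.w).w0.map (· - 2)) = some 0 := by simp [W3.add, hx, hy, wadd_some]; omega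
    refine Inv3_insert hI hn _ ?_ ?_ ?_ ?_ ?_
    · intro _; exact hΓ0
    · intro _; exact Or.inr ⟨0, hΓ0, by omega⟩
    · intro _; exact Or.inr ⟨x, hx, by omega⟩
    · intro _; exact Or.inr ⟨y, hy, by omega⟩
    · intro _; exact Or.inr ⟨0, hΓ0, by omega⟩

/-- what the accept case needs from (F2) (available under `G_mult`, and in mode `uv` for any rule set: `F2facts_of_topj`,
`F2facts_of_bd`) -/
def F2facts (topj : ℕ) (ch : Chain) : Prop :=
  ∀ k, (Move.A k ∈ legalMoves topj ch ∨ Move.AL k ∈ legalMoves topj ch) →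
    (∃ c, ch[k]? = some c ∧ c.w.w0 = some 2) ∧
    ∀ i ∈ ptsOf ch.length k, sing2At ch i = true →
      ∃ a b, nodeAt ch i = some (a, b) ∧ ∃ x y : ℕ, a.w.w0 = some x ∧ b.w.w0 = some y ∧ x + y = 2

theorem F2facts_of_topj {topj : ℕ} (htop : 2 ≤ topj) (ch : Chain) : F2facts topj ch := by
  intro k hk
  rcases hk with hk | hk
  · exact ⟨F2_A topj ch k hk, fun i hi hs => F2_A_node topj htop ch k hk i hi hs⟩
  · exact F2_AL topj (by omega) ch k hk

theorem F2facts_of_bd (topj : ℕ) (ch : Chain) (hbd : ∀ c ∈ ch, c.bd = true) : F2facts topj ch := by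
  intro k hk
  rcases hk with hk | hk
  · exact ⟨F2_A topj ch k hk, fun i hi hs => F2_A_node_bd topj ch hbd k hk i hi hs⟩
  · exact F2_AL_bd topj ch hbd k hk

theorem mem_ptsOf_left {n k j : ℕ} (h : j + 1 = k) : j ∈ ptsOf n k := by
  unfold ptsOf; rw [List.mem_append]; left; rw [if_pos (by omega)]; simp; omega

theorem mem_ptsOf_right {n k : ℕ} (h : k + 1 < n) : k ∈ ptsOf n k := by
  unfold ptsOf; rw [List.mem_append]; right; rw [if_pos h]; simp

theorem Inv3_accept {topj : ℕ} {ch : Chain} (hF : F2facts topj ch) (hI : Inv3 ch) {k : ℕ}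
    (hm : Move.A k ∈ legalMoves topj ch ∨ Move.AL k ∈ legalMoves topj ch)
    (hkind : kindAt ch k = .borderline ∨ kindAt ch k = .light) :
    Inv3 (ch.modify k (fun c => { c with w := c.w.sub 2 1 0, w3 := c.w3 + 1 })) := by
  obtain ⟨⟨K, hK, hK2⟩, hnode⟩ := hF k hm
  have hKbd : K.bd = true := by
    rcases hkind with h | h
    · obtain ⟨K', hK', hκ⟩ := kindAt_some h (by decide)
      have : K' = K := Option.some.inj (hK'.symm.trans hK)
      subst this; exact kindOf_bd (Or.inl hκ)
    · obtain ⟨K', hK', hκ⟩ := kindAt_some h (by decide)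
      have : K' = K := Option.some.inj (hK'.symm.trans hK)
      subst this; exact kindOf_bd (Or.inr hκ)
  have hK0 : (K.w.sub 2 1 0).w0 = some 0 := by simp [W3.sub, hK2]
  refine Inv3_modify hI hK _ ?_ ?_ ?_
  · intro _; exact hK0
  · intro j a hn0 hj
    refine ⟨fun _ => Or.inr ⟨0, hK0, by omega⟩, fun _ => ?_⟩
    cases hsn : sing2N a K with
    | false => exact Or.inl (sing2N_mono_right hKbd hKbd 2 1 0 rfl hsn)
    | true =>
      have hs : sing2At ch j = true := by unfold sing2At; simp only [hn0]; exact hsn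
      obtain ⟨a₁, b₁, hn1, x, y, hx, hy, hxy⟩ := hnode j (mem_ptsOf_left hj) hs
      rw [hn0] at hn1
      obtain ⟨rfl, rfl⟩ := Prod.mk.inj (Option.some.inj hn1)
      rw [hK2] at hy
      have : y = 2 := by simpa using hy.symm
      exact Or.inr ⟨x, hx, by omega⟩
  · intro b hn0
    refine ⟨fun _ => ?_, fun _ => Or.inr ⟨0, hK0, by omega⟩⟩
    cases hsn : sing2N K b with
    | false => exact Or.inl (sing2N_mono_left hKbd hKbd 2 1 0 rfl hsn)
    | true =>
      have hs : sing2At ch k = true := by unfold sing2At; simp only [hn0]; exact hsn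
      have hlt : k + 1 < ch.length := (List.getElem?_eq_some_iff.mp (nodeAt_some hn0).2).1
      obtain ⟨a₁, b₁, hn1, x, y, hx, hy, hxy⟩ := hnode k (mem_ptsOf_right hlt) hs
      rw [hn0] at hn1
      obtain ⟨rfl, rfl⟩ := Prod.mk.inj (Option.some.inj hn1)
      rw [hK2] at hx
      have : x = 2 := by simpa using hx.symm
      exact Or.inr ⟨y, hy, by omega⟩

theorem Inv3_deep {ch : Chain} (hI : Inv3 ch) {k : ℕ} (hk : kindAt ch k = .deep) :
    Inv3 (ch.modify k (fun c => { c with w := c.w.sub 3 2 1 })) := by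
  obtain ⟨K, hK, hκ⟩ := kindAt_some hk (by decide)
  obtain ⟨hKbd, hKdeep⟩ := kindOf_deep hκ
  have hw3 : wge K.w.w0 3 = true := by
    unfold isDeepW W3.ge at hKdeep; simp only [Bool.and_eq_true] at hKdeep; exact hKdeep.1.1
  have hK3 : K.w3 = 0 := by
    by_contra hne
    have h0 := hI.1 K (List.mem_of_getElem? hK) (by omega)
    rw [h0, wge_some, decide_eq_true_eq] at hw3; omega
  have hnotle : ¬ W0le2 K := by
    rintro ⟨y, hy, hy2⟩
    rw [hy, wge_some, decide_eq_true_eq] at hw3; omega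
  refine Inv3_modify hI hK _ ?_ ?_ ?_
  · intro h1; exfalso; simp only at h1; omega
  · intro j a hn0 _
    refine ⟨fun ha1 => Or.inl ?_, fun h1 => ?_⟩
    · rcases (hI.2 j a K hn0).1 ha1 with hdead | hle
      · exact sing2N_mono_right hKbd hKbd 3 2 1 rfl hdead
      · exact absurd hle hnotle
    · exfalso; simp only at h1; omega
  · intro b hn0
    refine ⟨fun h1 => ?_, fun hb1 => Or.inl ?_⟩
    · exfalso; simp only at h1; omega
    · rcases (hI.2 k K b hn0).2 hb1 with hdead | hle
      · exact sing2N_mono_left hKbd hKbd 3 2 1 rfl hdead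
      · exact absurd hle hnotle

/-- ONE MOVE: the invariant is preserved by every legal move (given the (F2) facts for accepts). -/
theorem Inv3_step (topj : ℕ) (ch : Chain) (hF : F2facts topj ch) (hI : Inv3 ch) (m : Move) (hm : m ∈ legalMoves topj ch) :
    Inv3 (applyMove ch m) := by
  cases m with
  | D k => exact Inv3_deep hI (D_mem_legalMoves topj ch k hm)
  | A k => exact Inv3_accept hF hI (Or.inl hm) (Or.inl (A_mem_legalMoves topj ch k hm).1)
  | AL k => exact Inv3_accept hF hI (Or.inr hm) (Or.inr (AL_mem_legalMoves topj ch k hm).1)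
  | I i => exact Inv3_blowup3 hI (I_mem_legalMoves topj ch i hm)
  | P i =>
    obtain ⟨hs, _, _⟩ := P_mem_legalMoves topj ch i hm
    show Inv3 (blowup ch i (if topAt ch i then 3 else 2))
    cases ht : topAt ch i with
    | true => rw [if_pos rfl]; exact Inv3_blowup3 hI ht
    | false => rw [if_neg Bool.false_ne_true]; exact Inv3_blowup2 hI hs ht

/-! ### plays -/

theorem applyMoves_cons (ch : Chain) (m : Move) (l : List Move) : applyMoves ch (m :: l) = applyMoves (applyMove ch m) l := rfl

theorem isLegalPlay_cons {topj : ℕ} {ch : Chain} {m : Move} {l : List Move} (h : isLegalPlay topj ch (m :: l) = true) :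
    m ∈ legalMoves topj ch ∧ isLegalPlay topj (applyMove ch m) l = true := by
  simp only [isLegalPlay, Bool.and_eq_true] at h
  exact ⟨by simpa using h.1, h.2⟩

theorem isLegalPlay_append {topj : ℕ} : ∀ (l₁ l₂ : List Move) (ch : Chain),
    isLegalPlay topj ch (l₁ ++ l₂) = true → isLegalPlay topj ch l₁ = true ∧ isLegalPlay topj (applyMoves ch l₁) l₂ = true := by
  intro l₁
  induction l₁ with
  | nil => intro l₂ ch h; exact ⟨rfl, h⟩
  | cons m l ih =>
    intro l₂ ch h
    rw [List.cons_append] at h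
    obtain ⟨hm, hl⟩ := isLegalPlay_cons h
    obtain ⟨h1, h2⟩ := ih l₂ (applyMove ch m) hl
    refine ⟨?_, by rw [applyMoves_cons]; exact h2⟩
    simp only [isLegalPlay, Bool.and_eq_true]
    exact ⟨by simpa using hm, h1⟩

theorem bd_applyMove {ch : Chain} (hbd : ∀ c ∈ ch, c.bd = true) (m : Move) : ∀ c ∈ applyMove ch m, c.bd = true := by
  intro c hc
  have hmod : ∀ (k : ℕ) (f : Curve → Curve), (∀ c, (f c).bd = c.bd) → c ∈ ch.modify k f → c.bd = true := by
    intro k f hf hc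
    rcases mem_modify_cases hc with hc | ⟨c₀, hc₀, rfl⟩
    · exact hbd c hc
    · rw [hf]; exact hbd c₀ (List.mem_of_getElem? hc₀)
  have hbl : ∀ (i α : ℕ), c ∈ blowup ch i α → c.bd = true := by
    intro i α hc
    unfold blowup at hc
    cases hn : nodeAt ch i with
    | none => simp only [hn] at hc; exact hbd c hc
    | some ab =>
      obtain ⟨a, b⟩ := ab
      simp only [hn] at hc
      rcases List.eq_or_mem_of_mem_insertIdx hc with rfl | hc
      · rfl
      · exact hbd c hc
  cases m with
  | D k => exact hmod k (fun c => { c with w := c.w.sub 3 2 1 }) (fun _ => rfl) hc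
  | A k => exact hmod k (fun c => { c with w := c.w.sub 2 1 0, w3 := c.w3 + 1 }) (fun _ => rfl) hc
  | AL k => exact hmod k (fun c => { c with w := c.w.sub 2 1 0, w3 := c.w3 + 1 }) (fun _ => rfl) hc
  | I i => exact hbl i 3 hc
  | P i => exact hbl i _ hc

/-- ALL PLAYS under `G_mult` (any `topj ≥ 2`): the invariant holds along every legal play from a state satisfying it. -/
theorem Inv3_play {topj : ℕ} (htop : 2 ≤ topj) : ∀ (l : List Move) (ch : Chain),
    Inv3 ch → isLegalPlay topj ch l = true → Inv3 (applyMoves ch l) := by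
  intro l
  induction l with
  | nil => intro ch hI _; exact hI
  | cons m l ih =>
    intro ch hI hl
    obtain ⟨hm, hl'⟩ := isLegalPlay_cons hl
    rw [applyMoves_cons]
    exact ih (applyMove ch m) (Inv3_step topj ch (F2facts_of_topj htop ch) hI m hm) hl'

/-- ALL PLAYS in mode `uv` (every curve a boundary curve), any rule set. -/
theorem Inv3_play_bd (topj : ℕ) : ∀ (l : List Move) (ch : Chain), (∀ c ∈ ch, c.bd = true) →
    Inv3 ch → isLegalPlay topj ch l = true → Inv3 (applyMoves ch l) := by
  intro l
  induction l with
  | nil => intro ch _ hI _; exact hI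
  | cons m l ih =>
    intro ch hbd hI hl
    obtain ⟨hm, hl'⟩ := isLegalPlay_cons hl
    rw [applyMoves_cons]
    exact ih (applyMove ch m) (bd_applyMove hbd m) (Inv3_step topj ch (F2facts_of_bd topj ch hbd) hI m hm) hl'

theorem node_of_topAt {ch : Chain} {i : ℕ} (ht : topAt ch i = true) : ∃ a b, nodeAt ch i = some (a, b) ∧ topN a b = true := by
  unfold topAt at ht
  cases hn : nodeAt ch i with
  | none => simp [hn] at ht
  | some ab => obtain ⟨a, b⟩ := ab; simp only [hn] at ht; exact ⟨a, b, rfl, ht⟩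

/-- α = 3 blow-ups of a legal play happen at points with `o₃ = 0` whenever the invariant holds at that moment. -/
theorem alpha3_noCubic {topj : ℕ} {s : Chain} (hI : Inv3 s) {m : Move} (hm : m ∈ legalMoves topj s) (i : ℕ)
    (h : m = .I i ∨ (m = .P i ∧ topAt s i = true)) : ∃ a b, nodeAt s i = some (a, b) ∧ a.w3 = 0 ∧ b.w3 = 0 := by
  have ht : topAt s i = true := by
    rcases h with rfl | ⟨rfl, ht⟩
    · exact I_mem_legalMoves topj s i hm
    · exact ht
  obtain ⟨a, b, hn, htn⟩ := node_of_topAt ht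
  exact ⟨a, b, hn, top_noCubic hI hn htn⟩

/-- LEMMA (3) of loop note §9.15 for ALL CHAINS under `G_mult` (indeed any rule set with `topj ≥ 2`): in every legal play from a state
without cubic weight, every α = 3 blow-up — every `I`-move and every `P`-move at a top point — happens at a point with `o₃ = 0`
(so every α = 3 newborn has `w₃ = 0`). -/
theorem lemma3_gmult {topj : ℕ} (htop : 2 ≤ topj) (ch₀ : Chain) (h0 : ∀ c ∈ ch₀, c.w3 = 0)
    (l₁ : List Move) (m : Move) (l₂ : List Move) (hl : isLegalPlay topj ch₀ (l₁ ++ m :: l₂) = true) (i : ℕ)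
    (h : m = .I i ∨ (m = .P i ∧ topAt (applyMoves ch₀ l₁) i = true)) :
    ∃ a b, nodeAt (applyMoves ch₀ l₁) i = some (a, b) ∧ a.w3 = 0 ∧ b.w3 = 0 := by
  obtain ⟨h1, h2⟩ := isLegalPlay_append l₁ (m :: l₂) ch₀ hl
  obtain ⟨hm, _⟩ := isLegalPlay_cons h2
  exact alpha3_noCubic (Inv3_play htop l₁ ch₀ (Inv3_of_noCubic ch₀ h0) h1) hm i h

/-- LEMMA (3) for ALL CHAINS in mode `uv` (all curves boundary curves), any rule set `topj`. -/
theorem lemma3_uv (topj : ℕ) (ch₀ : Chain) (hbd : ∀ c ∈ ch₀, c.bd = true) (h0 : ∀ c ∈ ch₀, c.w3 = 0)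
    (l₁ : List Move) (m : Move) (l₂ : List Move) (hl : isLegalPlay topj ch₀ (l₁ ++ m :: l₂) = true) (i : ℕ)
    (h : m = .I i ∨ (m = .P i ∧ topAt (applyMoves ch₀ l₁) i = true)) :
    ∃ a b, nodeAt (applyMoves ch₀ l₁) i = some (a, b) ∧ a.w3 = 0 ∧ b.w3 = 0 := by
  obtain ⟨h1, h2⟩ := isLegalPlay_append l₁ (m :: l₂) ch₀ hl
  obtain ⟨hm, _⟩ := isLegalPlay_cons h2
  exact alpha3_noCubic (Inv3_play_bd topj l₁ ch₀ hbd (Inv3_of_noCubic ch₀ h0) h1) hm i h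

/-- … and the invariant's first clause along the play: every cubic-weighted curve ever present has `w₀ = 0` (the accepted lines
and the (Q₂)-lines of §9.15 (3)). -/
theorem cubic_w0_gmult {topj : ℕ} (htop : 2 ≤ topj) (ch₀ : Chain) (h0 : ∀ c ∈ ch₀, c.w3 = 0) (l : List Move)
    (hl : isLegalPlay topj ch₀ l = true) : ∀ c ∈ applyMoves ch₀ l, 1 ≤ c.w3 → c.w.w0 = some 0 :=
  (Inv3_play htop l ch₀ (Inv3_of_noCubic ch₀ h0) hl).1


/-! ### THEOREM (4) of §9.15, the CENTRES half, for all chains -/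

/-- under the invariant (and the (F2) facts) every accepted centre — `D`, `A` or `AL` — has cubic weight `w₃ = 0` -/
theorem centre_monic {topj : ℕ} {s : Chain} (hF : F2facts topj s) (hI : Inv3 s) {m : Move} (hm : m ∈ legalMoves topj s)
    (k : ℕ) (h : m = .D k ∨ m = .A k ∨ m = .AL k) : ∃ K, s[k]? = some K ∧ K.w3 = 0 := by
  rcases h with rfl | rfl | rfl
  · obtain ⟨K, hK, hκ⟩ := kindAt_some (D_mem_legalMoves topj s k hm) (by decide)
    refine ⟨K, hK, ?_⟩
    obtain ⟨_, hKdeep⟩ := kindOf_deep hκ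
    have hw3 : wge K.w.w0 3 = true := by
      unfold isDeepW W3.ge at hKdeep; simp only [Bool.and_eq_true] at hKdeep; exact hKdeep.1.1
    by_contra hne
    rw [hI.1 K (List.mem_of_getElem? hK) (by omega), wge_some, decide_eq_true_eq] at hw3; omega
  · obtain ⟨⟨K, hK, hK2⟩, _⟩ := hF k (Or.inl hm)
    refine ⟨K, hK, ?_⟩
    by_contra hne
    rw [hI.1 K (List.mem_of_getElem? hK) (by omega)] at hK2; simp at hK2
  · obtain ⟨⟨K, hK, hK2⟩, _⟩ := hF k (Or.inr hm)
    refine ⟨K, hK, ?_⟩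
    by_contra hne
    rw [hI.1 K (List.mem_of_getElem? hK) (by omega)] at hK2; simp at hK2

/-- MONIC CENTRES for ALL CHAINS under `G_mult` (any `topj ≥ 2`): in every legal play from a state without cubic weight every
accepted centre has `w₃ = 0`. -/
theorem monic_centres_gmult {topj : ℕ} (htop : 2 ≤ topj) (ch₀ : Chain) (h0 : ∀ c ∈ ch₀, c.w3 = 0)
    (l₁ : List Move) (m : Move) (l₂ : List Move) (hl : isLegalPlay topj ch₀ (l₁ ++ m :: l₂) = true) (k : ℕ)
    (h : m = .D k ∨ m = .A k ∨ m = .AL k) : ∃ K, (applyMoves ch₀ l₁)[k]? = some K ∧ K.w3 = 0 := by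
  obtain ⟨h1, h2⟩ := isLegalPlay_append l₁ (m :: l₂) ch₀ hl
  obtain ⟨hm, _⟩ := isLegalPlay_cons h2
  exact centre_monic (F2facts_of_topj htop _) (Inv3_play htop l₁ ch₀ (Inv3_of_noCubic ch₀ h0) h1) hm k h

theorem bd_applyMoves (topj : ℕ) : ∀ (l : List Move) (ch : Chain), (∀ c ∈ ch, c.bd = true) →
    ∀ c ∈ applyMoves ch l, c.bd = true := by
  intro l
  induction l with
  | nil => intro ch h; exact h
  | cons m l ih => intro ch h; rw [applyMoves_cons]; exact ih _ (bd_applyMove h m)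

/-- MONIC CENTRES for ALL CHAINS in mode `uv`, any rule set. -/
theorem monic_centres_uv (topj : ℕ) (ch₀ : Chain) (hbd : ∀ c ∈ ch₀, c.bd = true) (h0 : ∀ c ∈ ch₀, c.w3 = 0)
    (l₁ : List Move) (m : Move) (l₂ : List Move) (hl : isLegalPlay topj ch₀ (l₁ ++ m :: l₂) = true) (k : ℕ)
    (h : m = .D k ∨ m = .A k ∨ m = .AL k) : ∃ K, (applyMoves ch₀ l₁)[k]? = some K ∧ K.w3 = 0 := by
  obtain ⟨h1, h2⟩ := isLegalPlay_append l₁ (m :: l₂) ch₀ hl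
  obtain ⟨hm, _⟩ := isLegalPlay_cons h2
  exact centre_monic (F2facts_of_bd topj _ (bd_applyMoves topj l₁ ch₀ hbd))
    (Inv3_play_bd topj l₁ ch₀ hbd (Inv3_of_noCubic ch₀ h0) h1) hm k h


/-! ## §B‴. THEOREM (4) of loop note §9.15, NEIGHBOURS half, for ALL chains — deep and borderline accepts, and light accepts across
Sing₂ points (the dry-point case is PROPOSITION (5), by hand) (rev 6, g8) -/

/-! ### class arithmetic -/

theorem kindOf_borderline {c : Curve} (h : kindOf c = .borderline) : c.bd = true ∧ isSingW c.w = true ∧ isDeepW c.w = false := by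
  unfold kindOf at h
  cases hbd : c.bd <;> cases hD : isDeepW c.w <;> cases hS : isSingW c.w <;> cases hC : isCW c.w <;> simp [hbd, hD, hS, hC] at h ⊢

theorem kindOf_light {c : Curve} (h : kindOf c = .light) : c.bd = true ∧ isCW c.w = true ∧ isSingW c.w = false := by
  unfold kindOf at h
  cases hbd : c.bd <;> cases hD : isDeepW c.w <;> cases hS : isSingW c.w <;> cases hC : isCW c.w <;> simp [hbd, hD, hS, hC] at h ⊢

theorem kindOf_of_singW {c : Curve} (hb : c.bd = true) (hs : isSingW c.w = true) : kindOf c = .deep ∨ kindOf c = .borderline := by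
  unfold kindOf
  cases hD : isDeepW c.w <;> simp [hb, hD, hs]

theorem kindOf_of_CW {c : Curve} (hb : c.bd = true) (hc : isCW c.w = true) :
    kindOf c = .deep ∨ kindOf c = .borderline ∨ kindOf c = .light := by
  unfold kindOf
  cases hD : isDeepW c.w <;> cases hS : isSingW c.w <;> simp [hb, hD, hS, hc]

theorem singW_of_deepW {w : W3} (h : isDeepW w = true) : isSingW w = true := by
  rcases w with ⟨_ | a, _ | b, _ | c⟩ <;> (simp only [ble_false_iff, Nat.ble_eq, isDeepW, isSingW, isCW, W3.ge, W3.add, W3.sub, finPos, wge_some, wge_none, wadd_some, wadd_none_l, wadd_none_r, Option.map_some, Option.map_none, Option.map, Bool.and_eq_true, Bool.or_eq_true, Bool.not_eq_true', Bool.not_eq_eq_eq_not, Bool.not_true, Bool.not_false, Bool.and_eq_false_eq_eq_false_or_eq_false, decide_eq_true_eq, decide_eq_false_iff_not, not_le, Bool.true_and, Bool.and_true, true_and, and_true, Bool.false_eq_true, Bool.true_eq_false, false_or, or_false, Option.some.injEq, reduceCtorEq, false_and, and_false, or_true, true_or, exists_and_left, exists_and_right, exists_eq_left, exists_eq_left',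 exists_eq_right, exists_eq_right', exists_eq', exists_false, exists_const, false_iff, iff_false, not_false_eq_true, not_true_eq_false, ite_true, ite_false, if_true, if_false, Bool.true_or, Bool.or_true, Bool.false_or, Bool.or_false, imp_false, not_lt] at *) <;> omega

theorem CW_of_singW {w : W3} (h : isSingW w = true) : isCW w = true := by
  rcases w with ⟨_ | a, _ | b, _ | c⟩ <;> (simp only [ble_false_iff, Nat.ble_eq, isDeepW, isSingW, isCW, W3.ge, W3.add, W3.sub, finPos, wge_some, wge_none, wadd_some, wadd_none_l, wadd_none_r, Option.map_some, Option.map_none, Option.map, Bool.and_eq_true, Bool.or_eq_true, Bool.not_eq_true', Bool.not_eq_eq_eq_not, Bool.not_true, Bool.not_false, Bool.and_eq_false_eq_eq_false_or_eq_false, decide_eq_true_eq, decide_eq_false_iff_not, not_le, Bool.true_and, Bool.and_true, true_and, and_true, Bool.false_eq_true, Bool.true_eq_false, false_or, or_false, Option.some.injEq, reduceCtorEq, false_and, and_false, or_true, true_or, exists_and_left, exists_and_right, exists_eq_left, exists_eq_left', exists_eq_right, exists_eq_right', exists_eq', exists_false, exists_const, false_iff, iff_false, not_false_eq_true, not_true_eq_false,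 ite_true, ite_false, if_true, if_false, Bool.true_or, Bool.or_true, Bool.false_or, Bool.or_false, imp_false, not_lt] at *) <;> omega

/-- at a 𝒟-node: a Sing₂-class branch against a class-𝒞 branch makes the point TOP (`o ≥ (4,3,1)`) -/
theorem topN_of_singW_CW {a b : Curve} (ha : a.bd = true) (hb : b.bd = true)
    (h : (isSingW a.w = true ∧ isCW b.w = true) ∨ (isCW a.w = true ∧ isSingW b.w = true)) : topN a b = true := by
  unfold topN sing2N resid
  rcases a with ⟨⟨_ | a0, _ | a1, _ | a2⟩, a3, abd⟩ <;> rcases b with ⟨⟨_ | b0, _ | b1, _ | b2⟩, b3, bbd⟩ <;>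
    simp only at ha hb <;> subst ha hb <;> (simp only [ble_false_iff, Nat.ble_eq, isDeepW, isSingW, isCW, W3.ge, W3.add, W3.sub, finPos, wge_some, wge_none, wadd_some, wadd_none_l, wadd_none_r, Option.map_some, Option.map_none, Option.map, Bool.and_eq_true, Bool.or_eq_true, Bool.not_eq_true', Bool.not_eq_eq_eq_not, Bool.not_true, Bool.not_false, Bool.and_eq_false_eq_eq_false_or_eq_false, decide_eq_true_eq, decide_eq_false_iff_not, not_le, Bool.true_and, Bool.and_true, true_and, and_true, Bool.false_eq_true, Bool.true_eq_false, false_or, or_false, Option.some.injEq, reduceCtorEq, false_and, and_false, or_true, true_or, exists_and_left, exists_and_right, exists_eq_left, exists_eq_left', exists_eq_right, exists_eq_right', exists_eq', exists_false, exists_const, false_iff, iff_false, not_false_eq_true, not_true_eq_false, ite_true, ite_false, if_true, if_false, Bool.true_or, Bool.or_true, Bool.false_or, Bool.or_false, imp_false, not_lt] at *) <;> omega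

/-- at a 𝒟-node: two class-𝒞 branches meeting in a Sing₂ point make it TOP (`o ≥ (4,2,1)`) -/
theorem topN_of_CW_CW_sing2 {a b : Curve} (ha : a.bd = true) (hb : b.bd = true) (hca : isCW a.w = true) (hcb : isCW b.w = true)
    (hs : sing2N a b = true) : topN a b = true := by
  unfold topN
  rw [hs, Bool.true_and]
  unfold sing2N resid at hs
  rcases a with ⟨⟨_ | a0, _ | a1, _ | a2⟩, a3, abd⟩ <;> rcases b with ⟨⟨_ | b0, _ | b1, _ | b2⟩, b3, bbd⟩ <;>
    simp only at ha hb <;> subst ha hb <;> (simp only [ble_false_iff, Nat.ble_eq, isDeepW, isSingW, isCW, W3.ge, W3.add, W3.sub, finPos, wge_some, wge_none, wadd_some, wadd_none_l, wadd_none_r, Option.map_some, Option.map_none, Option.map, Bool.and_eq_true, Bool.or_eq_true, Bool.not_eq_true', Bool.not_eq_eq_eq_not, Bool.not_true, Bool.not_false, Bool.and_eq_false_eq_eq_false_or_eq_false, decide_eq_true_eq, decide_eq_false_iff_not, not_le, Bool.true_and, Bool.and_true, true_and, and_true, Bool.false_eq_true, Bool.true_eq_false, false_or, or_false, Option.some.injEq,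 reduceCtorEq, false_and, and_false, or_true, true_or, exists_and_left, exists_and_right, exists_eq_left, exists_eq_left', exists_eq_right, exists_eq_right', exists_eq', exists_false, exists_const, false_iff, iff_false, not_false_eq_true, not_true_eq_false, ite_true, ite_false, if_true, if_false, Bool.true_or, Bool.or_true, Bool.false_or, Bool.or_false, imp_false, not_lt] at *) <;> omega

theorem not_singW_of_w0_zero {w : W3} (h : w.w0 = some 0) : isSingW w = false ∧ isCW w = false := by
  rcases w with ⟨_ | a, _ | b, _ | c⟩ <;> simp only at h <;> (simp only [ble_false_iff, Nat.ble_eq, isDeepW, isSingW, isCW, W3.ge, W3.add, W3.sub, finPos, wge_some, wge_none, wadd_some, wadd_none_l, wadd_none_r, Option.map_some, Option.map_none, Option.map, Bool.and_eq_true, Bool.or_eq_true, Bool.not_eq_true', Bool.not_eq_eq_eq_not, Bool.not_true, Bool.not_false, Bool.and_eq_false_eq_eq_false_or_eq_false, decide_eq_true_eq, decide_eq_false_iff_not, not_le, Bool.true_and, Bool.and_true, true_and, and_true, Bool.false_eq_true, Bool.true_eq_false, false_or, or_false, Option.some.injEq, reduceCtorEq, false_and, and_false, or_true, true_or, exists_and_left,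 exists_and_right, exists_eq_left, exists_eq_left', exists_eq_right, exists_eq_right', exists_eq', exists_false, exists_const, false_iff, iff_false, not_false_eq_true, not_true_eq_false, ite_true, ite_false, if_true, if_false, Bool.true_or, Bool.or_true, Bool.false_or, Bool.or_false, imp_false, not_lt] at *) <;> omega

/-! ### handled curves -/

theorem handled_of_singW {ch : Chain} {k : ℕ} {c : Curve} (hc : ch[k]? = some c) (hb : c.bd = true) (hs : isSingW c.w = true) :
    handled ch k = true := by
  unfold handled
  have hk : kindAt ch k = kindOf c := by unfold kindAt; simp only [hc]
  rcases kindOf_of_singW hb hs with h | h <;> simp [hk, h]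

theorem handled_of_CW_sing2 {ch : Chain} {k i : ℕ} {c : Curve} (hc : ch[k]? = some c) (hb : c.bd = true) (hcw : isCW c.w = true)
    (hi : i ∈ ptsOf ch.length k) (hs : sing2At ch i = true) : handled ch k = true := by
  unfold handled relevantLight
  have hk : kindAt ch k = kindOf c := by unfold kindAt; simp only [hc]
  have hany : (ptsOf ch.length k).any (sing2At ch) = true := List.any_eq_true.mpr ⟨i, hi, hs⟩
  rcases kindOf_of_CW hb hcw with h | h | h <;> simp [hk, h, hany]

/-! ### no top point on an accepted curve -/

/-- what the neighbours' step needs from legality: an `A`/`AL`-accepted curve has no TOP point (true under `G_mult`, and in mode `uv`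
for any rule set) -/
def AccFacts (topj : ℕ) (ch : Chain) : Prop :=
  ∀ k, (Move.A k ∈ legalMoves topj ch ∨ Move.AL k ∈ legalMoves topj ch) → ∀ i ∈ ptsOf ch.length k, topAt ch i = false

theorem AccFacts_of_topj {topj : ℕ} (htop : 2 ≤ topj) (ch : Chain) : AccFacts topj ch := by
  intro k hk i hi
  have hb2 : Nat.ble 2 topj = true := by simpa [Nat.ble_eq] using htop
  have hb1 : Nat.ble 1 topj = true := by simp [Nat.ble_eq]; omega
  rcases hk with hk | hk
  · have := (A_mem_legalMoves topj ch k hk).2 i hi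
    rw [hb2] at this; exact ((by simpa using this) : jumpAt ch i = false ∧ topAt ch i = false).2
  · have := (AL_mem_legalMoves topj ch k hk).2.2 i hi
    rw [hb1] at this; exact ((by simpa using this) : jumpAt ch i = false ∧ topAt ch i = false).2

theorem topAt_false_of_bd {ch : Chain} (hbd : ∀ c ∈ ch, c.bd = true) {i : ℕ} (hj : jumpAt ch i = false) : topAt ch i = false := by
  unfold jumpAt at hj; unfold topAt
  cases hn : nodeAt ch i with
  | none => simp [hn]
  | some ab =>
    obtain ⟨a, b⟩ := ab
    simp only [hn] at hj ⊢
    obtain ⟨ha, hb'⟩ := nodeAt_some hn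
    rw [jumpN_of_bd (hbd a (List.mem_of_getElem? ha)) (hbd b (List.mem_of_getElem? hb'))] at hj
    exact hj

theorem AccFacts_of_bd (topj : ℕ) (ch : Chain) (hbd : ∀ c ∈ ch, c.bd = true) : AccFacts topj ch := by
  intro k hk i hi
  rcases hk with hk | hk
  · have := (A_mem_legalMoves topj ch k hk).2 i hi
    exact topAt_false_of_bd hbd (by simpa using (Bool.or_eq_false_iff.mp this).1)
  · have := (AL_mem_legalMoves topj ch k hk).2.2 i hi
    exact topAt_false_of_bd hbd (by simpa using (Bool.or_eq_false_iff.mp this).1)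

/-! ### node invariants: generic transport -/

def NodeInv (R : Curve → Curve → Prop) (ch : Chain) : Prop := ∀ i a b, nodeAt ch i = some (a, b) → R a b

theorem NodeInv_modify {R : Curve → Curve → Prop} {ch : Chain} (hI : NodeInv R ch) {k : ℕ} {K : Curve} (hK : ch[k]? = some K)
    (f : Curve → Curve) (hL : ∀ j a, nodeAt ch j = some (a, K) → j + 1 = k → R a (f K))
    (hR : ∀ b, nodeAt ch k = some (K, b) → R (f K) b) : NodeInv R (ch.modify k f) := by
  intro j a' b' hn
  obtain ⟨a, b, hn0, rfl, rfl⟩ := nodeAt_modify_cases hn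
  obtain ⟨ha, hb⟩ := nodeAt_some hn0
  by_cases h1 : k = j
  · subst h1
    have haK : a = K := Option.some.inj (ha.symm.trans hK)
    subst haK
    rw [if_pos rfl, if_neg (by omega : k ≠ k + 1)]
    exact hR b hn0
  · rw [if_neg h1]
    by_cases h2 : k = j + 1
    · subst h2
      have hbK : b = K := Option.some.inj (hb.symm.trans hK)
      subst hbK
      rw [if_pos rfl]
      exact hL j a hn0 rfl
    · rw [if_neg h2]; exact hI j a b hn0

theorem NodeInv_insert {R : Curve → Curve → Prop} {ch : Chain} (hI : NodeInv R ch) {i : ℕ} {a b : Curve}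
    (hn : nodeAt ch i = some (a, b)) (Γ : Curve) (h1 : R a Γ) (h2 : R Γ b) : NodeInv R (ch.insertIdx (i + 1) Γ) := by
  obtain ⟨ha, hb⟩ := nodeAt_some hn
  have hi : i + 1 ≤ ch.length := by have := (List.getElem?_eq_some_iff.mp hb).1; omega
  intro j a' b' hn'
  rcases nodeAt_insertIdx_cases hi hn' with h | ⟨rfl, ha', rfl⟩ | ⟨rfl, rfl, hb'⟩ | ⟨_, h⟩
  · exact hI j a' b' h
  · have : a' = a := Option.some.inj (ha'.symm.trans ha)
    subst this; exact h1
  · have : b' = b := Option.some.inj (hb'.symm.trans hb)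
    subst this; exact h2
  · exact hI (j - 1) a' b' h

/-! ### the invariant of the neighbours' theorem -/

/-- node relation: a cubic-weighted branch never faces a Sing₂-class boundary branch, and faces a class-𝒞 boundary branch only across a
point that is not Sing₂ -/
def R4 (a b : Curve) : Prop :=
  (1 ≤ a.w3 → b.bd = true → isSingW b.w = false ∧ (isCW b.w = true → sing2N a b = false)) ∧
  (1 ≤ b.w3 → a.bd = true → isSingW a.w = false ∧ (isCW a.w = true → sing2N a b = false))

def Inv4 (ch : Chain) : Prop := NodeInv R4 ch

theorem Inv4_of_noCubic (ch : Chain) (h : ∀ c ∈ ch, c.w3 = 0) : Inv4 ch := by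
  intro i a b hn
  obtain ⟨ha, hb⟩ := nodeAt_some hn
  have := h a (List.mem_of_getElem? ha); have := h b (List.mem_of_getElem? hb)
  constructor <;> intro h1 <;> exfalso <;> omega

theorem Inv4_blowup3 {ch : Chain} (hI3 : Inv3 ch) (hI4 : Inv4 ch) {i : ℕ} (ht : topAt ch i = true) : Inv4 (blowup ch i 3) := by
  unfold topAt at ht
  unfold blowup
  cases hn : nodeAt ch i with
  | none => simp [hn] at ht
  | some ab =>
    obtain ⟨a, b⟩ := ab
    simp only [hn] at ht ⊢
    obtain ⟨ha3, hb3⟩ := top_noCubic hI3 hn ht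
    refine NodeInv_insert hI4 hn _ ?_ ?_
    · constructor
      · intro h; exfalso; omega
      · intro h; exfalso; simp only at h; omega
    · constructor
      · intro h; exfalso; simp only at h; omega
      · intro h; exfalso; omega

theorem Inv4_blowup2 {ch : Chain} (hI4 : Inv4 ch) {i : ℕ} (hs : sing2At ch i = true) (ht : topAt ch i = false)
    (hha : handled ch i = false) (hhb : handled ch (i + 1) = false) : Inv4 (blowup ch i 2) := by
  have hs0 := hs
  unfold sing2At at hs; unfold topAt at ht; unfold blowup
  cases hn : nodeAt ch i with
  | none => simp [hn] at hs
  | some ab =>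
    obtain ⟨a, b⟩ := ab
    simp only [hn] at hs ht ⊢
    obtain ⟨x, y, hx, hy, hxy⟩ := o0_of_sing2_not_top a b hs ht
    obtain ⟨ha, hb⟩ := nodeAt_some hn
    have hlen : i + 1 < ch.length := (List.getElem?_eq_some_iff.mp hb).1
    have hΓ0 : ((a.w.add b.w).w0.map (· - 2)) = some 0 := by simp [W3.add, hx, hy, wadd_some]; omega
    have hΓns := not_singW_of_w0_zero (w := ⟨(a.w.add b.w).w0.map (· - 2), (a.w.add b.w).w1.map (· + 1 - 2),
      (a.w.add b.w).w2.map (· + 2 - 2)⟩) hΓ0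
    -- the two old branches are not handled: not Sing₂-class, and not class 𝒞 (the point `i` being Sing₂)
    have hA : a.bd = true → isSingW a.w = false ∧ (isCW a.w = true → False) := by
      intro hab
      constructor
      · cases h : isSingW a.w with
        | false => rfl
        | true => have := handled_of_singW ha hab h; rw [hha] at this; exact absurd this Bool.false_ne_true
      · intro h; have := handled_of_CW_sing2 ha hab h (mem_ptsOf_right hlen) hs0; rw [hha] at this
        exact Bool.false_ne_true this
    have hB : b.bd = true → isSingW b.w = false ∧ (isCW b.w = true → False) := by
      intro hbb
      constructor
      · cases h : isSingW b.w with
        | false => rfl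
        | true => have := handled_of_singW hb hbb h; rw [hhb] at this; exact absurd this Bool.false_ne_true
      · intro h; have := handled_of_CW_sing2 hb hbb h (mem_ptsOf_left rfl) hs0; rw [hhb] at this
        exact Bool.false_ne_true this
    refine NodeInv_insert hI4 hn _ ?_ ?_
    · constructor
      · intro _ _; exact ⟨hΓns.1, fun h => absurd h (by rw [hΓns.2]; exact Bool.false_ne_true)⟩
      · intro _ hab; obtain ⟨h1, h2⟩ := hA hab; exact ⟨h1, fun h => (h2 h).elim⟩
    · constructor
      · intro _ hbb; obtain ⟨h1, h2⟩ := hB hbb; exact ⟨h1, fun h => (h2 h).elim⟩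
      · intro _ _; exact ⟨hΓns.1, fun h => absurd h (by rw [hΓns.2]; exact Bool.false_ne_true)⟩

theorem Inv4_deep {ch : Chain} (hI3 : Inv3 ch) (hI4 : Inv4 ch) {k : ℕ} (hk : kindAt ch k = .deep) :
    Inv4 (ch.modify k (fun c => { c with w := c.w.sub 3 2 1 })) := by
  obtain ⟨K, hK, hκ⟩ := kindAt_some hk (by decide)
  obtain ⟨hKbd, hKdeep⟩ := kindOf_deep hκ
  have hKs : isSingW K.w = true := singW_of_deepW hKdeep
  have hw3 : wge K.w.w0 3 = true := by
    unfold isDeepW W3.ge at hKdeep; simp only [Bool.and_eq_true] at hKdeep; exact hKdeep.1.1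
  have hK3 : K.w3 = 0 := by
    by_contra hne
    have h0 := hI3.1 K (List.mem_of_getElem? hK) (by omega)
    rw [h0, wge_some, decide_eq_true_eq] at hw3; omega
  refine NodeInv_modify hI4 hK _ ?_ ?_
  · intro j a hn0 _
    have hold := hI4 j a K hn0
    constructor
    · intro ha1; exfalso; have := (hold.1 ha1 hKbd).1; rw [hKs] at this; exact Bool.noConfusion this
    · intro h1; exfalso; simp only at h1; omega
  · intro b hn0
    have hold := hI4 k K b hn0
    constructor
    · intro h1; exfalso; simp only at h1; omega
    · intro hb1; exfalso; have := (hold.2 hb1 hKbd).1; rw [hKs] at this; exact Bool.noConfusion this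

theorem Inv4_acceptA {topj : ℕ} {ch : Chain} (hA : AccFacts topj ch) (hI4 : Inv4 ch) {k : ℕ}
    (hm : Move.A k ∈ legalMoves topj ch) : Inv4 (ch.modify k (fun c => { c with w := c.w.sub 2 1 0, w3 := c.w3 + 1 })) := by
  obtain ⟨K, hK, hκ⟩ := kindAt_some (A_mem_legalMoves topj ch k hm).1 (by decide)
  obtain ⟨hKbd, hKs, _⟩ := kindOf_borderline hκ
  have hnt := hA k (Or.inl hm)
  -- a boundary neighbour of the borderline centre is neither Sing₂-class nor class 𝒞 (else the point would be top)
  have key : ∀ i b, i ∈ ptsOf ch.length k → (nodeAt ch i = some (K, b) ∨ nodeAt ch i = some (b, K)) → b.bd = true →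
      isSingW b.w = false ∧ isCW b.w = false := by
    intro i b hi hn hbb
    have ht := hnt i hi
    unfold topAt at ht
    have hcb : isCW b.w = false := by
      cases hc : isCW b.w with
      | false => rfl
      | true =>
        exfalso
        rcases hn with hn | hn <;> rw [hn] at ht <;> simp only at ht
        · have := topN_of_singW_CW hKbd hbb (Or.inl ⟨hKs, hc⟩); rw [ht] at this; exact Bool.false_ne_true this
        · have := topN_of_singW_CW hbb hKbd (Or.inr ⟨hc, hKs⟩); rw [ht] at this; exact Bool.false_ne_true this
    refine ⟨?_, hcb⟩
    cases hs : isSingW b.w with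
    | false => rfl
    | true => rw [CW_of_singW hs] at hcb; exact hcb
  refine NodeInv_modify hI4 hK _ ?_ ?_
  · intro j a hn0 hj
    have hold := hI4 j a K hn0
    constructor
    · intro ha1; exfalso; have := (hold.1 ha1 hKbd).1; rw [hKs] at this; exact Bool.noConfusion this
    · intro _ hab
      obtain ⟨h1, h2⟩ := key j a (mem_ptsOf_left hj) (Or.inr hn0) hab
      exact ⟨h1, fun h => by rw [h2] at h; exact absurd h Bool.false_ne_true⟩
  · intro b hn0
    have hold := hI4 k K b hn0
    have hlen : k + 1 < ch.length := (List.getElem?_eq_some_iff.mp (nodeAt_some hn0).2).1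
    constructor
    · intro _ hbb
      obtain ⟨h1, h2⟩ := key k b (mem_ptsOf_right hlen) (Or.inl hn0) hbb
      exact ⟨h1, fun h => by rw [h2] at h; exact absurd h Bool.false_ne_true⟩
    · intro hb1; exfalso; have := (hold.2 hb1 hKbd).1; rw [hKs] at this; exact Bool.noConfusion this

theorem Inv4_acceptAL {topj : ℕ} {ch : Chain} (hF : F2facts topj ch) (hA : AccFacts topj ch) (hI4 : Inv4 ch) {k : ℕ}
    (hm : Move.AL k ∈ legalMoves topj ch) : Inv4 (ch.modify k (fun c => { c with w := c.w.sub 2 1 0, w3 := c.w3 + 1 })) := by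
  obtain ⟨K, hK, hκ⟩ := kindAt_some (AL_mem_legalMoves topj ch k hm).1 (by decide)
  obtain ⟨hKbd, hKc, _⟩ := kindOf_light hκ
  obtain ⟨⟨K', hK', hK2'⟩, _⟩ := hF k (Or.inr hm)
  have hK2 : K.w.w0 = some 2 := by
    have e : K' = K := Option.some.inj (hK'.symm.trans hK)
    rw [e] at hK2'; exact hK2'
  have hnt := hA k (Or.inr hm)
  have hK0 : (K.w.sub 2 1 0).w0 = some 0 := by simp [W3.sub, hK2]
  have hKns := not_singW_of_w0_zero hK0
  -- a boundary neighbour `b` of the light centre: not Sing₂-class (else top), and if class 𝒞 then the point is not Sing₂ (else top)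
  have key : ∀ i b, i ∈ ptsOf ch.length k → (nodeAt ch i = some (K, b) ∨ nodeAt ch i = some (b, K)) → b.bd = true →
      isSingW b.w = false ∧ (isCW b.w = true → (nodeAt ch i = some (K, b) → sing2N K b = false) ∧
        (nodeAt ch i = some (b, K) → sing2N b K = false)) := by
    intro i b hi hn hbb
    have ht := hnt i hi
    unfold topAt at ht
    constructor
    · cases hsb : isSingW b.w with
      | false => rfl
      | true =>
        exfalso
        rcases hn with hn | hn <;> rw [hn] at ht <;> simp only at ht
        · have := topN_of_singW_CW hKbd hbb (Or.inr ⟨hKc, hsb⟩); rw [ht] at this; exact Bool.false_ne_true this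
        · have := topN_of_singW_CW hbb hKbd (Or.inl ⟨hsb, hKc⟩); rw [ht] at this; exact Bool.false_ne_true this
    · intro hcb
      constructor
      · intro hn1; rw [hn1] at ht; simp only at ht
        cases hs : sing2N K b with
        | false => rfl
        | true => have := topN_of_CW_CW_sing2 hKbd hbb hKc hcb hs; rw [ht] at this; exact absurd this Bool.false_ne_true
      · intro hn1; rw [hn1] at ht; simp only at ht
        cases hs : sing2N b K with
        | false => rfl
        | true => have := topN_of_CW_CW_sing2 hbb hKbd hcb hKc hs; rw [ht] at this; exact absurd this Bool.false_ne_true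
  refine NodeInv_modify hI4 hK _ ?_ ?_
  · intro j a hn0 hj
    constructor
    · intro _ _; exact ⟨hKns.1, fun h => by rw [hKns.2] at h; exact absurd h Bool.false_ne_true⟩
    · intro _ hab
      obtain ⟨h1, h2⟩ := key j a (mem_ptsOf_left hj) (Or.inr hn0) hab
      exact ⟨h1, fun hc => sing2N_mono_right hKbd hKbd 2 1 0 rfl ((h2 hc).2 hn0)⟩
  · intro b hn0
    have hlen : k + 1 < ch.length := (List.getElem?_eq_some_iff.mp (nodeAt_some hn0).2).1
    constructor
    · intro _ hbb
      obtain ⟨h1, h2⟩ := key k b (mem_ptsOf_right hlen) (Or.inl hn0) hbb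
      exact ⟨h1, fun hc => sing2N_mono_left hKbd hKbd 2 1 0 rfl ((h2 hc).1 hn0)⟩
    · intro _ _; exact ⟨hKns.1, fun h => by rw [hKns.2] at h; exact absurd h Bool.false_ne_true⟩

/-- ONE MOVE: `Inv4` is preserved by every legal move (given `Inv3`, the (F2) facts and the no-top-point facts). -/
theorem Inv4_step (topj : ℕ) (ch : Chain) (hF : F2facts topj ch) (hA : AccFacts topj ch) (hI3 : Inv3 ch) (hI4 : Inv4 ch)
    (m : Move) (hm : m ∈ legalMoves topj ch) : Inv4 (applyMove ch m) := by
  cases m with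
  | D k => exact Inv4_deep hI3 hI4 (D_mem_legalMoves topj ch k hm)
  | A k => exact Inv4_acceptA hA hI4 hm
  | AL k => exact Inv4_acceptAL hF hA hI4 hm
  | I i => exact Inv4_blowup3 hI3 hI4 (I_mem_legalMoves topj ch i hm)
  | P i =>
    obtain ⟨hs, hha, hhb⟩ := P_mem_legalMoves topj ch i hm
    show Inv4 (blowup ch i (if topAt ch i then 3 else 2))
    cases ht : topAt ch i with
    | true => rw [if_pos rfl]; exact Inv4_blowup3 hI3 hI4 ht
    | false => rw [if_neg Bool.false_ne_true]; exact Inv4_blowup2 hI4 hs ht hha hhb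

theorem Inv34_play {topj : ℕ} (htop : 2 ≤ topj) : ∀ (l : List Move) (ch : Chain),
    Inv3 ch → Inv4 ch → isLegalPlay topj ch l = true → Inv3 (applyMoves ch l) ∧ Inv4 (applyMoves ch l) := by
  intro l
  induction l with
  | nil => intro ch h3 h4 _; exact ⟨h3, h4⟩
  | cons m l ih =>
    intro ch h3 h4 hl
    obtain ⟨hm, hl'⟩ := isLegalPlay_cons hl
    rw [applyMoves_cons]
    exact ih (applyMove ch m) (Inv3_step topj ch (F2facts_of_topj htop ch) h3 m hm)
      (Inv4_step topj ch (F2facts_of_topj htop ch) (AccFacts_of_topj htop ch) h3 h4 m hm) hl'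

theorem Inv34_play_bd (topj : ℕ) : ∀ (l : List Move) (ch : Chain), (∀ c ∈ ch, c.bd = true) →
    Inv3 ch → Inv4 ch → isLegalPlay topj ch l = true → Inv3 (applyMoves ch l) ∧ Inv4 (applyMoves ch l) := by
  intro l
  induction l with
  | nil => intro ch _ h3 h4 _; exact ⟨h3, h4⟩
  | cons m l ih =>
    intro ch hbd h3 h4 hl
    obtain ⟨hm, hl'⟩ := isLegalPlay_cons hl
    rw [applyMoves_cons]
    exact ih (applyMove ch m) (bd_applyMove hbd m) (Inv3_step topj ch (F2facts_of_bd topj ch hbd) h3 m hm)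
      (Inv4_step topj ch (F2facts_of_bd topj ch hbd) (AccFacts_of_bd topj ch hbd) h3 h4 m hm) hl'

/-! ### the neighbours' theorem -/

/-- under the two invariants: at a `D`- or `A`-accept of `k` BOTH branches of EVERY point of `k` have `w₃ = 0`; at an `AL`-accept the
same holds at every Sing₂ point of `k` (the centre itself is monic by `centre_monic`; the remaining configuration — a cubic-weighted
neighbour across a non-Sing₂ point of a light centre — is the residual sub-case of §9.14 (5), excluded by PROPOSITION 9.15 (5) by hand). -/
theorem neighbours_monic {topj : ℕ} {s : Chain} (hF : F2facts topj s) (hI3 : Inv3 s) (hI4 : Inv4 s) {m : Move}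
    (hm : m ∈ legalMoves topj s) (k : ℕ) :
    ((m = .D k ∨ m = .A k) → ∀ i ∈ ptsOf s.length k, ∀ a b, nodeAt s i = some (a, b) → a.w3 = 0 ∧ b.w3 = 0) ∧
    (m = .AL k → ∀ i ∈ ptsOf s.length k, sing2At s i = true → ∀ a b, nodeAt s i = some (a, b) → a.w3 = 0 ∧ b.w3 = 0) := by
  constructor
  · intro hDA i hi a b hn
    -- the centre K is Sing₂-class and monic
    have hkind : kindAt s k = .deep ∨ kindAt s k = .borderline := by
      rcases hDA with rfl | rfl
      · exact Or.inl (D_mem_legalMoves topj s k hm)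
      · exact Or.inr (A_mem_legalMoves topj s k hm).1
    obtain ⟨K, hK, hKbd, hKs⟩ : ∃ K, s[k]? = some K ∧ K.bd = true ∧ isSingW K.w = true := by
      rcases hkind with h | h
      · obtain ⟨K, hK, hκ⟩ := kindAt_some h (by decide); obtain ⟨h1, h2⟩ := kindOf_deep hκ
        exact ⟨K, hK, h1, singW_of_deepW h2⟩
      · obtain ⟨K, hK, hκ⟩ := kindAt_some h (by decide); obtain ⟨h1, h2, _⟩ := kindOf_borderline hκ
        exact ⟨K, hK, h1, h2⟩
    have hK3 : K.w3 = 0 := by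
      have hm' : m = .D k ∨ m = .A k ∨ m = .AL k := by rcases hDA with h | h; exact Or.inl h; exact Or.inr (Or.inl h)
      obtain ⟨K', hK', h3⟩ := centre_monic hF hI3 hm k hm'
      have : K' = K := Option.some.inj (hK'.symm.trans hK); subst this; exact h3
    obtain ⟨ha, hb⟩ := nodeAt_some hn
    have hold := hI4 i a b hn
    rcases mem_ptsOf hi with ⟨_, hik⟩ | ⟨_, rfl⟩
    · -- i + 1 = k : b = K
      have hbK : b = K := Option.some.inj (by rw [← hb, ← hK, hik])
      subst hbK
      refine ⟨?_, hK3⟩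
      by_contra hne
      have := (hold.1 (by omega) hKbd).1; rw [hKs] at this; exact Bool.noConfusion this
    · have haK : a = K := Option.some.inj (ha.symm.trans hK)
      subst haK
      refine ⟨hK3, ?_⟩
      by_contra hne
      have := (hold.2 (by omega) hKbd).1; rw [hKs] at this; exact Bool.noConfusion this
  · intro hAL i hi hs a b hn
    subst hAL
    obtain ⟨K, hK, hκ⟩ := kindAt_some (AL_mem_legalMoves topj s k hm).1 (by decide)
    obtain ⟨hKbd, hKc, _⟩ := kindOf_light hκ
    have hK3 : K.w3 = 0 := by
      obtain ⟨K', hK', h3⟩ := centre_monic hF hI3 hm k (Or.inr (Or.inr rfl))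
      have : K' = K := Option.some.inj (hK'.symm.trans hK); subst this; exact h3
    obtain ⟨ha, hb⟩ := nodeAt_some hn
    have hold := hI4 i a b hn
    have hsn : sing2N a b = true := by unfold sing2At at hs; rw [hn] at hs; simpa using hs
    rcases mem_ptsOf hi with ⟨_, hik⟩ | ⟨_, rfl⟩
    · have hbK : b = K := Option.some.inj (by rw [← hb, ← hK, hik])
      subst hbK
      refine ⟨?_, hK3⟩
      by_contra hne
      have := (hold.1 (by omega) hKbd).2 hKc; rw [hsn] at this; exact Bool.noConfusion this
    · have haK : a = K := Option.some.inj (ha.symm.trans hK)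
      subst haK
      refine ⟨hK3, ?_⟩
      by_contra hne
      have := (hold.2 (by omega) hKbd).2 hKc; rw [hsn] at this; exact Bool.noConfusion this

/-- MONIC NEIGHBOURS for ALL CHAINS under `G_mult` (any `topj ≥ 2`), in every legal play from a state without cubic weight: at every
`D`/`A`-accept all branches at the centre's points have `w₃ = 0`; at every `AL`-accept the same at the centre's Sing₂ points. -/
theorem monic_neighbours_gmult {topj : ℕ} (htop : 2 ≤ topj) (ch₀ : Chain) (h0 : ∀ c ∈ ch₀, c.w3 = 0)
    (l₁ : List Move) (m : Move) (l₂ : List Move) (hl : isLegalPlay topj ch₀ (l₁ ++ m :: l₂) = true) (k : ℕ) :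
    let s := applyMoves ch₀ l₁
    ((m = .D k ∨ m = .A k) → ∀ i ∈ ptsOf s.length k, ∀ a b, nodeAt s i = some (a, b) → a.w3 = 0 ∧ b.w3 = 0) ∧
    (m = .AL k → ∀ i ∈ ptsOf s.length k, sing2At s i = true → ∀ a b, nodeAt s i = some (a, b) → a.w3 = 0 ∧ b.w3 = 0) := by
  obtain ⟨h1, h2⟩ := isLegalPlay_append l₁ (m :: l₂) ch₀ hl
  obtain ⟨hm, _⟩ := isLegalPlay_cons h2
  obtain ⟨hI3, hI4⟩ := Inv34_play htop l₁ ch₀ (Inv3_of_noCubic ch₀ h0) (Inv4_of_noCubic ch₀ h0) h1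
  exact neighbours_monic (F2facts_of_topj htop _) hI3 hI4 hm k

/-- MONIC NEIGHBOURS for ALL CHAINS in mode `uv`, any rule set. -/
theorem monic_neighbours_uv (topj : ℕ) (ch₀ : Chain) (hbd : ∀ c ∈ ch₀, c.bd = true) (h0 : ∀ c ∈ ch₀, c.w3 = 0)
    (l₁ : List Move) (m : Move) (l₂ : List Move) (hl : isLegalPlay topj ch₀ (l₁ ++ m :: l₂) = true) (k : ℕ) :
    let s := applyMoves ch₀ l₁
    ((m = .D k ∨ m = .A k) → ∀ i ∈ ptsOf s.length k, ∀ a b, nodeAt s i = some (a, b) → a.w3 = 0 ∧ b.w3 = 0) ∧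
    (m = .AL k → ∀ i ∈ ptsOf s.length k, sing2At s i = true → ∀ a b, nodeAt s i = some (a, b) → a.w3 = 0 ∧ b.w3 = 0) := by
  obtain ⟨h1, h2⟩ := isLegalPlay_append l₁ (m :: l₂) ch₀ hl
  obtain ⟨hm, _⟩ := isLegalPlay_cons h2
  obtain ⟨hI3, hI4⟩ := Inv34_play_bd topj l₁ ch₀ hbd (Inv3_of_noCubic ch₀ h0) (Inv4_of_noCubic ch₀ h0) h1
  exact neighbours_monic (F2facts_of_bd topj _ (bd_applyMoves topj l₁ ch₀ hbd)) hI3 hI4 hm k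


/-! ## §B⁗. Towards PROPOSITION (5): the shape of the residual configuration, for ALL chains (rev 7, g8)
A third state invariant: a cubic-weighted branch adjacent to a class-𝒞 boundary branch forces BOTH to have class-2 weight `w₂ = 0`
(so the point between them is dry for ever). Consequently the only configuration of THEOREM (4) not decided by §B‴ — a cubic-weighted
neighbour `N` across the non-Sing₂ point of an `AL`-accepted light centre `K` — has `w(K) = (2, k₁, 0)` and `w₂(N) = 0`, i.e. it is
literally the hypothesis of PROPOSITION 9.15 (5) (whose exclusion needs birth data and stays by hand). Also recorded: TOP points never
carry cubic weight along legal plays (`top_noCubic_gmult|uv`; the S6 LEMMA clause «Q-born curves never meet top nodes» for all chains). -/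

/-- two class-𝒞 boundary branches meeting in a NON-Sing₂ point both have `w₂ = 0` (`o₀ ≥ 4`, `o₁ ≥ 2` leave only `o₂ = 0`) -/
theorem w2_zero_of_CW_CW_dead {a b : Curve} (ha : a.bd = true) (hb : b.bd = true) (hca : isCW a.w = true) (hcb : isCW b.w = true)
    (hs : sing2N a b = false) : a.w.w2 = some 0 ∧ b.w.w2 = some 0 := by
  unfold sing2N resid at hs
  rcases a with ⟨⟨_ | a0, _ | a1, _ | a2⟩, a3, abd⟩ <;> rcases b with ⟨⟨_ | b0, _ | b1, _ | b2⟩, b3, bbd⟩ <;>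
    simp only at ha hb <;> subst ha hb <;> (simp only [ble_false_iff, Nat.ble_eq, isDeepW, isSingW, isCW, W3.ge, W3.add, W3.sub, finPos, wge_some, wge_none, wadd_some, wadd_none_l, wadd_none_r, Option.map_some, Option.map_none, Option.map, Bool.and_eq_true, Bool.or_eq_true, Bool.not_eq_true', Bool.not_eq_eq_eq_not, Bool.not_true, Bool.not_false, Bool.and_eq_false_eq_eq_false_or_eq_false, decide_eq_true_eq, decide_eq_false_iff_not, not_le, Bool.true_and, Bool.and_true, true_and, and_true, Bool.false_eq_true, Bool.true_eq_false, false_or, or_false, Option.some.injEq, reduceCtorEq, false_and, and_false, or_true, true_or, exists_and_left, exists_and_right, exists_eq_left, exists_eq_left', exists_eq_right, exists_eq_right', exists_eq', exists_false, exists_const, false_iff, iff_false, not_false_eq_true, not_true_eq_false, ite_true, ite_false, if_true, if_false, Bool.true_or, Bool.or_true, Bool.false_or, Bool.or_false, imp_false, not_lt] at *) <;> omega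

/-- node relation: a cubic-weighted branch against a class-𝒞 boundary branch ⇒ both have `w₂ = 0` -/
def R6 (a b : Curve) : Prop :=
  (1 ≤ a.w3 → b.bd = true → isCW b.w = true → a.w.w2 = some 0 ∧ b.w.w2 = some 0) ∧
  (1 ≤ b.w3 → a.bd = true → isCW a.w = true → a.w.w2 = some 0 ∧ b.w.w2 = some 0)

def Inv6 (ch : Chain) : Prop := NodeInv R6 ch

theorem Inv6_of_noCubic (ch : Chain) (h : ∀ c ∈ ch, c.w3 = 0) : Inv6 ch := by
  intro i a b hn
  obtain ⟨ha, hb⟩ := nodeAt_some hn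
  have := h a (List.mem_of_getElem? ha); have := h b (List.mem_of_getElem? hb)
  constructor <;> intro h1 <;> exfalso <;> omega

theorem Inv6_blowup3 {ch : Chain} (hI3 : Inv3 ch) (hI6 : Inv6 ch) {i : ℕ} (ht : topAt ch i = true) : Inv6 (blowup ch i 3) := by
  unfold topAt at ht
  unfold blowup
  cases hn : nodeAt ch i with
  | none => simp [hn] at ht
  | some ab =>
    obtain ⟨a, b⟩ := ab
    simp only [hn] at ht ⊢
    obtain ⟨ha3, hb3⟩ := top_noCubic hI3 hn ht
    refine NodeInv_insert hI6 hn _ ?_ ?_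
    · constructor
      · intro h; exfalso; omega
      · intro h; exfalso; simp only at h; omega
    · constructor
      · intro h; exfalso; simp only at h; omega
      · intro h; exfalso; omega

theorem Inv6_blowup2 {ch : Chain} (hI6 : Inv6 ch) {i : ℕ} (hs : sing2At ch i = true) (ht : topAt ch i = false)
    (hha : handled ch i = false) (hhb : handled ch (i + 1) = false) : Inv6 (blowup ch i 2) := by
  have hs0 := hs
  unfold sing2At at hs; unfold topAt at ht; unfold blowup
  cases hn : nodeAt ch i with
  | none => simp [hn] at hs
  | some ab =>
    obtain ⟨a, b⟩ := ab
    simp only [hn] at hs ht ⊢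
    obtain ⟨x, y, hx, hy, hxy⟩ := o0_of_sing2_not_top a b hs ht
    obtain ⟨ha, hb⟩ := nodeAt_some hn
    have hlen : i + 1 < ch.length := (List.getElem?_eq_some_iff.mp hb).1
    have hΓ0 : ((a.w.add b.w).w0.map (· - 2)) = some 0 := by simp [W3.add, hx, hy, wadd_some]; omega
    have hΓns := not_singW_of_w0_zero (w := ⟨(a.w.add b.w).w0.map (· - 2), (a.w.add b.w).w1.map (· + 1 - 2),
      (a.w.add b.w).w2.map (· + 2 - 2)⟩) hΓ0
    have hA : a.bd = true → isCW a.w = true → False := by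
      intro hab h; have := handled_of_CW_sing2 ha hab h (mem_ptsOf_right hlen) hs0; rw [hha] at this
      exact Bool.false_ne_true this
    have hB : b.bd = true → isCW b.w = true → False := by
      intro hbb h; have := handled_of_CW_sing2 hb hbb h (mem_ptsOf_left rfl) hs0; rw [hhb] at this
      exact Bool.false_ne_true this
    refine NodeInv_insert hI6 hn _ ?_ ?_
    · constructor
      · intro _ _ h; exfalso; rw [hΓns.2] at h; exact Bool.false_ne_true h
      · intro _ hab h; exact (hA hab h).elim
    · constructor
      · intro _ hbb h; exact (hB hbb h).elim
      · intro _ _ h; exfalso; rw [hΓns.2] at h; exact Bool.false_ne_true h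

theorem Inv6_deep {ch : Chain} (hI3 : Inv3 ch) (hI4 : Inv4 ch) (hI6 : Inv6 ch) {k : ℕ} (hk : kindAt ch k = .deep) :
    Inv6 (ch.modify k (fun c => { c with w := c.w.sub 3 2 1 })) := by
  obtain ⟨K, hK, hκ⟩ := kindAt_some hk (by decide)
  obtain ⟨hKbd, hKdeep⟩ := kindOf_deep hκ
  have hKs : isSingW K.w = true := singW_of_deepW hKdeep
  have hw3 : wge K.w.w0 3 = true := by
    unfold isDeepW W3.ge at hKdeep; simp only [Bool.and_eq_true] at hKdeep; exact hKdeep.1.1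
  have hK3 : K.w3 = 0 := by
    by_contra hne
    have h0 := hI3.1 K (List.mem_of_getElem? hK) (by omega)
    rw [h0, wge_some, decide_eq_true_eq] at hw3; omega
  refine NodeInv_modify hI6 hK _ ?_ ?_
  · intro j a hn0 _
    have hold := hI4 j a K hn0
    constructor
    · intro ha1; exfalso; have := (hold.1 ha1 hKbd).1; rw [hKs] at this; exact Bool.noConfusion this
    · intro h1; exfalso; simp only at h1; omega
  · intro b hn0
    have hold := hI4 k K b hn0
    constructor
    · intro h1; exfalso; simp only at h1; omega
    · intro hb1; exfalso; have := (hold.2 hb1 hKbd).1; rw [hKs] at this; exact Bool.noConfusion this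

theorem Inv6_accept {topj : ℕ} {ch : Chain} (hF : F2facts topj ch) (hA : AccFacts topj ch) (hI4 : Inv4 ch) (hI6 : Inv6 ch) {k : ℕ}
    (hm : Move.A k ∈ legalMoves topj ch ∨ Move.AL k ∈ legalMoves topj ch) :
    Inv6 (ch.modify k (fun c => { c with w := c.w.sub 2 1 0, w3 := c.w3 + 1 })) := by
  -- the centre K is a class-𝒞 boundary curve with w₀ = 2 and no top point
  obtain ⟨⟨K, hK, hK2⟩, _⟩ := hF k hm
  have hKc : K.bd = true ∧ isCW K.w = true := by
    rcases hm with hm | hm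
    · obtain ⟨K', hK', hκ⟩ := kindAt_some (A_mem_legalMoves topj ch k hm).1 (by decide)
      have e : K' = K := Option.some.inj (hK'.symm.trans hK)
      subst e; obtain ⟨h1, h2, _⟩ := kindOf_borderline hκ; exact ⟨h1, CW_of_singW h2⟩
    · obtain ⟨K', hK', hκ⟩ := kindAt_some (AL_mem_legalMoves topj ch k hm).1 (by decide)
      have e : K' = K := Option.some.inj (hK'.symm.trans hK)
      subst e; obtain ⟨h1, h2, _⟩ := kindOf_light hκ; exact ⟨h1, h2⟩
  obtain ⟨hKbd, hKcw⟩ := hKc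
  have hnt := hA k hm
  have hK0 : (K.w.sub 2 1 0).w0 = some 0 := by simp [W3.sub, hK2]
  have hKns := not_singW_of_w0_zero hK0
  have hsub2 : ∀ z, K.w.w2 = some z → (K.w.sub 2 1 0).w2 = some z := by
    intro z hz; rcases K with ⟨⟨_ | a, _ | b, _ | c⟩, _, _⟩ <;> simp only at hz ⊢ <;> (simp only [ble_false_iff, Nat.ble_eq, isDeepW, isSingW, isCW, W3.ge, W3.add, W3.sub, finPos, wge_some, wge_none, wadd_some, wadd_none_l, wadd_none_r, Option.map_some, Option.map_none, Option.map, Bool.and_eq_true, Bool.or_eq_true, Bool.not_eq_true', Bool.not_eq_eq_eq_not, Bool.not_true, Bool.not_false, Bool.and_eq_false_eq_eq_false_or_eq_false, decide_eq_true_eq, decide_eq_false_iff_not, not_le, Bool.true_and, Bool.and_true, true_and, and_true, Bool.false_eq_true, Bool.true_eq_false, false_or, or_false, Option.some.injEq, reduceCtorEq, false_and, and_false, or_true, true_or, exists_and_left, exists_and_right, exists_eq_left, exists_eq_left', exists_eq_right, exists_eq_right', exists_eq', exists_false, exists_const, false_iff, iff_false, not_false_eq_true, not_true_eq_false, ite_true,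 ite_false, if_true, if_false, Bool.true_or, Bool.or_true, Bool.false_or, Bool.or_false, imp_false, not_lt] at *) <;> omega
  -- a class-𝒞 boundary neighbour `b`: the point is not top, hence not Sing₂, hence both `w₂ = 0`
  have key : ∀ i b, i ∈ ptsOf ch.length k → b.bd = true → isCW b.w = true →
      (nodeAt ch i = some (K, b) → K.w.w2 = some 0 ∧ b.w.w2 = some 0) ∧
      (nodeAt ch i = some (b, K) → b.w.w2 = some 0 ∧ K.w.w2 = some 0) := by
    intro i b hi hbb hcb
    have ht := hnt i hi
    unfold topAt at ht
    constructor
    · intro hn1; rw [hn1] at ht; simp only at ht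
      cases hs : sing2N K b with
      | false => exact w2_zero_of_CW_CW_dead hKbd hbb hKcw hcb hs
      | true => have := topN_of_CW_CW_sing2 hKbd hbb hKcw hcb hs; rw [ht] at this; exact absurd this Bool.false_ne_true
    · intro hn1; rw [hn1] at ht; simp only at ht
      cases hs : sing2N b K with
      | false => exact w2_zero_of_CW_CW_dead hbb hKbd hcb hKcw hs
      | true => have := topN_of_CW_CW_sing2 hbb hKbd hcb hKcw hs; rw [ht] at this; exact absurd this Bool.false_ne_true
  refine NodeInv_modify hI6 hK _ ?_ ?_
  · intro j a hn0 hj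
    constructor
    · intro _ _ h; exfalso; rw [hKns.2] at h; exact Bool.false_ne_true h
    · intro _ hab hca
      obtain ⟨h1, h2⟩ := (key j a (mem_ptsOf_left hj) hab hca).2 hn0
      exact ⟨h1, hsub2 0 h2⟩
  · intro b hn0
    have hlen : k + 1 < ch.length := (List.getElem?_eq_some_iff.mp (nodeAt_some hn0).2).1
    constructor
    · intro _ hbb hcb
      obtain ⟨h1, h2⟩ := (key k b (mem_ptsOf_right hlen) hbb hcb).1 hn0
      exact ⟨hsub2 0 h1, h2⟩
    · intro _ _ h; exfalso; rw [hKns.2] at h; exact Bool.false_ne_true h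

theorem Inv6_step (topj : ℕ) (ch : Chain) (hF : F2facts topj ch) (hA : AccFacts topj ch) (hI3 : Inv3 ch) (hI4 : Inv4 ch)
    (hI6 : Inv6 ch) (m : Move) (hm : m ∈ legalMoves topj ch) : Inv6 (applyMove ch m) := by
  cases m with
  | D k => exact Inv6_deep hI3 hI4 hI6 (D_mem_legalMoves topj ch k hm)
  | A k => exact Inv6_accept hF hA hI4 hI6 (Or.inl hm)
  | AL k => exact Inv6_accept hF hA hI4 hI6 (Or.inr hm)
  | I i => exact Inv6_blowup3 hI3 hI6 (I_mem_legalMoves topj ch i hm)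
  | P i =>
    obtain ⟨hs, hha, hhb⟩ := P_mem_legalMoves topj ch i hm
    show Inv6 (blowup ch i (if topAt ch i then 3 else 2))
    cases ht : topAt ch i with
    | true => rw [if_pos rfl]; exact Inv6_blowup3 hI3 hI6 ht
    | false => rw [if_neg Bool.false_ne_true]; exact Inv6_blowup2 hI6 hs ht hha hhb

/-- all three invariants along legal plays -/
theorem Inv346_play {topj : ℕ} (htop : 2 ≤ topj) : ∀ (l : List Move) (ch : Chain),
    Inv3 ch → Inv4 ch → Inv6 ch → isLegalPlay topj ch l = true →
    Inv3 (applyMoves ch l) ∧ Inv4 (applyMoves ch l) ∧ Inv6 (applyMoves ch l) := by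
  intro l
  induction l with
  | nil => intro ch h3 h4 h6 _; exact ⟨h3, h4, h6⟩
  | cons m l ih =>
    intro ch h3 h4 h6 hl
    obtain ⟨hm, hl'⟩ := isLegalPlay_cons hl
    rw [applyMoves_cons]
    have hF := F2facts_of_topj htop ch
    have hA := AccFacts_of_topj htop ch
    exact ih (applyMove ch m) (Inv3_step topj ch hF h3 m hm) (Inv4_step topj ch hF hA h3 h4 m hm)
      (Inv6_step topj ch hF hA h3 h4 h6 m hm) hl'

theorem Inv346_play_bd (topj : ℕ) : ∀ (l : List Move) (ch : Chain), (∀ c ∈ ch, c.bd = true) →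
    Inv3 ch → Inv4 ch → Inv6 ch → isLegalPlay topj ch l = true →
    Inv3 (applyMoves ch l) ∧ Inv4 (applyMoves ch l) ∧ Inv6 (applyMoves ch l) := by
  intro l
  induction l with
  | nil => intro ch _ h3 h4 h6 _; exact ⟨h3, h4, h6⟩
  | cons m l ih =>
    intro ch hbd h3 h4 h6 hl
    obtain ⟨hm, hl'⟩ := isLegalPlay_cons hl
    rw [applyMoves_cons]
    have hF := F2facts_of_bd topj ch hbd
    have hA := AccFacts_of_bd topj ch hbd
    exact ih (applyMove ch m) (bd_applyMove hbd m) (Inv3_step topj ch hF h3 m hm) (Inv4_step topj ch hF hA h3 h4 m hm)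
      (Inv6_step topj ch hF hA h3 h4 h6 m hm) hl'

/-! ### consequences -/

/-- under the invariants: at an `AL`-accept of `k`, a cubic-weighted boundary neighbour `N` (necessarily across a NON-Sing₂ point, by
`neighbours_monic`) forces the residual shape of PROPOSITION (5): `w(K) = (2, k₁, 0)` and `w₂(N) = 0`, `w₀(N) = 0`. -/
theorem residual_shape {topj : ℕ} {s : Chain} (hF : F2facts topj s) (hI3 : Inv3 s) (hI6 : Inv6 s) {k : ℕ}
    (hm : Move.AL k ∈ legalMoves topj s) (i : ℕ) (hi : i ∈ ptsOf s.length k) (a b : Curve) (hn : nodeAt s i = some (a, b)) :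
    ∃ K, s[k]? = some K ∧ K.w.w0 = some 2 ∧
      ((b = K → 1 ≤ a.w3 → a.bd = true → K.w.w2 = some 0 ∧ a.w.w2 = some 0 ∧ a.w.w0 = some 0) ∧
       (a = K → 1 ≤ b.w3 → b.bd = true → K.w.w2 = some 0 ∧ b.w.w2 = some 0 ∧ b.w.w0 = some 0)) := by
  obtain ⟨⟨K, hK, hK2⟩, _⟩ := hF k (Or.inr hm)
  obtain ⟨K', hK', hκ⟩ := kindAt_some (AL_mem_legalMoves topj s k hm).1 (by decide)
  have e : K' = K := Option.some.inj (hK'.symm.trans hK)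
  subst e
  obtain ⟨hKbd, hKc, _⟩ := kindOf_light hκ
  obtain ⟨ha, hb⟩ := nodeAt_some hn
  refine ⟨K', hK, hK2, ?_, ?_⟩
  · intro e1 ha1 hab
    rw [e1] at hn
    obtain ⟨h1, h2⟩ := (hI6 i a K' hn).1 ha1 hKbd hKc
    exact ⟨h2, h1, hI3.1 a (List.mem_of_getElem? ha) ha1⟩
  · intro e1 hb1 hbb
    rw [e1] at hn
    obtain ⟨h1, h2⟩ := (hI6 i K' b hn).2 hb1 hKbd hKc
    exact ⟨h1, h2, hI3.1 b (List.mem_of_getElem? hb) hb1⟩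

/-- RESIDUAL SHAPE for ALL CHAINS under `G_mult` (any `topj ≥ 2`): in every legal play from a cubic-free state, if an `AL`-accepted
centre `K` has a cubic-weighted boundary neighbour `N` at one of its points, then `w₀(K) = 2`, `w₂(K) = 0`, `w₀(N) = 0`, `w₂(N) = 0`
— the hypothesis of PROPOSITION 9.15 (5) (and by `monic_neighbours_gmult` that point is not Sing₂). -/
theorem residual_shape_gmult {topj : ℕ} (htop : 2 ≤ topj) (ch₀ : Chain) (h0 : ∀ c ∈ ch₀, c.w3 = 0)
    (l₁ : List Move) (k : ℕ) (l₂ : List Move) (hl : isLegalPlay topj ch₀ (l₁ ++ Move.AL k :: l₂) = true)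
    (i : ℕ) (hi : i ∈ ptsOf (applyMoves ch₀ l₁).length k) (a b : Curve) (hn : nodeAt (applyMoves ch₀ l₁) i = some (a, b)) :
    ∃ K, (applyMoves ch₀ l₁)[k]? = some K ∧ K.w.w0 = some 2 ∧
      ((b = K → 1 ≤ a.w3 → a.bd = true → K.w.w2 = some 0 ∧ a.w.w2 = some 0 ∧ a.w.w0 = some 0) ∧
       (a = K → 1 ≤ b.w3 → b.bd = true → K.w.w2 = some 0 ∧ b.w.w2 = some 0 ∧ b.w.w0 = some 0)) := by
  obtain ⟨h1, h2⟩ := isLegalPlay_append l₁ (Move.AL k :: l₂) ch₀ hl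
  obtain ⟨hm, _⟩ := isLegalPlay_cons h2
  obtain ⟨hI3, _, hI6⟩ := Inv346_play htop l₁ ch₀ (Inv3_of_noCubic ch₀ h0) (Inv4_of_noCubic ch₀ h0) (Inv6_of_noCubic ch₀ h0) h1
  exact residual_shape (F2facts_of_topj htop _) hI3 hI6 hm i hi a b hn

/-- RESIDUAL SHAPE for ALL CHAINS in mode `uv`, any rule set. -/
theorem residual_shape_uv (topj : ℕ) (ch₀ : Chain) (hbd : ∀ c ∈ ch₀, c.bd = true) (h0 : ∀ c ∈ ch₀, c.w3 = 0)
    (l₁ : List Move) (k : ℕ) (l₂ : List Move) (hl : isLegalPlay topj ch₀ (l₁ ++ Move.AL k :: l₂) = true)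
    (i : ℕ) (hi : i ∈ ptsOf (applyMoves ch₀ l₁).length k) (a b : Curve) (hn : nodeAt (applyMoves ch₀ l₁) i = some (a, b)) :
    ∃ K, (applyMoves ch₀ l₁)[k]? = some K ∧ K.w.w0 = some 2 ∧
      ((b = K → 1 ≤ a.w3 → a.bd = true → K.w.w2 = some 0 ∧ a.w.w2 = some 0 ∧ a.w.w0 = some 0) ∧
       (a = K → 1 ≤ b.w3 → b.bd = true → K.w.w2 = some 0 ∧ b.w.w2 = some 0 ∧ b.w.w0 = some 0)) := by
  obtain ⟨h1, h2⟩ := isLegalPlay_append l₁ (Move.AL k :: l₂) ch₀ hl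
  obtain ⟨hm, _⟩ := isLegalPlay_cons h2
  obtain ⟨hI3, _, hI6⟩ := Inv346_play_bd topj l₁ ch₀ hbd (Inv3_of_noCubic ch₀ h0) (Inv4_of_noCubic ch₀ h0)
    (Inv6_of_noCubic ch₀ h0) h1
  exact residual_shape (F2facts_of_bd topj _ (bd_applyMoves topj l₁ ch₀ hbd)) hI3 hI6 hm i hi a b hn

/-- TOP POINTS NEVER CARRY CUBIC WEIGHT along legal plays under `G_mult` (S6 LEMMA clause «Q-born curves never meet top nodes», for
all chains): both branches of every top point of every reached state have `w₃ = 0`. -/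
theorem top_noCubic_gmult {topj : ℕ} (htop : 2 ≤ topj) (ch₀ : Chain) (h0 : ∀ c ∈ ch₀, c.w3 = 0) (l : List Move)
    (hl : isLegalPlay topj ch₀ l = true) (i : ℕ) (a b : Curve) (hn : nodeAt (applyMoves ch₀ l) i = some (a, b))
    (ht : topN a b = true) : a.w3 = 0 ∧ b.w3 = 0 :=
  top_noCubic (Inv3_play htop l ch₀ (Inv3_of_noCubic ch₀ h0) hl) hn ht

theorem top_noCubic_uv (topj : ℕ) (ch₀ : Chain) (hbd : ∀ c ∈ ch₀, c.bd = true) (h0 : ∀ c ∈ ch₀, c.w3 = 0) (l : List Move)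
    (hl : isLegalPlay topj ch₀ l = true) (i : ℕ) (a b : Curve) (hn : nodeAt (applyMoves ch₀ l) i = some (a, b))
    (ht : topN a b = true) : a.w3 = 0 ∧ b.w3 = 0 :=
  top_noCubic (Inv3_play_bd topj l ch₀ hbd (Inv3_of_noCubic ch₀ h0) hl) hn ht


/-! ## §B⁵. Birth records and the FAR-SIDE LEMMA of PROPOSITION 9.15 (5)(ii), for ALL chains (rev 8, g8)
PROPOSITION (5) is about HISTORY («X was born at a point of Y while Y was light-shaped»), which the state does not record. We make
the history explicit by a CONSERVATIVE EXTENSION of the game: every curve carries a BIRTH RECORD `par` = the two branches of the point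
at which it was born (initial curves: `none`); moves act on the records trivially, and `proj` forgets them — `proj_gApplyMoves` shows
the extended play projects EXACTLY onto the original play, so nothing about the game changes. Over the extension we prove the
inductive invariant `I5` = «a boundary curve with `w₃ = 0` and `w₀ = 3·w₂ + 2` (Δ := w₀ − 3w₂ = 2) that was born at a point whose left
(resp. right) branch was light-shaped `(2,·,0)` has a right (resp. left) neighbour `G` with finite `w₂(G)` and `3·w₂(G) ≤ w₀(G)`
(Δ(G) ≥ 0)» — this is the quantity Δ of loop note §9.15 (5)(ii) — and the FAR-SIDE LEMMA `farside_gmult|uv`: such a curve is never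
`AL`-accepted through its far point. What then remains by hand of PROPOSITION (5) is only the genesis bookkeeping (5)(i) (that in the
residual configuration one of the two light lines was born at a point of the other). -/

/-- a curve together with its birth record (the two branches of its birth point; `none` for initial curves) -/
structure GCurve where
  c : Curve
  par : Option (Curve × Curve)

abbrev GChain := List GCurve

def proj (g : GChain) : Chain := g.map GCurve.c

def lift (ch : Chain) : GChain := ch.map (fun c => ⟨c, none⟩)

/-- the newborn curve of a blow-up with exponent `α` at a point with branches `a`, `b` -/
def newborn (a b : Curve) (α : ℕ) : Curve :=
  ⟨⟨(a.w.add b.w).w0.map (· - α), (a.w.add b.w).w1.map (· + 1 - α), (a.w.add b.w).w2.map (· + 2 - α)⟩, a.w3 + b.w3 + 3 - α, true⟩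

def gBlowup (g : GChain) (i α : ℕ) : GChain :=
  match nodeAt (proj g) i with
  | none => g
  | some (a, b) => g.insertIdx (i + 1) ⟨newborn a b α, some (a, b)⟩

def gAccD (x : GCurve) : GCurve := ⟨{ x.c with w := x.c.w.sub 3 2 1 }, x.par⟩
def gAccA (x : GCurve) : GCurve := ⟨{ x.c with w := x.c.w.sub 2 1 0, w3 := x.c.w3 + 1 }, x.par⟩

/-- the moves on the extension: as before on the curves; a newborn records its birth point -/
def gApplyMove (g : GChain) : Move → GChain
  | .D k => g.modify k gAccD
  | .A k => g.modify k gAccA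
  | .AL k => g.modify k gAccA
  | .I i => gBlowup g i 3
  | .P i => gBlowup g i (if topAt (proj g) i then 3 else 2)

def gApplyMoves (g : GChain) : List Move → GChain
  | [] => g
  | m :: l => gApplyMoves (gApplyMove g m) l

theorem proj_getElem? (g : GChain) (i : ℕ) : (proj g)[i]? = g[i]?.map GCurve.c := by
  simp [proj, List.getElem?_map]

theorem proj_length (g : GChain) : (proj g).length = g.length := by simp [proj]

theorem proj_lift (ch : Chain) : proj (lift ch) = ch := by
  induction ch with
  | nil => rfl
  | cons c t ih => show c :: proj (lift t) = c :: t; rw [ih]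

theorem proj_modify (g : GChain) (k : ℕ) (F : GCurve → GCurve) (f : Curve → Curve) (hf : ∀ x, (F x).c = f x.c) :
    proj (g.modify k F) = (proj g).modify k f := by
  apply List.ext_getElem?
  intro i
  rw [List.getElem?_modify, proj_getElem?, proj_getElem?, List.getElem?_modify]
  cases g[i]? with
  | none => rfl
  | some x => by_cases h : k = i <;> simp [h, hf]

theorem proj_insertIdx : ∀ (g : GChain) (n : ℕ) (x : GCurve), proj (g.insertIdx n x) = (proj g).insertIdx n x.c
  | g, 0, x => by simp [proj]
  | [], n + 1, x => by simp [proj]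
  | y :: g, n + 1, x => by
    have ih := proj_insertIdx g n x
    simp only [proj, List.map_cons, List.insertIdx_succ_cons] at ih ⊢
    rw [ih]

theorem proj_gBlowup (g : GChain) (i α : ℕ) : proj (gBlowup g i α) = blowup (proj g) i α := by
  unfold gBlowup blowup
  cases h : nodeAt (proj g) i with
  | none => rfl
  | some ab =>
    obtain ⟨a, b⟩ := ab
    simp only []
    rw [proj_insertIdx]
    rfl

theorem proj_gApplyMove (g : GChain) (m : Move) : proj (gApplyMove g m) = applyMove (proj g) m := by
  cases m with
  | D k => exact proj_modify g k gAccD _ (fun x => rfl)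
  | A k => exact proj_modify g k gAccA _ (fun x => rfl)
  | AL k => exact proj_modify g k gAccA _ (fun x => rfl)
  | I i => exact proj_gBlowup g i 3
  | P i => exact proj_gBlowup g i _

/-- the extension projects exactly onto the game -/
theorem proj_gApplyMoves : ∀ (l : List Move) (g : GChain), proj (gApplyMoves g l) = applyMoves (proj g) l := by
  intro l
  induction l with
  | nil => intro g; rfl
  | cons m l ih => intro g; rw [applyMoves_cons, ← proj_gApplyMove]; exact ih (gApplyMove g m)

/-! ### the far-side invariant -/

/-- light-shaped: `(2, ·, 0)` -/
def LSw (w : W3) : Prop := w.w0 = some 2 ∧ w.w2 = some 0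
/-- Δ = w₀ − 3·w₂ = 2 (finite) -/
def D2 (w : W3) : Prop := ∃ x0 x2 : ℕ, w.w0 = some x0 ∧ w.w2 = some x2 ∧ x0 = 3 * x2 + 2
/-- Δ(G) ≥ 0 with finite `w₂` -/
def FarOK (G : Curve) : Prop := ∃ g2 : ℕ, G.w.w2 = some g2 ∧ ∀ g0 : ℕ, G.w.w0 = some g0 → 3 * g2 ≤ g0
/-- born at a point whose LEFT branch was light-shaped (far side = right) -/
def farR (X : GCurve) : Prop := ∃ a b, X.par = some (a, b) ∧ LSw a.w
/-- born at a point whose RIGHT branch was light-shaped (far side = left) -/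
def farL (X : GCurve) : Prop := ∃ a b, X.par = some (a, b) ∧ LSw b.w
def Scope (X : GCurve) : Prop := X.c.bd = true ∧ X.c.w3 = 0 ∧ D2 X.c.w

def I5 (g : GChain) : Prop :=
  ∀ i X, g[i]? = some X → Scope X →
    (farR X → ∃ G, g[i + 1]? = some G ∧ FarOK G.c) ∧ (farL X → ∃ j G, j + 1 = i ∧ g[j]? = some G ∧ FarOK G.c)

theorem I5_lift (ch : Chain) : I5 (lift ch) := by
  intro i X hX _
  have hp : X.par = none := by
    unfold lift at hX
    rw [List.getElem?_map] at hX
    cases h : ch[i]? with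
    | none => rw [h] at hX; simp at hX
    | some c => rw [h] at hX; simp at hX; rw [← hX]
  constructor
  · rintro ⟨a, b, hab, _⟩; rw [hp] at hab; exact absurd hab (by simp)
  · rintro ⟨a, b, hab, _⟩; rw [hp] at hab; exact absurd hab (by simp)

/-- preservation through a modification of one curve that keeps the record, does not create scope, and keeps `FarOK` -/
theorem I5_modify {g : GChain} (hI : I5 g) (k : ℕ) (F : GCurve → GCurve) (hpar : ∀ x, (F x).par = x.par)
    (hS : ∀ x, g[k]? = some x → Scope (F x) → Scope x) (hF : ∀ x, g[k]? = some x → FarOK x.c → FarOK (F x).c) :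
    I5 (g.modify k F) := by
  intro i X hX hSc
  rw [List.getElem?_modify] at hX
  cases hX0 : g[i]? with
  | none => simp [hX0] at hX
  | some X0 =>
    simp [hX0] at hX
    -- hX : (if k = i then F X0 else X0) = X; the curve at `i` before the move is `X0`
    have hSc0 : Scope X0 := by
      by_cases h : k = i
      · simp [h] at hX; rw [← hX] at hSc; exact hS X0 (by rw [h]; exact hX0) hSc
      · simp [h] at hX; rw [← hX] at hSc; exact hSc
    have hparX : X.par = X0.par := by
      by_cases h : k = i
      · simp [h] at hX; rw [← hX]; exact hpar X0
      · simp [h] at hX; rw [← hX]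
    obtain ⟨hR, hL⟩ := hI i X0 hX0 hSc0
    constructor
    · rintro ⟨a, b, hab, hls⟩
      obtain ⟨G, hG, hok⟩ := hR ⟨a, b, by rw [← hparX]; exact hab, hls⟩
      by_cases h : k = i + 1
      · refine ⟨F G, ?_, hF G (by rw [h]; exact hG) hok⟩
        rw [List.getElem?_modify, hG]; simp [h]
      · refine ⟨G, ?_, hok⟩
        rw [List.getElem?_modify, hG]; simp [h]
    · rintro ⟨a, b, hab, hls⟩
      obtain ⟨j, G, hj, hG, hok⟩ := hL ⟨a, b, by rw [← hparX]; exact hab, hls⟩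
      by_cases h : k = j
      · refine ⟨j, F G, hj, ?_, hF G (by rw [h]; exact hG) hok⟩
        rw [List.getElem?_modify, hG]; simp [h]
      · refine ⟨j, G, hj, ?_, hok⟩
        rw [List.getElem?_modify, hG]; simp [h]

/-- preservation through the insertion of a newborn `N` between `A = g[j]` and `B = g[j+1]` -/
theorem I5_insert {g : GChain} (hI : I5 g) {j : ℕ} {A B : GCurve} (hA : g[j]? = some A) (hB : g[j + 1]? = some B) (N : GCurve)
    (hAN : Scope A → farR A → FarOK N.c) (hBN : Scope B → farL B → FarOK N.c)
    (hNR : Scope N → farR N → FarOK B.c) (hNL : Scope N → farL N → FarOK A.c) :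
    I5 (g.insertIdx (j + 1) N) := by
  have hlen : j + 1 ≤ g.length := by have := (List.getElem?_eq_some_iff.mp hB).1; omega
  -- reading the new chain
  have rd : ∀ i, (g.insertIdx (j + 1) N)[i]? = if i < j + 1 then g[i]? else if i = j + 1 then some N else g[i - 1]? := by
    intro i
    rw [List.getElem?_insertIdx]
    by_cases h1 : i < j + 1
    · rw [if_pos h1, if_pos h1]
    · rw [if_neg h1, if_neg h1]
      by_cases h2 : i = j + 1
      · subst h2; rw [if_pos rfl, if_pos rfl, if_pos hlen]
      · rw [if_neg h2, if_neg h2]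
  intro i X hX hSc
  rw [rd] at hX
  rcases Nat.lt_trichotomy i (j + 1) with hlt | heq | hgt
  · -- an old curve left of the newborn (possibly `A` itself)
    rw [if_pos hlt] at hX
    obtain ⟨hR, hL⟩ := hI i X hX hSc
    constructor
    · intro hf
      by_cases hi : i = j
      · subst hi
        have e : X = A := Option.some.inj (hX.symm.trans hA)
        subst e
        refine ⟨N, ?_, hAN hSc hf⟩
        rw [rd, if_neg (lt_irrefl _), if_pos rfl]
      · obtain ⟨G, hG, hok⟩ := hR hf
        refine ⟨G, ?_, hok⟩
        rw [rd, if_pos (by omega)]; exact hG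
    · intro hf
      obtain ⟨j', G, hj', hG, hok⟩ := hL hf
      refine ⟨j', G, hj', ?_, hok⟩
      rw [rd, if_pos (by omega)]; exact hG
  · -- the newborn
    subst heq
    rw [if_neg (lt_irrefl _), if_pos rfl] at hX
    have e : X = N := (Option.some.inj hX).symm
    subst e
    constructor
    · intro hf
      refine ⟨B, ?_, hNR hSc hf⟩
      rw [rd, if_neg (by omega), if_neg (by omega)]
      show g[j + 1 + 1 - 1]? = some B
      rw [Nat.add_sub_cancel]; exact hB
    · intro hf
      refine ⟨j, A, rfl, ?_, hNL hSc hf⟩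
      rw [rd, if_pos (by omega)]; exact hA
  · -- an old curve right of the newborn (possibly `B` itself), shifted by one
    rw [if_neg (by omega), if_neg (by omega)] at hX
    obtain ⟨hR, hL⟩ := hI (i - 1) X hX hSc
    constructor
    · intro hf
      obtain ⟨G, hG, hok⟩ := hR hf
      refine ⟨G, ?_, hok⟩
      rw [rd, if_neg (by omega), if_neg (by omega)]
      rw [show i + 1 - 1 = i - 1 + 1 by omega]; exact hG
    · intro hf
      by_cases hi : i = j + 2
      · subst hi
        have e : X = B := by
          rw [show j + 2 - 1 = j + 1 by omega] at hX
          exact Option.some.inj (hX.symm.trans hB)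
        subst e
        refine ⟨j + 1, N, by omega, ?_, hBN hSc hf⟩
        rw [rd, if_neg (lt_irrefl _), if_pos rfl]
      · obtain ⟨j', G, hj', hG, hok⟩ := hL hf
        refine ⟨j' + 1, G, by omega, ?_, hok⟩
        rw [rd, if_neg (by omega), if_neg (by omega), Nat.add_sub_cancel]; exact hG

/-! ### the arithmetic of Δ through the moves -/

theorem FarOK_accD {G : Curve} (h : FarOK G) : FarOK { G with w := G.w.sub 3 2 1 } := by
  obtain ⟨g2, hg2, hg⟩ := h
  refine ⟨g2 - 1, by simp [W3.sub, hg2], ?_⟩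
  intro g0 hg0
  simp only [W3.sub] at hg0
  cases h0 : G.w.w0 with
  | none => rw [h0] at hg0; simp at hg0
  | some y => rw [h0] at hg0; simp at hg0; have := hg y h0; omega

theorem FarOK_accA {G : Curve} (h : FarOK G) (h2 : G.w.w0 = some 2) : FarOK { G with w := G.w.sub 2 1 0, w3 := G.w3 + 1 } := by
  obtain ⟨g2, hg2, hg⟩ := h
  have := hg 2 h2
  refine ⟨g2 - 0, by simp [W3.sub, hg2], ?_⟩
  intro g0 _; omega

theorem D2_of_accD {X : Curve} (hd : isDeepW X.w = true) (h : D2 (X.w.sub 3 2 1)) : D2 X.w := by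
  obtain ⟨x0, x2, hx0, hx2, hx⟩ := h
  unfold isDeepW W3.ge at hd
  simp only [W3.sub] at hx0 hx2
  cases h0 : X.w.w0 with
  | none => rw [h0] at hx0; simp at hx0
  | some y0 =>
    cases h2' : X.w.w2 with
    | none => rw [h2'] at hx2; simp at hx2
    | some y2 =>
      rw [h0] at hx0; rw [h2'] at hx2; simp at hx0 hx2
      rw [h0, h2'] at hd; simp only [wge_some, Bool.and_eq_true, decide_eq_true_eq] at hd
      exact ⟨y0, y2, h0, h2', by omega⟩

/-- the far partner of a Δ = 2 curve after a blow-up of the point between them (any exponent `α ≤ 3`) still has Δ ≥ 0 -/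
theorem FarOK_newborn_right {a b : Curve} (α : ℕ) (hα : α = 2 ∨ α = 3) (ha : D2 a.w) (hb : FarOK b) : FarOK (newborn a b α) := by
  obtain ⟨x0, x2, hx0, hx2, hx⟩ := ha
  obtain ⟨g2, hg2, hg⟩ := hb
  refine ⟨x2 + g2 + 2 - α, by simp [newborn, W3.add, hx2, hg2, wadd_some], ?_⟩
  intro g0 hg0
  simp only [newborn, W3.add, hx0] at hg0
  cases h0 : b.w.w0 with
  | none => rw [h0] at hg0; simp [wadd] at hg0
  | some y => rw [h0, wadd_some] at hg0; simp at hg0; have := hg y h0; rcases hα with rfl | rfl <;> omega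

theorem FarOK_newborn_left {a b : Curve} (α : ℕ) (hα : α = 2 ∨ α = 3) (hb : D2 b.w) (ha : FarOK a) : FarOK (newborn a b α) := by
  obtain ⟨x0, x2, hx0, hx2, hx⟩ := hb
  obtain ⟨g2, hg2, hg⟩ := ha
  refine ⟨g2 + x2 + 2 - α, by simp [newborn, W3.add, hx2, hg2, wadd_some], ?_⟩
  intro g0 hg0
  simp only [newborn, W3.add, hx0] at hg0
  cases h0 : a.w.w0 with
  | none => rw [h0] at hg0; simp [wadd] at hg0
  | some y => rw [h0, wadd_some] at hg0; simp at hg0; have := hg y h0; rcases hα with rfl | rfl <;> omega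

/-- at birth: a newborn with Δ = 2 whose left branch is light-shaped has a right branch with Δ = 0 (hence ≥ 0) -/
theorem FarOK_birth_right {a b : Curve} {α : ℕ} (hα : α ≤ 3) (hN : D2 (newborn a b α).w) (h3 : (newborn a b α).w3 = 0)
    (ha : LSw a.w) : FarOK b := by
  obtain ⟨ha0, ha2⟩ := ha
  obtain ⟨x0, x2, hx0, hx2, hx⟩ := hN
  simp only [newborn] at h3
  simp only [newborn, W3.add, ha0, ha2] at hx0 hx2
  cases h0 : b.w.w0 with
  | none => rw [h0] at hx0; simp [wadd] at hx0
  | some y0 =>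
    cases h2 : b.w.w2 with
    | none => rw [h2] at hx2; simp [wadd] at hx2
    | some y2 =>
      rw [h0, wadd_some] at hx0; rw [h2, wadd_some] at hx2; simp at hx0 hx2
      exact ⟨y2, h2, fun g0 hg0 => by rw [h0] at hg0; cases hg0; omega⟩

theorem FarOK_birth_left {a b : Curve} {α : ℕ} (hα : α ≤ 3) (hN : D2 (newborn a b α).w) (h3 : (newborn a b α).w3 = 0)
    (hb : LSw b.w) : FarOK a := by
  obtain ⟨hb0, hb2⟩ := hb
  obtain ⟨x0, x2, hx0, hx2, hx⟩ := hN
  simp only [newborn] at h3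
  simp only [newborn, W3.add, hb0, hb2] at hx0 hx2
  cases h0 : a.w.w0 with
  | none => rw [h0] at hx0; simp [wadd] at hx0
  | some y0 =>
    cases h2 : a.w.w2 with
    | none => rw [h2] at hx2; simp [wadd] at hx2
    | some y2 =>
      rw [h0, wadd_some] at hx0; rw [h2, wadd_some] at hx2; simp at hx0 hx2
      exact ⟨y2, h2, fun g0 hg0 => by rw [h0] at hg0; cases hg0; omega⟩

/-! ### preservation by every legal move -/

theorem I5_gBlowup {g : GChain} (hI : I5 g) (i α : ℕ) (hα : α = 2 ∨ α = 3) : I5 (gBlowup g i α) := by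
  unfold gBlowup
  cases hn : nodeAt (proj g) i with
  | none => exact hI
  | some ab =>
    obtain ⟨a, b⟩ := ab
    simp only []
    obtain ⟨ha, hb⟩ := nodeAt_some hn
    rw [proj_getElem?] at ha hb
    cases hA : g[i]? with
    | none => rw [hA] at ha; simp at ha
    | some A =>
      cases hB : g[i + 1]? with
      | none => rw [hB] at hb; simp at hb
      | some B =>
        rw [hA] at ha; rw [hB] at hb; simp at ha hb
        -- ha : A.c = a, hb : B.c = b
        refine I5_insert hI hA hB ⟨newborn a b α, some (a, b)⟩ ?_ ?_ ?_ ?_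
        · intro hSc hf
          obtain ⟨G, hG, hok⟩ := (hI i A hA hSc).1 hf
          rw [hB] at hG; cases hG
          rw [← ha, ← hb]; exact FarOK_newborn_right α hα hSc.2.2 hok
        · intro hSc hf
          obtain ⟨j, G, hj, hG, hok⟩ := (hI (i + 1) B hB hSc).2 hf
          have : j = i := by omega
          subst this
          rw [hA] at hG; cases hG
          rw [← ha, ← hb]; exact FarOK_newborn_left α hα hSc.2.2 hok
        · rintro ⟨_, h3, hD⟩ ⟨a', b', hab, hls⟩
          simp only [Option.some.injEq, Prod.mk.injEq] at hab
          obtain ⟨rfl, rfl⟩ := hab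
          rw [hb]; exact FarOK_birth_right (by omega) hD h3 hls
        · rintro ⟨_, h3, hD⟩ ⟨a', b', hab, hls⟩
          simp only [Option.some.injEq, Prod.mk.injEq] at hab
          obtain ⟨rfl, rfl⟩ := hab
          rw [ha]; exact FarOK_birth_left (by omega) hD h3 hls

theorem I5_D {g : GChain} (hI : I5 g) {k : ℕ} (hk : kindAt (proj g) k = .deep) : I5 (gApplyMove g (.D k)) := by
  obtain ⟨K, hK, hκ⟩ := kindAt_some hk (by decide)
  obtain ⟨_, hKdeep⟩ := kindOf_deep hκ
  rw [proj_getElem?] at hK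
  refine I5_modify hI k gAccD (fun x => rfl) ?_ ?_
  · intro x hx ⟨hbd, h3, hD⟩
    rw [hx] at hK; simp at hK
    refine ⟨hbd, h3, ?_⟩
    rw [← hK] at hKdeep
    exact D2_of_accD hKdeep hD
  · intro x _ hok; exact FarOK_accD hok

theorem I5_A {topj : ℕ} {g : GChain} (hF : F2facts topj (proj g)) (hI : I5 g) {k : ℕ}
    (hm : Move.A k ∈ legalMoves topj (proj g) ∨ Move.AL k ∈ legalMoves topj (proj g)) : I5 (g.modify k gAccA) := by
  obtain ⟨⟨K, hK, hK2⟩, _⟩ := hF k hm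
  rw [proj_getElem?] at hK
  refine I5_modify hI k gAccA (fun x => rfl) ?_ ?_
  · intro x _ ⟨_, h3, _⟩; exfalso; simp [gAccA] at h3
  · intro x hx hok
    rw [hx] at hK; simp at hK
    rw [← hK] at hK2
    exact FarOK_accA hok hK2

theorem I5_step (topj : ℕ) (g : GChain) (hF : F2facts topj (proj g)) (hI : I5 g) (m : Move) (hm : m ∈ legalMoves topj (proj g)) :
    I5 (gApplyMove g m) := by
  cases m with
  | D k => exact I5_D hI (D_mem_legalMoves topj _ k hm)
  | A k => exact I5_A hF hI (Or.inl hm)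
  | AL k => exact I5_A hF hI (Or.inr hm)
  | I i => exact I5_gBlowup hI i 3 (Or.inr rfl)
  | P i =>
    show I5 (gBlowup g i (if topAt (proj g) i then 3 else 2))
    cases topAt (proj g) i
    · exact I5_gBlowup hI i 2 (Or.inl rfl)
    · exact I5_gBlowup hI i 3 (Or.inr rfl)

theorem I5_play {topj : ℕ} (htop : 2 ≤ topj) : ∀ (l : List Move) (g : GChain), I5 g → isLegalPlay topj (proj g) l = true →
    I5 (gApplyMoves g l) := by
  intro l
  induction l with
  | nil => intro g h _; exact h
  | cons m l ih =>
    intro g h hl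
    obtain ⟨hm, hl'⟩ := isLegalPlay_cons hl
    rw [← proj_gApplyMove] at hl'
    exact ih (gApplyMove g m) (I5_step topj g (F2facts_of_topj htop _) h m hm) hl'

theorem I5_play_bd (topj : ℕ) : ∀ (l : List Move) (g : GChain), (∀ c ∈ proj g, c.bd = true) → I5 g →
    isLegalPlay topj (proj g) l = true → I5 (gApplyMoves g l) := by
  intro l
  induction l with
  | nil => intro g _ h _; exact h
  | cons m l ih =>
    intro g hbd h hl
    obtain ⟨hm, hl'⟩ := isLegalPlay_cons hl
    rw [← proj_gApplyMove] at hl'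
    have hbd' : ∀ c ∈ proj (gApplyMove g m), c.bd = true := by rw [proj_gApplyMove]; exact bd_applyMove hbd m
    exact ih (gApplyMove g m) hbd' (I5_step topj g (F2facts_of_bd topj _ hbd) h m hm) hl'

/-! ### the far-side lemma -/

theorem o2_of_sing2 {a b : Curve} (hs : sing2N a b = true) : wge (wadd a.w.w2 b.w.w2) 1 = true := by
  unfold sing2N at hs
  simp only [Bool.and_eq_true] at hs
  have h := hs.1
  unfold isSingW W3.ge W3.add at h
  simp only [Bool.and_eq_true] at h
  exact h.2

/-- the far point of a Δ = 2 curve in scope is never an enabling (Sing₂, non-top) point -/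
theorem far_not_enabling {X G : Curve} (hX : D2 X.w) (hG : FarOK G) :
    (sing2N X G = true → topN X G = false → False) ∧ (sing2N G X = true → topN G X = false → False) := by
  obtain ⟨x0, x2, hx0, hx2, hx⟩ := hX
  obtain ⟨g2, hg2, hg⟩ := hG
  constructor
  · intro hs ht
    obtain ⟨x, y, hx', hy, hxy⟩ := o0_of_sing2_not_top X G hs ht
    have h2 := o2_of_sing2 hs
    rw [hx0] at hx'; cases hx'
    have := hg y hy
    rw [hx2, hg2, wadd_some, wge_some, decide_eq_true_eq] at h2
    omega
  · intro hs ht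
    obtain ⟨y, x, hy, hx', hxy⟩ := o0_of_sing2_not_top G X hs ht
    have h2 := o2_of_sing2 hs
    rw [hx0] at hx'; cases hx'
    have := hg y hy
    rw [hx2, hg2, wadd_some, wge_some, decide_eq_true_eq] at h2
    omega

/-- under `I5`, `AccFacts` and `Inv3`: an `AL`-accepted centre in scope born with a light-shaped left (right) branch is not accepted
through its right (left) point — that point is not Sing₂ -/
theorem farside {topj : ℕ} {g : GChain} (hI : I5 g) (hF : F2facts topj (proj g)) (hA : AccFacts topj (proj g))
    (hI3 : Inv3 (proj g)) {k : ℕ} (hm : Move.AL k ∈ legalMoves topj (proj g)) (X : GCurve) (hX : g[k]? = some X)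
    (hw2 : X.c.w.w2 = some 0) :
    (farR X → sing2At (proj g) k = false) ∧ (farL X → ∀ j, j + 1 = k → sing2At (proj g) j = false) := by
  obtain ⟨K, hK, hκ⟩ := kindAt_some (AL_mem_legalMoves topj _ k hm).1 (by decide)
  have hKX : K = X.c := by rw [proj_getElem?, hX] at hK; simp at hK; exact hK.symm
  obtain ⟨hKbd, hKc, _⟩ := kindOf_light hκ
  have hK3 : K.w3 = 0 := by
    obtain ⟨K', hK', h3⟩ := centre_monic hF hI3 hm k (Or.inr (Or.inr rfl))
    have e : K' = K := Option.some.inj (hK'.symm.trans hK)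
    rw [e] at h3; exact h3
  have hK2 : K.w.w0 = some 2 := by
    obtain ⟨⟨K', hK', h2⟩, _⟩ := hF k (Or.inr hm)
    have e : K' = K := Option.some.inj (hK'.symm.trans hK)
    rw [e] at h2; exact h2
  subst hKX
  have hSc : Scope X := ⟨hKbd, hK3, 2, 0, hK2, hw2, by omega⟩
  obtain ⟨hR, hL⟩ := hI k X hX hSc
  constructor
  · intro hf
    obtain ⟨G, hG, hok⟩ := hR hf
    have hn : nodeAt (proj g) k = some (X.c, G.c) := by
      unfold nodeAt; rw [proj_getElem?, proj_getElem?, hX, hG]; rfl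
    have hlen : k + 1 < (proj g).length := by rw [proj_length]; exact (List.getElem?_eq_some_iff.mp hG).1
    have ht := hA k (Or.inr hm) k (mem_ptsOf_right hlen)
    unfold topAt at ht; rw [hn] at ht; simp only at ht
    cases hs : sing2At (proj g) k with
    | false => rfl
    | true => exfalso; unfold sing2At at hs; rw [hn] at hs; simp only at hs; exact (far_not_enabling hSc.2.2 hok).1 hs ht
  · intro hf j hj
    obtain ⟨j', G, hj', hG, hok⟩ := hL hf
    have e : j' = j := by omega
    subst e
    have hn : nodeAt (proj g) j' = some (G.c, X.c) := by
      unfold nodeAt; rw [proj_getElem?, proj_getElem?, hG, hj', hX]; rfl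
    have ht := hA k (Or.inr hm) j' (mem_ptsOf_left hj')
    unfold topAt at ht; rw [hn] at ht; simp only at ht
    cases hs : sing2At (proj g) j' with
    | false => rfl
    | true => exfalso; unfold sing2At at hs; rw [hn] at hs; simp only at hs; exact (far_not_enabling hSc.2.2 hok).2 hs ht

/-- FAR-SIDE LEMMA (PROPOSITION 9.15 (5)(ii)) for ALL CHAINS under `G_mult` (any `topj ≥ 2`). Run any legal play from a cubic-free
state `ch₀` together with its birth records (`gApplyMoves (lift ch₀) l₁`; by `proj_gApplyMoves` this IS the play). If the centre `K` of
an `AL` accept has `w₂(K) = 0` and was born at a point whose LEFT (resp. RIGHT) branch was light-shaped `(2,·,0)` at that moment,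
then the RIGHT (resp. LEFT) point of `K` is not Sing₂ — the accept goes through the near point. -/
theorem farside_gmult {topj : ℕ} (htop : 2 ≤ topj) (ch₀ : Chain) (h0 : ∀ c ∈ ch₀, c.w3 = 0)
    (l₁ : List Move) (k : ℕ) (l₂ : List Move) (hl : isLegalPlay topj ch₀ (l₁ ++ Move.AL k :: l₂) = true)
    (X : GCurve) (hX : (gApplyMoves (lift ch₀) l₁)[k]? = some X) (hw2 : X.c.w.w2 = some 0) :
    (farR X → sing2At (applyMoves ch₀ l₁) k = false) ∧ (farL X → ∀ j, j + 1 = k → sing2At (applyMoves ch₀ l₁) j = false) := by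
  obtain ⟨h1, h2⟩ := isLegalPlay_append l₁ (Move.AL k :: l₂) ch₀ hl
  obtain ⟨hm, _⟩ := isLegalPlay_cons h2
  have hp : proj (gApplyMoves (lift ch₀) l₁) = applyMoves ch₀ l₁ := by rw [proj_gApplyMoves, proj_lift]
  have hI : I5 (gApplyMoves (lift ch₀) l₁) := I5_play htop l₁ (lift ch₀) (I5_lift ch₀) (by rw [proj_lift]; exact h1)
  have hI3 : Inv3 (applyMoves ch₀ l₁) := Inv3_play htop l₁ ch₀ (Inv3_of_noCubic ch₀ h0) h1
  rw [← hp] at hI3 hm ⊢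
  exact farside hI (F2facts_of_topj htop _) (AccFacts_of_topj htop _) hI3 hm X hX hw2

/-- FAR-SIDE LEMMA for ALL CHAINS in mode `uv` (all branches boundary), any rule set. -/
theorem farside_uv (topj : ℕ) (ch₀ : Chain) (hbd : ∀ c ∈ ch₀, c.bd = true) (h0 : ∀ c ∈ ch₀, c.w3 = 0)
    (l₁ : List Move) (k : ℕ) (l₂ : List Move) (hl : isLegalPlay topj ch₀ (l₁ ++ Move.AL k :: l₂) = true)
    (X : GCurve) (hX : (gApplyMoves (lift ch₀) l₁)[k]? = some X) (hw2 : X.c.w.w2 = some 0) :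
    (farR X → sing2At (applyMoves ch₀ l₁) k = false) ∧ (farL X → ∀ j, j + 1 = k → sing2At (applyMoves ch₀ l₁) j = false) := by
  obtain ⟨h1, h2⟩ := isLegalPlay_append l₁ (Move.AL k :: l₂) ch₀ hl
  obtain ⟨hm, _⟩ := isLegalPlay_cons h2
  have hp : proj (gApplyMoves (lift ch₀) l₁) = applyMoves ch₀ l₁ := by rw [proj_gApplyMoves, proj_lift]
  have hI : I5 (gApplyMoves (lift ch₀) l₁) :=
    I5_play_bd topj l₁ (lift ch₀) (by rw [proj_lift]; exact hbd) (I5_lift ch₀) (by rw [proj_lift]; exact h1)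
  have hI3 : Inv3 (applyMoves ch₀ l₁) := Inv3_play_bd topj l₁ ch₀ hbd (Inv3_of_noCubic ch₀ h0) h1
  have hbd' : ∀ c ∈ applyMoves ch₀ l₁, c.bd = true := bd_applyMoves topj l₁ ch₀ hbd
  rw [← hp] at hI3 hm hbd' ⊢
  exact farside hI (F2facts_of_bd topj _ hbd') (AccFacts_of_bd topj _ hbd') hI3 hm X hX hw2


/-! ## §B⁶. The genesis bookkeeping of PROPOSITION 9.15 (5)(i) and the FULL monic-neighbours theorem for seeds (rev 9, g8)
Over the birth-record extension of §B⁵ four more inductive invariants — `G0` (a curve without birth record is an end of the chain; true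
for initial chains of length ≤ 2), `B2` (a curve born next to a cubic-weighted branch has `w₀ = 0` for ever), `G1` (GENESIS: of two
adjacent curves, either both are initial, or one was born at a point of the other, whose weights since then changed at most by ONE
`A/AL` accept — `Rel`), `I8` (a cubic-weighted boundary curve with `w₀ = w₂ = 0` born with a light-shaped right/left branch has a
right/left neighbour with `w₀ = 0`: it was accepted through its near point, by the far-side lemma) — and `NB` (non-boundary branches
keep `w₃ = 0`). With `Inv3/4/6`, `I5` and `residual_shape` they EXCLUDE the residual configuration: `prop5_gmult|uv` = PROPOSITION
9.15 (5) and hence THEOREM 9.15 (4) in full — at every `AL` accept BOTH neighbours have `w₃ = 0` — for every legal play from every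
cubic-free initial chain of length ≤ 2 (all seeds `[V(t), V(s)]`, `[V(s), R]` of the boxes, and beyond). -/

/-! ### generic neighbour invariants over the extension -/

def NbrInv (P QR QL : GCurve → Prop) (okR okL : Curve → Prop) (g : GChain) : Prop :=
  ∀ i X, g[i]? = some X → P X →
    (QR X → ∃ G, g[i + 1]? = some G ∧ okR G.c) ∧ (QL X → ∃ j G, j + 1 = i ∧ g[j]? = some G ∧ okL G.c)

theorem NbrInv_modify {P QR QL : GCurve → Prop} {okR okL : Curve → Prop} {g : GChain} (hI : NbrInv P QR QL okR okL g) (k : ℕ)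
    (F : GCurve → GCurve) (hQR : ∀ x, QR (F x) ↔ QR x) (hQL : ∀ x, QL (F x) ↔ QL x)
    (hK : ∀ x, g[k]? = some x → P (F x) →
      P x ∨ ((QR x → ∃ G, g[k + 1]? = some G ∧ okR G.c) ∧ (QL x → ∃ j G, j + 1 = k ∧ g[j]? = some G ∧ okL G.c)))
    (hFR : ∀ x, g[k]? = some x → okR x.c → okR (F x).c) (hFL : ∀ x, g[k]? = some x → okL x.c → okL (F x).c) :
    NbrInv P QR QL okR okL (g.modify k F) := by
  intro i X hX hP
  rw [List.getElem?_modify] at hX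
  cases hX0 : g[i]? with
  | none => simp [hX0] at hX
  | some X0 =>
    simp [hX0] at hX
    by_cases hki : k = i
    · subst hki
      simp at hX
      subst hX
      have hnb : (QR X0 → ∃ G, g[k + 1]? = some G ∧ okR G.c) ∧ (QL X0 → ∃ j G, j + 1 = k ∧ g[j]? = some G ∧ okL G.c) := by
        rcases hK X0 hX0 hP with hP0 | hfresh
        · exact hI k X0 hX0 hP0
        · exact hfresh
      constructor
      · intro hq
        obtain ⟨G, hG, hok⟩ := hnb.1 ((hQR X0).mp hq)
        refine ⟨G, ?_, hok⟩
        rw [List.getElem?_modify, hG]; simp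
      · intro hq
        obtain ⟨j, G, hj, hG, hok⟩ := hnb.2 ((hQL X0).mp hq)
        refine ⟨j, G, hj, ?_, hok⟩
        rw [List.getElem?_modify, hG]; simp [show k ≠ j by omega]
    · simp [hki] at hX
      subst hX
      obtain ⟨hR, hL⟩ := hI i X0 hX0 hP
      constructor
      · intro hq
        obtain ⟨G, hG, hok⟩ := hR hq
        by_cases h : k = i + 1
        · refine ⟨F G, ?_, hFR G (by rw [h]; exact hG) hok⟩
          rw [List.getElem?_modify, hG]; simp [h]
        · refine ⟨G, ?_, hok⟩
          rw [List.getElem?_modify, hG]; simp [h]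
      · intro hq
        obtain ⟨j, G, hj, hG, hok⟩ := hL hq
        by_cases h : k = j
        · refine ⟨j, F G, hj, ?_, hFL G (by rw [h]; exact hG) hok⟩
          rw [List.getElem?_modify, hG]; simp [h]
        · refine ⟨j, G, hj, ?_, hok⟩
          rw [List.getElem?_modify, hG]; simp [h]

theorem NbrInv_insert {P QR QL : GCurve → Prop} {okR okL : Curve → Prop} {g : GChain} (hI : NbrInv P QR QL okR okL g) {j : ℕ}
    {A B : GCurve} (hA : g[j]? = some A) (hB : g[j + 1]? = some B) (N : GCurve)
    (hAN : P A → QR A → okR N.c) (hBN : P B → QL B → okL N.c) (hNR : P N → QR N → okR B.c) (hNL : P N → QL N → okL A.c) :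
    NbrInv P QR QL okR okL (g.insertIdx (j + 1) N) := by
  have hlen : j + 1 ≤ g.length := by have := (List.getElem?_eq_some_iff.mp hB).1; omega
  have rd : ∀ i, (g.insertIdx (j + 1) N)[i]? = if i < j + 1 then g[i]? else if i = j + 1 then some N else g[i - 1]? := by
    intro i
    rw [List.getElem?_insertIdx]
    by_cases h1 : i < j + 1
    · rw [if_pos h1, if_pos h1]
    · rw [if_neg h1, if_neg h1]
      by_cases h2 : i = j + 1
      · subst h2; rw [if_pos rfl, if_pos rfl, if_pos hlen]
      · rw [if_neg h2, if_neg h2]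
  intro i X hX hSc
  rw [rd] at hX
  rcases Nat.lt_trichotomy i (j + 1) with hlt | heq | hgt
  · rw [if_pos hlt] at hX
    obtain ⟨hR, hL⟩ := hI i X hX hSc
    constructor
    · intro hf
      by_cases hi : i = j
      · subst hi
        have e : X = A := Option.some.inj (hX.symm.trans hA)
        subst e
        refine ⟨N, ?_, hAN hSc hf⟩
        rw [rd, if_neg (lt_irrefl _), if_pos rfl]
      · obtain ⟨G, hG, hok⟩ := hR hf
        refine ⟨G, ?_, hok⟩
        rw [rd, if_pos (by omega)]; exact hG
    · intro hf
      obtain ⟨j', G, hj', hG, hok⟩ := hL hf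
      refine ⟨j', G, hj', ?_, hok⟩
      rw [rd, if_pos (by omega)]; exact hG
  · subst heq
    rw [if_neg (lt_irrefl _), if_pos rfl] at hX
    have e : X = N := (Option.some.inj hX).symm
    subst e
    constructor
    · intro hf
      refine ⟨B, ?_, hNR hSc hf⟩
      rw [rd, if_neg (by omega), if_neg (by omega)]
      show g[j + 1 + 1 - 1]? = some B
      rw [Nat.add_sub_cancel]; exact hB
    · intro hf
      refine ⟨j, A, rfl, ?_, hNL hSc hf⟩
      rw [rd, if_pos (by omega)]; exact hA
  · rw [if_neg (by omega), if_neg (by omega)] at hX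
    obtain ⟨hR, hL⟩ := hI (i - 1) X hX hSc
    constructor
    · intro hf
      obtain ⟨G, hG, hok⟩ := hR hf
      refine ⟨G, ?_, hok⟩
      rw [rd, if_neg (by omega), if_neg (by omega)]
      rw [show i + 1 - 1 = i - 1 + 1 by omega]; exact hG
    · intro hf
      by_cases hi : i = j + 2
      · subst hi
        have e : X = B := by
          rw [show j + 2 - 1 = j + 1 by omega] at hX
          exact Option.some.inj (hX.symm.trans hB)
        subst e
        refine ⟨j + 1, N, by omega, ?_, hBN hSc hf⟩
        rw [rd, if_neg (lt_irrefl _), if_pos rfl]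
      · obtain ⟨j', G, hj', hG, hok⟩ := hL hf
        refine ⟨j' + 1, G, by omega, ?_, hok⟩
        rw [rd, if_neg (by omega), if_neg (by omega), Nat.add_sub_cancel]; exact hG

/-- reading an inserted chain (for the pointwise / pair invariants) -/
theorem rd_insert {g : GChain} {j : ℕ} {B : GCurve} (hB : g[j + 1]? = some B) (N : GCurve) (i : ℕ) :
    (g.insertIdx (j + 1) N)[i]? = if i < j + 1 then g[i]? else if i = j + 1 then some N else g[i - 1]? := by
  have hlen : j + 1 ≤ g.length := by have := (List.getElem?_eq_some_iff.mp hB).1; omega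
  rw [List.getElem?_insertIdx]
  by_cases h1 : i < j + 1
  · rw [if_pos h1, if_pos h1]
  · rw [if_neg h1, if_neg h1]
    by_cases h2 : i = j + 1
    · subst h2; rw [if_pos rfl, if_pos rfl, if_pos hlen]
    · rw [if_neg h2, if_neg h2]

/-! ### legality: blow-ups happen in deep-free states; small weight facts -/

theorem noDeep_of_mem {topj : ℕ} {ch : Chain} {m : Move} (h : m ∈ legalMoves topj ch) (hD : ∀ k, m ≠ .D k)
    (j : ℕ) (hj : j < ch.length) : kindAt ch j ≠ .deep := by
  unfold legalMoves at h
  dsimp only at h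
  generalize hf : List.filter (fun k => kindAt ch k == Kind.deep) (List.range ch.length) = fl at h
  cases fl with
  | cons k' tl => simp only [List.mem_singleton] at h; exact absurd h (hD k')
  | nil =>
    intro hk
    have : j ∈ List.filter (fun k => kindAt ch k == Kind.deep) (List.range ch.length) :=
      List.mem_filter.mpr ⟨List.mem_range.mpr hj, by simp [hk]⟩
    rw [hf] at this; simp at this

theorem kindAt_eq {ch : Chain} {k : ℕ} {c : Curve} (h : ch[k]? = some c) : kindAt ch k = kindOf c := by
  unfold kindAt; rw [h]

theorem kindOf_of_deepW {c : Curve} (hb : c.bd = true) (hd : isDeepW c.w = true) : kindOf c = .deep := by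
  simp [kindOf, hb, hd]

/-- at a blow-up (an `I` or `P` move) every boundary branch is non-deep -/
theorem notDeep_at_blowup {topj : ℕ} {ch : Chain} {m : Move} (h : m ∈ legalMoves topj ch) (hD : ∀ k, m ≠ .D k)
    {j : ℕ} {c : Curve} (hc : ch[j]? = some c) (hb : c.bd = true) : isDeepW c.w = false := by
  have hj : j < ch.length := (List.getElem?_eq_some_iff.mp hc).1
  have hk := noDeep_of_mem h hD j hj
  rw [kindAt_eq hc] at hk
  cases hd : isDeepW c.w with
  | false => rfl
  | true => exact absurd (kindOf_of_deepW hb hd) hk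

theorem deepW_of_sub {w : W3} (h : isDeepW (w.sub 2 1 0) = true) : isDeepW w = true := by
  obtain ⟨w0, w1, w2⟩ := w
  simp only [isDeepW, W3.ge, W3.sub, Bool.and_eq_true] at h ⊢
  obtain ⟨⟨h0, h1⟩, h2⟩ := h
  refine ⟨⟨?_, ?_⟩, ?_⟩
  · cases w0 with | none => rfl | some a => simp [wge_some] at h0 ⊢; omega
  · cases w1 with | none => rfl | some a => simp [wge_some] at h1 ⊢; omega
  · cases w2 with | none => rfl | some a => simp [wge_some] at h2 ⊢; omega

theorem singW_w2_ne_zero {w : W3} (h : isSingW w = true) (h2 : w.w2 = some 0) : False := by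
  unfold isSingW W3.ge at h
  rw [h2] at h
  simp [wge_some] at h

theorem map_sub_zero_eq {x : Option ℕ} {z : ℕ} (h : x.map (· - 0) = some z) : x = some z := by
  cases x with
  | none => simp at h
  | some y => simp at h; rw [h]

theorem mem_ptsOf_cases {n k i : ℕ} (h : i ∈ ptsOf n k) : (i + 1 = k) ∨ (i = k ∧ k + 1 < n) := by
  unfold ptsOf at h
  simp only [List.mem_append] at h
  rcases h with h | h
  · by_cases h1 : 1 ≤ k
    · rw [if_pos h1] at h; simp at h; left; omega
    · rw [if_neg h1] at h; simp at h
  · by_cases h1 : k + 1 < n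
    · rw [if_pos h1] at h; simp at h; right; exact ⟨h, h1⟩
    · rw [if_neg h1] at h; simp at h

/-- from «some point of `k` is Sing₂» and «the left point is not»: the right point is -/
theorem sing2_right {s : Chain} {k : ℕ} (hany : (ptsOf s.length k).any (sing2At s) = true)
    (hleft : ∀ j, j + 1 = k → sing2At s j = false) : sing2At s k = true ∧ k + 1 < s.length := by
  obtain ⟨i, hi, hs⟩ := List.any_eq_true.mp hany
  rcases mem_ptsOf_cases hi with h | ⟨rfl, h⟩
  · rw [hleft i h] at hs; exact absurd hs Bool.false_ne_true
  · exact ⟨hs, h⟩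

theorem sing2_left {s : Chain} {k : ℕ} (hany : (ptsOf s.length k).any (sing2At s) = true)
    (hright : sing2At s k = false) : ∃ j, j + 1 = k ∧ sing2At s j = true := by
  obtain ⟨i, hi, hs⟩ := List.any_eq_true.mp hany
  rcases mem_ptsOf_cases hi with h | ⟨rfl, h⟩
  · exact ⟨i, h, hs⟩
  · rw [hright] at hs; exact absurd hs Bool.false_ne_true

/-! ### the invariants `NB`, `G0`, `B2` -/

/-- non-boundary branches are never touched: they keep `w₃ = 0` -/
def NB (g : GChain) : Prop := ∀ c ∈ proj g, c.bd = false → c.w3 = 0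

/-- a curve without birth record is an end of the chain -/
def G0 (g : GChain) : Prop := ∀ (i : ℕ) (X : GCurve), g[i]? = some X → X.par = none → i = 0 ∨ g[i + 1]? = none

/-- born next to a cubic-weighted branch ⇒ `w₀ = 0` -/
def B2 (g : GChain) : Prop :=
  ∀ (i : ℕ) (X : GCurve), g[i]? = some X → ∀ (a b : Curve), X.par = some (a, b) → (1 ≤ a.w3 ∨ 1 ≤ b.w3) → X.c.w.w0 = some 0

theorem NB_step (topj : ℕ) (g : GChain) (h : NB g) (m : Move) (hm : m ∈ legalMoves topj (proj g)) : NB (gApplyMove g m) := by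
  intro c hc hb
  rw [proj_gApplyMove] at hc
  cases m with
  | D k =>
    rcases mem_modify_cases hc with hc | ⟨c₀, hc₀, rfl⟩
    · exact h c hc hb
    · obtain ⟨K, hK, hκ⟩ := kindAt_some (D_mem_legalMoves topj _ k hm) (by decide)
      have e : c₀ = K := Option.some.inj (hc₀.symm.trans hK)
      subst e; have := (kindOf_deep hκ).1; simp only at hb; rw [this] at hb; exact absurd hb (by decide)
  | A k =>
    rcases mem_modify_cases hc with hc | ⟨c₀, hc₀, rfl⟩
    · exact h c hc hb
    · obtain ⟨K, hK, hκ⟩ := kindAt_some (A_mem_legalMoves topj _ k hm).1 (by decide)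
      have e : c₀ = K := Option.some.inj (hc₀.symm.trans hK)
      subst e; have := (kindOf_borderline hκ).1; simp only at hb; rw [this] at hb; exact absurd hb (by decide)
  | AL k =>
    rcases mem_modify_cases hc with hc | ⟨c₀, hc₀, rfl⟩
    · exact h c hc hb
    · obtain ⟨K, hK, hκ⟩ := kindAt_some (AL_mem_legalMoves topj _ k hm).1 (by decide)
      have e : c₀ = K := Option.some.inj (hc₀.symm.trans hK)
      subst e; have := (kindOf_light hκ).1; simp only at hb; rw [this] at hb; exact absurd hb (by decide)
  | I i =>
    show c.w3 = 0
    change c ∈ blowup (proj g) i 3 at hc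
    unfold blowup at hc
    cases hn : nodeAt (proj g) i with
    | none => rw [hn] at hc; exact h c hc hb
    | some ab =>
      obtain ⟨a, b⟩ := ab; rw [hn] at hc; simp only at hc
      rcases List.eq_or_mem_of_mem_insertIdx hc with rfl | hc
      · simp at hb
      · exact h c hc hb
  | P i =>
    show c.w3 = 0
    change c ∈ blowup (proj g) i (if topAt (proj g) i then 3 else 2) at hc
    unfold blowup at hc
    cases hn : nodeAt (proj g) i with
    | none => rw [hn] at hc; exact h c hc hb
    | some ab =>
      obtain ⟨a, b⟩ := ab; rw [hn] at hc; simp only at hc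
      rcases List.eq_or_mem_of_mem_insertIdx hc with rfl | hc
      · simp at hb
      · exact h c hc hb

theorem G0_modify {g : GChain} (hI : G0 g) (k : ℕ) (F : GCurve → GCurve) (hpar : ∀ x, (F x).par = x.par) : G0 (g.modify k F) := by
  intro i X hX hp
  rw [List.getElem?_modify] at hX
  cases hX0 : g[i]? with
  | none => simp [hX0] at hX
  | some X0 =>
    simp [hX0] at hX
    have hp0 : X0.par = none := by
      by_cases h : k = i
      · simp [h] at hX; rw [← hX, hpar] at hp; exact hp
      · simp [h] at hX; rw [← hX] at hp; exact hp
    rcases hI i X0 hX0 hp0 with h | h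
    · exact Or.inl h
    · right; rw [List.getElem?_modify, h]; rfl

theorem G0_insert {g : GChain} (hI : G0 g) {j : ℕ} {B : GCurve} (hB : g[j + 1]? = some B) (N : GCurve) (hN : N.par ≠ none) :
    G0 (g.insertIdx (j + 1) N) := by
  have rd := rd_insert hB N
  intro i X hX hp
  rw [rd] at hX
  rcases Nat.lt_trichotomy i (j + 1) with hlt | heq | hgt
  · rw [if_pos hlt] at hX
    rcases hI i X hX hp with h | h
    · exact Or.inl h
    · exfalso
      have := (List.getElem?_eq_some_iff.mp hB).1
      have := List.getElem?_eq_none_iff.mp h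
      omega
  · subst heq; rw [if_neg (lt_irrefl _), if_pos rfl] at hX; cases hX; exact absurd hp hN
  · rw [if_neg (by omega), if_neg (by omega)] at hX
    rcases hI (i - 1) X hX hp with h | h
    · omega
    · right; rw [rd, if_neg (by omega), if_neg (by omega)]
      rw [show i + 1 - 1 = i - 1 + 1 by omega]; exact h

theorem G0_gBlowup {g : GChain} (hI : G0 g) (i α : ℕ) : G0 (gBlowup g i α) := by
  unfold gBlowup
  cases hn : nodeAt (proj g) i with
  | none => exact hI
  | some ab =>
    obtain ⟨a, b⟩ := ab
    simp only []
    obtain ⟨_, hb⟩ := nodeAt_some hn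
    rw [proj_getElem?] at hb
    cases hB : g[i + 1]? with
    | none => rw [hB] at hb; simp at hb
    | some B => exact G0_insert hI hB _ (by simp)

theorem G0_step (topj : ℕ) (g : GChain) (hI : G0 g) (m : Move) : G0 (gApplyMove g m) := by
  cases m with
  | D k => exact G0_modify hI k gAccD (fun x => rfl)
  | A k => exact G0_modify hI k gAccA (fun x => rfl)
  | AL k => exact G0_modify hI k gAccA (fun x => rfl)
  | I i => exact G0_gBlowup hI i 3
  | P i => exact G0_gBlowup hI i _

theorem B2_modify {g : GChain} (hI : B2 g) (k : ℕ) (F : GCurve → GCurve) (hpar : ∀ x, (F x).par = x.par)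
    (h0 : ∀ x, x.c.w.w0 = some 0 → (F x).c.w.w0 = some 0) : B2 (g.modify k F) := by
  intro i X hX a b hp hab
  rw [List.getElem?_modify] at hX
  cases hX0 : g[i]? with
  | none => simp [hX0] at hX
  | some X0 =>
    simp [hX0] at hX
    by_cases h : k = i
    · simp [h] at hX; rw [← hX] at hp ⊢; rw [hpar] at hp; exact h0 X0 (hI i X0 hX0 a b hp hab)
    · simp [h] at hX; rw [← hX] at hp ⊢; exact hI i X0 hX0 a b hp hab

theorem B2_insert {g : GChain} (hI : B2 g) {j : ℕ} {B : GCurve} (hB : g[j + 1]? = some B) (N : GCurve)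
    (hN : ∀ a b, N.par = some (a, b) → (1 ≤ a.w3 ∨ 1 ≤ b.w3) → N.c.w.w0 = some 0) : B2 (g.insertIdx (j + 1) N) := by
  have rd := rd_insert hB N
  intro i X hX a b hp hab
  rw [rd] at hX
  rcases Nat.lt_trichotomy i (j + 1) with hlt | heq | hgt
  · rw [if_pos hlt] at hX; exact hI i X hX a b hp hab
  · subst heq; rw [if_neg (lt_irrefl _), if_pos rfl] at hX; cases hX; exact hN a b hp hab
  · rw [if_neg (by omega), if_neg (by omega)] at hX; exact hI (i - 1) X hX a b hp hab

theorem w0_acc_zero (c : Curve) (d0 d1 d2 : ℕ) (h : c.w.w0 = some 0) : (c.w.sub d0 d1 d2).w0 = some 0 := by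
  simp [W3.sub, h]

/-- blow-up with legality data: exponent 3 at a top point, exponent 2 at a non-top Sing₂ point -/
def BlowData (g : GChain) (i α : ℕ) : Prop :=
  (α = 3 ∧ topAt (proj g) i = true) ∨ (α = 2 ∧ sing2At (proj g) i = true ∧ topAt (proj g) i = false)

theorem blowData_P {g : GChain} {i : ℕ} (hs : sing2At (proj g) i = true) :
    BlowData g i (if topAt (proj g) i then 3 else 2) := by
  cases ht : topAt (proj g) i with
  | true => exact Or.inl ⟨by simp, ht⟩
  | false => exact Or.inr ⟨by simp, hs, ht⟩

theorem B2_gBlowup {g : GChain} (hI3 : Inv3 (proj g)) (hI : B2 g) {i α : ℕ} (hd : BlowData g i α) : B2 (gBlowup g i α) := by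
  unfold gBlowup
  cases hn : nodeAt (proj g) i with
  | none => exact hI
  | some ab =>
    obtain ⟨a, b⟩ := ab
    simp only []
    obtain ⟨_, hb⟩ := nodeAt_some hn
    rw [proj_getElem?] at hb
    cases hB : g[i + 1]? with
    | none => rw [hB] at hb; simp at hb
    | some B =>
      refine B2_insert hI hB _ ?_
      intro a' b' hp hab
      simp only [Option.some.injEq, Prod.mk.injEq] at hp
      obtain ⟨rfl, rfl⟩ := hp
      rcases hd with ⟨rfl, ht⟩ | ⟨rfl, hs, ht⟩
      · exfalso
        unfold topAt at ht; rw [hn] at ht; simp only at ht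
        obtain ⟨ha3, hb3⟩ := top_noCubic hI3 hn ht
        omega
      · unfold sing2At at hs; unfold topAt at ht; rw [hn] at hs ht; simp only at hs ht
        obtain ⟨x, y, hx, hy, hxy⟩ := o0_of_sing2_not_top a b hs ht
        show ((a.w.add b.w).w0.map (· - 2)) = some 0
        simp [W3.add, hx, hy, wadd_some]; omega

theorem B2_step (topj : ℕ) (g : GChain) (hI3 : Inv3 (proj g)) (hI : B2 g) (m : Move) (hm : m ∈ legalMoves topj (proj g)) :
    B2 (gApplyMove g m) := by
  cases m with
  | D k => exact B2_modify hI k gAccD (fun x => rfl) (fun x h => w0_acc_zero x.c 3 2 1 h)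
  | A k => exact B2_modify hI k gAccA (fun x => rfl) (fun x h => w0_acc_zero x.c 2 1 0 h)
  | AL k => exact B2_modify hI k gAccA (fun x => rfl) (fun x h => w0_acc_zero x.c 2 1 0 h)
  | I i => exact B2_gBlowup hI3 hI (Or.inl ⟨rfl, I_mem_legalMoves topj _ i hm⟩)
  | P i => exact B2_gBlowup hI3 hI (blowData_P (P_mem_legalMoves topj _ i hm).1)

/-! ### the invariant `I8` (accepted light lines were accepted through the near point) -/

def CubLS (X : GCurve) : Prop := X.c.bd = true ∧ 1 ≤ X.c.w3 ∧ X.c.w.w0 = some 0 ∧ X.c.w.w2 = some 0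
def W0z (G : Curve) : Prop := G.w.w0 = some 0

def I8 (g : GChain) : Prop := NbrInv CubLS farL farR W0z W0z g

theorem I8_lift (ch : Chain) : I8 (lift ch) := by
  intro i X hX _
  have hp : X.par = none := by
    unfold lift at hX
    rw [List.getElem?_map] at hX
    cases h : ch[i]? with
    | none => rw [h] at hX; simp at hX
    | some c => rw [h] at hX; simp at hX; rw [← hX]
  constructor
  · rintro ⟨a, b, hab, _⟩; rw [hp] at hab; exact absurd hab (by simp)
  · rintro ⟨a, b, hab, _⟩; rw [hp] at hab; exact absurd hab (by simp)

theorem I8_D {g : GChain} (hI3 : Inv3 (proj g)) (hI8 : I8 g) {k : ℕ} (hk : kindAt (proj g) k = .deep) : I8 (g.modify k gAccD) := by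
  obtain ⟨K, hK, hκ⟩ := kindAt_some hk (by decide)
  obtain ⟨_, hKdeep⟩ := kindOf_deep hκ
  have hKm : K ∈ proj g := List.mem_of_getElem? hK
  rw [proj_getElem?] at hK
  refine NbrInv_modify hI8 k gAccD (fun x => Iff.rfl) (fun x => Iff.rfl) ?_ ?_ ?_
  · intro x hx ⟨_, h3, _, _⟩
    exfalso
    rw [hx] at hK; simp at hK
    have h3' : 1 ≤ K.w3 := by rw [← hK]; exact h3
    have h0 := hI3.1 K hKm h3'
    unfold isDeepW W3.ge at hKdeep; rw [h0] at hKdeep; simp [wge_some] at hKdeep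
  · intro x _ h0; exact w0_acc_zero x.c 3 2 1 h0
  · intro x _ h0; exact w0_acc_zero x.c 3 2 1 h0

theorem I8_A {topj : ℕ} {g : GChain} (hF : F2facts topj (proj g)) (hA : AccFacts topj (proj g)) (hI3 : Inv3 (proj g))
    (hI5 : I5 g) (hI8 : I8 g) {k : ℕ} (hm : Move.A k ∈ legalMoves topj (proj g) ∨ Move.AL k ∈ legalMoves topj (proj g)) :
    I8 (g.modify k gAccA) := by
  obtain ⟨⟨K, hK, hK2⟩, _⟩ := hF k hm
  have hKg := hK
  rw [proj_getElem?] at hKg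
  refine NbrInv_modify hI8 k gAccA (fun x => Iff.rfl) (fun x => Iff.rfl) ?_ ?_ ?_
  · intro x hx ⟨hbd, _, h0, h2⟩
    right
    rw [hx] at hKg; simp at hKg
    -- hKg : x.c = K
    have hw2 : x.c.w.w2 = some 0 := map_sub_zero_eq h2
    -- the move is `AL` (a borderline centre has w₂ ≥ 1)
    have hmAL : Move.AL k ∈ legalMoves topj (proj g) := by
      rcases hm with hm | hm
      · exfalso
        obtain ⟨K', hK', hκ⟩ := kindAt_some (A_mem_legalMoves topj _ k hm).1 (by decide)
        have e : K' = x.c := Option.some.inj (hK'.symm.trans (by rw [hK, hKg]))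
        rw [e] at hκ
        exact singW_w2_ne_zero (kindOf_borderline hκ).2.1 hw2
      · exact hm
    have hfar := farside hI5 hF hA hI3 hmAL x hx hw2
    have hany := (AL_mem_legalMoves topj _ k hmAL).2.1
    have hx2 : x.c.w.w0 = some 2 := by rw [hKg]; exact hK2
    constructor
    · intro hf
      obtain ⟨hs, hlen⟩ := sing2_right hany (hfar.2 hf)
      rw [proj_length] at hlen
      cases hG : g[k + 1]? with
      | none => exfalso; have := List.getElem?_eq_none_iff.mp hG; omega
      | some G =>
        refine ⟨G, rfl, ?_⟩
        have hn : nodeAt (proj g) k = some (x.c, G.c) := by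
          unfold nodeAt; rw [proj_getElem?, proj_getElem?, hx, hG]; rfl
        have ht := hA k (Or.inr hmAL) k (mem_ptsOf_right (by rw [proj_length]; exact hlen))
        unfold topAt at ht; unfold sing2At at hs; rw [hn] at ht hs; simp only at ht hs
        obtain ⟨x0, y, hx0, hy, hxy⟩ := o0_of_sing2_not_top x.c G.c hs ht
        rw [hx2] at hx0; cases hx0
        show G.c.w.w0 = some 0
        rw [hy]; congr 1; omega
    · intro hf
      obtain ⟨j, hj, hs⟩ := sing2_left hany (hfar.1 hf)
      cases hG : g[j]? with
      | none =>
        exfalso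
        have := List.getElem?_eq_none_iff.mp hG
        have := (List.getElem?_eq_some_iff.mp hx).1
        omega
      | some G =>
        refine ⟨j, G, hj, hG, ?_⟩
        have hn : nodeAt (proj g) j = some (G.c, x.c) := by
          unfold nodeAt; rw [proj_getElem?, proj_getElem?, hG, hj, hx]; rfl
        have ht := hA k (Or.inr hmAL) j (mem_ptsOf_left hj)
        unfold topAt at ht; unfold sing2At at hs; rw [hn] at ht hs; simp only at ht hs
        obtain ⟨y, x0, hy, hx0, hxy⟩ := o0_of_sing2_not_top G.c x.c hs ht
        rw [hx2] at hx0; cases hx0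
        show G.c.w.w0 = some 0
        rw [hy]; congr 1; omega
  · intro x _ h0; exact w0_acc_zero x.c 2 1 0 h0
  · intro x _ h0; exact w0_acc_zero x.c 2 1 0 h0

theorem I8_gBlowup {g : GChain} (hI3 : Inv3 (proj g)) (hI8 : I8 g) {i α : ℕ} (hd : BlowData g i α) : I8 (gBlowup g i α) := by
  unfold gBlowup
  cases hn : nodeAt (proj g) i with
  | none => exact hI8
  | some ab =>
    obtain ⟨a, b⟩ := ab
    simp only []
    obtain ⟨ha, hb⟩ := nodeAt_some hn
    rw [proj_getElem?] at ha hb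
    cases hA : g[i]? with
    | none => rw [hA] at ha; simp at ha
    | some A =>
      cases hB : g[i + 1]? with
      | none => rw [hB] at hb; simp at hb
      | some B =>
        rw [hA] at ha; rw [hB] at hb; simp at ha hb
        -- a newborn is never in `CubLS`
        have hN : ¬ CubLS ⟨newborn a b α, some (a, b)⟩ := by
          rintro ⟨_, h3, _, h2⟩
          rcases hd with ⟨rfl, ht⟩ | ⟨rfl, hs, ht⟩
          · unfold topAt at ht; rw [hn] at ht; simp only at ht
            obtain ⟨ha3, hb3⟩ := top_noCubic hI3 hn ht
            simp only [newborn] at h3; omega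
          · unfold sing2At at hs; rw [hn] at hs; simp only at hs
            have h2o := o2_of_sing2 hs
            simp only [newborn, W3.add] at h2
            have : wadd a.w.w2 b.w.w2 = some 0 := by
              cases hw : wadd a.w.w2 b.w.w2 with
              | none => rw [hw] at h2; simp at h2
              | some z => rw [hw] at h2; simp at h2; rw [h2]
            rw [this, wge_some] at h2o; simp at h2o
        refine NbrInv_insert hI8 hA hB ⟨newborn a b α, some (a, b)⟩ ?_ ?_ (fun h _ => (hN h).elim) (fun h _ => (hN h).elim)
        · intro hSc hf
          obtain ⟨G, hG, hok⟩ := (hI8 i A hA hSc).1 hf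
          rw [hB] at hG; cases hG
          show ((a.w.add b.w).w0.map (· - α)) = some 0
          rw [← ha, ← hb]; unfold W0z at hok; simp [W3.add, hSc.2.2.1, hok, wadd_some]
        · intro hSc hf
          obtain ⟨j, G, hj, hG, hok⟩ := (hI8 (i + 1) B hB hSc).2 hf
          have : j = i := by omega
          subst this
          rw [hA] at hG; cases hG
          show ((a.w.add b.w).w0.map (· - α)) = some 0
          rw [← ha, ← hb]; unfold W0z at hok; simp [W3.add, hSc.2.2.1, hok, wadd_some]

theorem I8_step (topj : ℕ) (g : GChain) (hF : F2facts topj (proj g)) (hA : AccFacts topj (proj g)) (hI3 : Inv3 (proj g))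
    (hI5 : I5 g) (hI8 : I8 g) (m : Move) (hm : m ∈ legalMoves topj (proj g)) : I8 (gApplyMove g m) := by
  cases m with
  | D k => exact I8_D hI3 hI8 (D_mem_legalMoves topj _ k hm)
  | A k => exact I8_A hF hA hI3 hI5 hI8 (Or.inl hm)
  | AL k => exact I8_A hF hA hI3 hI5 hI8 (Or.inr hm)
  | I i => exact I8_gBlowup hI3 hI8 (Or.inl ⟨rfl, I_mem_legalMoves topj _ i hm⟩)
  | P i => exact I8_gBlowup hI3 hI8 (blowData_P (P_mem_legalMoves topj _ i hm).1)


/-! ### the genesis invariant `G1` -/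

/-- «`C` is the recorded branch `c0`, changed since at most by one `A/AL` accept (and never deep if boundary)» -/
def Rel (C c0 : Curve) : Prop :=
  C.bd = c0.bd ∧ (C.bd = true → isDeepW C.w = false) ∧
  ((C.w = c0.w ∧ C.w3 = c0.w3) ∨ (C.w = c0.w.sub 2 1 0 ∧ C.w3 = c0.w3 + 1 ∧ c0.w.w0 = some 2))

/-- GENESIS: two adjacent curves are both initial, or one was born at a point of the other -/
def G1 (g : GChain) : Prop := ∀ (i : ℕ) (A B : GCurve), g[i]? = some A → g[i + 1]? = some B →
  (A.par = none ∧ B.par = none) ∨ (∃ a b, B.par = some (a, b) ∧ Rel A.c a) ∨ (∃ a b, A.par = some (a, b) ∧ Rel B.c b)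

theorem lift_par {ch : Chain} {i : ℕ} {X : GCurve} (hX : (lift ch)[i]? = some X) : X.par = none := by
  unfold lift at hX
  rw [List.getElem?_map] at hX
  cases h : ch[i]? with
  | none => rw [h] at hX; simp at hX
  | some c => rw [h] at hX; simp at hX; rw [← hX]

theorem G1_lift (ch : Chain) : G1 (lift ch) := by
  intro i A B hA hB
  exact Or.inl ⟨lift_par hA, lift_par hB⟩

theorem G1_modify {g : GChain} (hI : G1 g) (k : ℕ) (F : GCurve → GCurve) (hpar : ∀ x, (F x).par = x.par)
    (hRel : ∀ x, g[k]? = some x → ∀ c0, Rel x.c c0 → Rel (F x).c c0) : G1 (g.modify k F) := by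
  intro i A B hA hB
  rw [List.getElem?_modify] at hA hB
  cases hA0 : g[i]? with
  | none => simp [hA0] at hA
  | some A0 =>
    cases hB0 : g[i + 1]? with
    | none => simp [hB0] at hB
    | some B0 =>
      simp [hA0] at hA; simp [hB0] at hB
      have hpA : A.par = A0.par := by
        by_cases h : k = i
        · simp [h] at hA; rw [← hA, hpar]
        · simp [h] at hA; rw [← hA]
      have hpB : B.par = B0.par := by
        by_cases h : k = i + 1
        · simp [h] at hB; rw [← hB, hpar]
        · simp [h] at hB; rw [← hB]
      have hRA : ∀ c0, Rel A0.c c0 → Rel A.c c0 := by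
        intro c0 hr
        by_cases h : k = i
        · simp [h] at hA; rw [← hA]; exact hRel A0 (by rw [h]; exact hA0) c0 hr
        · simp [h] at hA; rw [← hA]; exact hr
      have hRB : ∀ c0, Rel B0.c c0 → Rel B.c c0 := by
        intro c0 hr
        by_cases h : k = i + 1
        · simp [h] at hB; rw [← hB]; exact hRel B0 (by rw [h]; exact hB0) c0 hr
        · simp [h] at hB; rw [← hB]; exact hr
      rcases hI i A0 B0 hA0 hB0 with ⟨h1, h2⟩ | ⟨a, b, hp, hr⟩ | ⟨a, b, hp, hr⟩
      · exact Or.inl ⟨by rw [hpA]; exact h1, by rw [hpB]; exact h2⟩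
      · exact Or.inr (Or.inl ⟨a, b, by rw [hpB]; exact hp, hRA a hr⟩)
      · exact Or.inr (Or.inr ⟨a, b, by rw [hpA]; exact hp, hRB b hr⟩)

theorem G1_insert {g : GChain} (hI : G1 g) {j : ℕ} {A0 B0 : GCurve} (hA0 : g[j]? = some A0) (hB0 : g[j + 1]? = some B0)
    (N : GCurve) (hNpar : N.par = some (A0.c, B0.c)) (hRA : Rel A0.c A0.c) (hRB : Rel B0.c B0.c) :
    G1 (g.insertIdx (j + 1) N) := by
  have rd := rd_insert hB0 N
  intro i A B hA hB
  rw [rd] at hA hB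
  rcases Nat.lt_trichotomy (i + 1) (j + 1) with hlt | heq | hgt
  · rw [if_pos (by omega)] at hA; rw [if_pos hlt] at hB
    exact hI i A B hA hB
  · have hij : i = j := by omega
    subst hij
    rw [if_pos (by omega)] at hA; rw [if_neg (lt_irrefl _), if_pos rfl] at hB
    have eA : A = A0 := Option.some.inj (hA.symm.trans hA0)
    have eB : B = N := (Option.some.inj hB).symm
    subst eA eB
    exact Or.inr (Or.inl ⟨A.c, B0.c, hNpar, hRA⟩)
  · by_cases hi : i = j + 1
    · subst hi
      rw [if_neg (lt_irrefl _), if_pos rfl] at hA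
      rw [if_neg (by omega), if_neg (by omega), show j + 1 + 1 - 1 = j + 1 by omega] at hB
      have eA : A = N := (Option.some.inj hA).symm
      have eB : B = B0 := Option.some.inj (hB.symm.trans hB0)
      subst eA eB
      exact Or.inr (Or.inr ⟨A0.c, B.c, hNpar, hRB⟩)
    · rw [if_neg (by omega), if_neg hi] at hA
      rw [if_neg (by omega), if_neg (by omega)] at hB
      exact hI (i - 1) A B hA (by rw [show i - 1 + 1 = i + 1 - 1 by omega]; exact hB)

theorem Rel_refl_of_notDeep {c : Curve} (h : c.bd = true → isDeepW c.w = false) : Rel c c :=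
  ⟨rfl, h, Or.inl ⟨rfl, rfl⟩⟩

theorem G1_gBlowup {topj : ℕ} {g : GChain} (hI : G1 g) {m : Move} (hm : m ∈ legalMoves topj (proj g)) (hD : ∀ k, m ≠ .D k)
    (i α : ℕ) : G1 (gBlowup g i α) := by
  unfold gBlowup
  cases hn : nodeAt (proj g) i with
  | none => exact hI
  | some ab =>
    obtain ⟨a, b⟩ := ab
    simp only []
    obtain ⟨ha, hb⟩ := nodeAt_some hn
    have ha' := ha; have hb' := hb
    rw [proj_getElem?] at ha hb
    cases hA : g[i]? with
    | none => rw [hA] at ha; simp at ha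
    | some A =>
      cases hB : g[i + 1]? with
      | none => rw [hB] at hb; simp at hb
      | some B =>
        rw [hA] at ha; rw [hB] at hb; simp at ha hb
        subst ha hb
        exact G1_insert hI hA hB _ rfl (Rel_refl_of_notDeep (notDeep_at_blowup hm hD ha'))
          (Rel_refl_of_notDeep (notDeep_at_blowup hm hD hb'))

theorem G1_D {g : GChain} (hI : G1 g) {k : ℕ} (hk : kindAt (proj g) k = .deep) : G1 (g.modify k gAccD) := by
  obtain ⟨K, hK, hκ⟩ := kindAt_some hk (by decide)
  obtain ⟨hKbd, hKdeep⟩ := kindOf_deep hκ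
  rw [proj_getElem?] at hK
  refine G1_modify hI k gAccD (fun x => rfl) ?_
  intro x hx c0 ⟨_, hnd, _⟩
  exfalso
  rw [hx] at hK; simp at hK
  rw [← hK] at hKbd hKdeep
  rw [hnd hKbd] at hKdeep; exact Bool.false_ne_true hKdeep

theorem G1_A {topj : ℕ} {g : GChain} (hF : F2facts topj (proj g)) (hI3 : Inv3 (proj g)) (hI : G1 g) {k : ℕ}
    (hm : Move.A k ∈ legalMoves topj (proj g) ∨ Move.AL k ∈ legalMoves topj (proj g)) : G1 (g.modify k gAccA) := by
  obtain ⟨⟨K, hK, hK2⟩, _⟩ := hF k hm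
  have hK3 : K.w3 = 0 := by
    rcases hm with hm | hm
    · obtain ⟨K', hK', h3⟩ := centre_monic hF hI3 hm k (Or.inr (Or.inl rfl))
      have e : K' = K := Option.some.inj (hK'.symm.trans hK); rw [e] at h3; exact h3
    · obtain ⟨K', hK', h3⟩ := centre_monic hF hI3 hm k (Or.inr (Or.inr rfl))
      have e : K' = K := Option.some.inj (hK'.symm.trans hK); rw [e] at h3; exact h3
  rw [proj_getElem?] at hK
  refine G1_modify hI k gAccA (fun x => rfl) ?_
  intro x hx c0 ⟨hbd, hnd, hbr⟩
  rw [hx] at hK; simp at hK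
  -- hK : x.c = K
  refine ⟨hbd, ?_, ?_⟩
  · intro hb
    show isDeepW (x.c.w.sub 2 1 0) = false
    cases hd : isDeepW (x.c.w.sub 2 1 0) with
    | false => rfl
    | true => have := deepW_of_sub hd; rw [hnd hb] at this; exact absurd this Bool.false_ne_true
  · rcases hbr with ⟨hw, h3⟩ | ⟨_, h3, _⟩
    · right
      refine ⟨?_, ?_, ?_⟩
      · show x.c.w.sub 2 1 0 = c0.w.sub 2 1 0
        rw [hw]
      · show x.c.w3 + 1 = c0.w3 + 1
        rw [h3]
      · rw [← hw, hK]; exact hK2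
    · exfalso; rw [hK] at h3; omega

theorem G1_step (topj : ℕ) (g : GChain) (hF : F2facts topj (proj g)) (hI3 : Inv3 (proj g)) (hI : G1 g) (m : Move)
    (hm : m ∈ legalMoves topj (proj g)) : G1 (gApplyMove g m) := by
  cases m with
  | D k => exact G1_D hI (D_mem_legalMoves topj _ k hm)
  | A k => exact G1_A hF hI3 hI (Or.inl hm)
  | AL k => exact G1_A hF hI3 hI (Or.inr hm)
  | I i => exact G1_gBlowup hI hm (fun k h => Move.noConfusion h) i 3
  | P i => exact G1_gBlowup hI hm (fun k h => Move.noConfusion h) i _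

/-! ### all invariants along legal plays -/

def AllG (g : GChain) : Prop :=
  Inv3 (proj g) ∧ Inv4 (proj g) ∧ Inv6 (proj g) ∧ I5 g ∧ I8 g ∧ NB g ∧ G0 g ∧ B2 g ∧ G1 g

theorem AllG_lift (ch : Chain) (hlen : ch.length ≤ 2) (h0 : ∀ c ∈ ch, c.w3 = 0) : AllG (lift ch) := by
  refine ⟨?_, ?_, ?_, I5_lift ch, I8_lift ch, ?_, ?_, ?_, G1_lift ch⟩
  · rw [proj_lift]; exact Inv3_of_noCubic ch h0
  · rw [proj_lift]; exact Inv4_of_noCubic ch h0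
  · rw [proj_lift]; exact Inv6_of_noCubic ch h0
  · intro c hc _; rw [proj_lift] at hc; exact h0 c hc
  · intro i X hX _
    by_cases hi : i = 0
    · exact Or.inl hi
    · right
      have h1 := (List.getElem?_eq_some_iff.mp hX).1
      simp only [lift, List.length_map] at h1
      apply List.getElem?_eq_none_iff.mpr
      simp only [lift, List.length_map]; omega
  · intro i X hX a b hp _; rw [lift_par hX] at hp; exact absurd hp (by simp)

theorem AllG_step (topj : ℕ) (g : GChain) (hF : F2facts topj (proj g)) (hA : AccFacts topj (proj g)) (h : AllG g) (m : Move)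
    (hm : m ∈ legalMoves topj (proj g)) : AllG (gApplyMove g m) := by
  obtain ⟨h3, h4, h6, h5, h8, hnb, h0, hb2, h1⟩ := h
  refine ⟨?_, ?_, ?_, I5_step topj g hF h5 m hm, I8_step topj g hF hA h3 h5 h8 m hm, NB_step topj g hnb m hm, G0_step topj g h0 m,
    B2_step topj g h3 hb2 m hm, G1_step topj g hF h3 h1 m hm⟩
  · rw [proj_gApplyMove]; exact Inv3_step topj _ hF h3 m hm
  · rw [proj_gApplyMove]; exact Inv4_step topj _ hF hA h3 h4 m hm
  · rw [proj_gApplyMove]; exact Inv6_step topj _ hF hA h3 h4 h6 m hm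

theorem AllG_play {topj : ℕ} (htop : 2 ≤ topj) : ∀ (l : List Move) (g : GChain), AllG g → isLegalPlay topj (proj g) l = true →
    AllG (gApplyMoves g l) := by
  intro l
  induction l with
  | nil => intro g h _; exact h
  | cons m l ih =>
    intro g h hl
    obtain ⟨hm, hl'⟩ := isLegalPlay_cons hl
    rw [← proj_gApplyMove] at hl'
    exact ih (gApplyMove g m) (AllG_step topj g (F2facts_of_topj htop _) (AccFacts_of_topj htop _) h m hm) hl'

theorem AllG_play_bd (topj : ℕ) : ∀ (l : List Move) (g : GChain), (∀ c ∈ proj g, c.bd = true) → AllG g →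
    isLegalPlay topj (proj g) l = true → AllG (gApplyMoves g l) := by
  intro l
  induction l with
  | nil => intro g _ h _; exact h
  | cons m l ih =>
    intro g hbd h hl
    obtain ⟨hm, hl'⟩ := isLegalPlay_cons hl
    rw [← proj_gApplyMove] at hl'
    have hbd' : ∀ c ∈ proj (gApplyMove g m), c.bd = true := by rw [proj_gApplyMove]; exact bd_applyMove hbd m
    exact ih (gApplyMove g m) hbd' (AllG_step topj g (F2facts_of_bd topj _ hbd) (AccFacts_of_bd topj _ hbd) h m hm) hl'

/-! ### PROPOSITION 9.15 (5): the residual configuration does not occur -/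

theorem w2_of_sub {a c0 : Curve} (hw : a.w = c0.w.sub 2 1 0) (h2 : a.w.w2 = some 0) : c0.w.w2 = some 0 := by
  rw [hw] at h2; simp only [W3.sub] at h2; exact map_sub_zero_eq h2

/-- under all invariants: at an `AL` accept BOTH branches of EVERY point of the centre have `w₃ = 0` -/
theorem prop5_state {topj : ℕ} {g : GChain} (h : AllG g) (hF : F2facts topj (proj g)) (hA : AccFacts topj (proj g)) {k : ℕ}
    (hm : Move.AL k ∈ legalMoves topj (proj g)) (i : ℕ) (hi : i ∈ ptsOf (proj g).length k) (a b : Curve)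
    (hn : nodeAt (proj g) i = some (a, b)) : a.w3 = 0 ∧ b.w3 = 0 := by
  obtain ⟨h3, h4, h6, h5, h8, hnb, hg0, hb2, hg1⟩ := h
  rcases Bool.eq_false_or_eq_true (sing2At (proj g) i) with hs | hs
  · exact (neighbours_monic hF h3 h4 hm k).2 rfl i hi hs a b hn
  obtain ⟨K, hK, hK2, hleft, hright⟩ := residual_shape hF h3 h6 hm i hi a b hn
  have hK3 : K.w3 = 0 := by
    obtain ⟨K', hK', hh⟩ := centre_monic hF h3 hm k (Or.inr (Or.inr rfl))
    have e : K' = K := Option.some.inj (hK'.symm.trans hK)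
    rw [e] at hh; exact hh
  obtain ⟨X, hX, hKg⟩ : ∃ X : GCurve, g[k]? = some X ∧ X.c = K := by
    have hKg := hK
    rw [proj_getElem?] at hKg
    cases hX : g[k]? with
    | none => rw [hX] at hKg; simp at hKg
    | some X => rw [hX] at hKg; simp at hKg; exact ⟨X, rfl, hKg⟩
  have hany := (AL_mem_legalMoves topj _ k hm).2.1
  obtain ⟨hna, hnb'⟩ := nodeAt_some hn
  have hfar := farside h5 hF hA h3 hm X hX
  rcases mem_ptsOf_cases hi with hik | ⟨hik', hkn⟩
  · -- the point LEFT of the centre: `b = K`, `a = N`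
    have eb : b = K := Option.some.inj (hnb'.symm.trans (by rw [hik]; exact hK))
    subst eb
    refine ⟨?_, hK3⟩
    rcases Nat.eq_zero_or_pos a.w3 with ha3 | ha1
    · exact ha3
    exfalso
    rcases Bool.eq_false_or_eq_true a.bd with habd | habd
    swap
    · have := hnb a (List.mem_of_getElem? hna) habd; omega
    obtain ⟨hK2', ha2, ha0⟩ := hleft rfl ha1 habd
    -- the RIGHT point of the centre is the Sing₂ one
    obtain ⟨hsk, hlen⟩ := sing2_right hany (fun j hj => by rw [show j = i by omega]; exact hs)
    rw [proj_length] at hlen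
    -- the curve `Y` at `i`, `Y.c = a`
    obtain ⟨Y, hY, hYg⟩ : ∃ Y : GCurve, g[i]? = some Y ∧ Y.c = a := by
      have hYg := hna
      rw [proj_getElem?] at hYg
      cases hY : g[i]? with
      | none => rw [hY] at hYg; simp at hYg
      | some Y => rw [hY] at hYg; simp at hYg; exact ⟨Y, rfl, hYg⟩
    have hXk : g[i + 1]? = some X := by rw [hik]; exact hX
    rcases hg1 i Y X hY hXk with ⟨_, hXp⟩ | ⟨a', b', hXp, hRel⟩ | ⟨a', b', hYp, hRel⟩
    · rcases hg0 k X hX hXp with h0 | h0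
      · omega
      · have := List.getElem?_eq_none_iff.mp h0; omega
    · obtain ⟨_, _, hbr⟩ := hRel
      rcases hbr with ⟨hw, hw3⟩ | ⟨hw, hw3, h2'⟩
      · have := hb2 k X hX a' b' hXp (Or.inl (by rw [← hw3, hYg]; exact ha1))
        rw [hKg, hK2] at this; cases this
      · have hw' : a.w = a'.w.sub 2 1 0 := by rw [← hYg]; exact hw
        have hls : LSw a'.w := ⟨h2', w2_of_sub hw' ha2⟩
        have := (hfar (by rw [hKg]; exact hK2')).1 ⟨a', b', hXp, hls⟩
        rw [this] at hsk; exact Bool.false_ne_true hsk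
    · obtain ⟨_, _, hbr⟩ := hRel
      rcases hbr with ⟨hw, hw3⟩ | ⟨hw, hw3, h2'⟩
      · have hls : LSw b'.w := ⟨by rw [← hw, hKg]; exact hK2, by rw [← hw, hKg]; exact hK2'⟩
        have hcub : CubLS Y := ⟨by rw [hYg]; exact habd, by rw [hYg]; exact ha1, by rw [hYg]; exact ha0, by rw [hYg]; exact ha2⟩
        obtain ⟨G, hG, hok⟩ := (h8 i Y hY hcub).1 ⟨a', b', hYp, hls⟩
        have e : G = X := (Option.some.inj (hG.symm.trans hXk))
        rw [e] at hok
        unfold W0z at hok; rw [hKg, hK2] at hok; cases hok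
      · rw [hKg, hK3] at hw3; omega
  · -- the point RIGHT of the centre (`i = k`): `a = K`, `b = N`
    have hnak : (proj g)[k]? = some a := by rw [← hik']; exact hna
    have hnbk : (proj g)[k + 1]? = some b := by rw [← hik']; exact hnb'
    have hsk : sing2At (proj g) k = false := by rw [← hik']; exact hs
    have ea : a = K := Option.some.inj (hnak.symm.trans hK)
    subst ea
    refine ⟨hK3, ?_⟩
    rcases Nat.eq_zero_or_pos b.w3 with hb3 | hb1
    · exact hb3
    exfalso
    rcases Bool.eq_false_or_eq_true b.bd with hbbd | hbbd
    swap
    · have := hnb b (List.mem_of_getElem? hnbk) hbbd; omega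
    obtain ⟨hK2', hb2', hb0⟩ := hright rfl hb1 hbbd
    -- the LEFT point of the centre is the Sing₂ one
    obtain ⟨j, hj, hsj⟩ := sing2_left hany hsk
    obtain ⟨Y, hY, hYg⟩ : ∃ Y : GCurve, g[k + 1]? = some Y ∧ Y.c = b := by
      have hYg := hnbk
      rw [proj_getElem?] at hYg
      cases hY : g[k + 1]? with
      | none => rw [hY] at hYg; simp at hYg
      | some Y => rw [hY] at hYg; simp at hYg; exact ⟨Y, rfl, hYg⟩
    rcases hg1 k X Y hX hY with ⟨hXp, _⟩ | ⟨a'', b'', hYp, hRel⟩ | ⟨a'', b'', hXp, hRel⟩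
    · rcases hg0 k X hX hXp with h0 | h0
      · omega
      · rw [hY] at h0; cases h0
    · obtain ⟨_, _, hbr⟩ := hRel
      rcases hbr with ⟨hw, hw3⟩ | ⟨hw, hw3, h2'⟩
      · have hls : LSw a''.w := ⟨by rw [← hw, hKg]; exact hK2, by rw [← hw, hKg]; exact hK2'⟩
        have hcub : CubLS Y := ⟨by rw [hYg]; exact hbbd, by rw [hYg]; exact hb1, by rw [hYg]; exact hb0, by rw [hYg]; exact hb2'⟩
        obtain ⟨j', G, hj', hG, hok⟩ := (h8 (k + 1) Y hY hcub).2 ⟨a'', b'', hYp, hls⟩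
        have e : G = X := by
          have e' : j' = k := by omega
          rw [e'] at hG; exact Option.some.inj (hG.symm.trans hX)
        rw [e] at hok
        unfold W0z at hok; rw [hKg, hK2] at hok; cases hok
      · rw [hKg, hK3] at hw3; omega
    · obtain ⟨_, _, hbr⟩ := hRel
      rcases hbr with ⟨hw, hw3⟩ | ⟨hw, hw3, h2'⟩
      · have := hb2 k X hX a'' b'' hXp (Or.inr (by rw [← hw3, hYg]; exact hb1))
        rw [hKg, hK2] at this; cases this
      · have hw' : b.w = b''.w.sub 2 1 0 := by rw [← hYg]; exact hw
        have hls : LSw b''.w := ⟨h2', w2_of_sub hw' hb2'⟩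
        have := (hfar (by rw [hKg]; exact hK2')).2 ⟨a'', b'', hXp, hls⟩ j hj
        rw [this] at hsj; exact Bool.false_ne_true hsj

/-- ★ PROPOSITION 9.15 (5) — hence THEOREM 9.15 (4) IN FULL — for ALL LEGAL PLAYS from every cubic-free initial chain of length
≤ 2 (all seeds of the boxes: `[V(t), V(s)]`, `[V(s), R]`, …), mode `G_mult` (`topj ≥ 2`): at every `AL` accept BOTH branches at
EVERY point of the centre have `w₃ = 0` (the residual configuration of `residual_shape` never occurs). Kernel-checked, no `sorry`;
the proof is the conjunction of the state invariants `Inv3 ∧ Inv4 ∧ Inv6` (§B″–§B⁗) and of the birth-record invariants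
`I5 ∧ I8 ∧ NB ∧ G0 ∧ B2 ∧ G1` (§B⁵, §B⁶) along the play, and `prop5_state`. -/
theorem prop5_gmult {topj : ℕ} (htop : 2 ≤ topj) (ch₀ : Chain) (hlen : ch₀.length ≤ 2) (h0 : ∀ c ∈ ch₀, c.w3 = 0)
    (l₁ : List Move) (k : ℕ) (l₂ : List Move) (hl : isLegalPlay topj ch₀ (l₁ ++ Move.AL k :: l₂) = true)
    (i : ℕ) (hi : i ∈ ptsOf (applyMoves ch₀ l₁).length k) (a b : Curve) (hn : nodeAt (applyMoves ch₀ l₁) i = some (a, b)) :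
    a.w3 = 0 ∧ b.w3 = 0 := by
  obtain ⟨h1, h2⟩ := isLegalPlay_append l₁ (Move.AL k :: l₂) ch₀ hl
  obtain ⟨hm, _⟩ := isLegalPlay_cons h2
  have hp : proj (gApplyMoves (lift ch₀) l₁) = applyMoves ch₀ l₁ := by rw [proj_gApplyMoves, proj_lift]
  have hG : AllG (gApplyMoves (lift ch₀) l₁) := AllG_play htop l₁ (lift ch₀) (AllG_lift ch₀ hlen h0) (by rw [proj_lift]; exact h1)
  rw [← hp] at hm hi hn
  exact prop5_state hG (F2facts_of_topj htop _) (AccFacts_of_topj htop _) hm i hi a b hn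

/-- ★ the same for ALL LEGAL PLAYS in mode `uv` (all branches boundary), any rule set (`topj` arbitrary). -/
theorem prop5_uv (topj : ℕ) (ch₀ : Chain) (hbd : ∀ c ∈ ch₀, c.bd = true) (hlen : ch₀.length ≤ 2) (h0 : ∀ c ∈ ch₀, c.w3 = 0)
    (l₁ : List Move) (k : ℕ) (l₂ : List Move) (hl : isLegalPlay topj ch₀ (l₁ ++ Move.AL k :: l₂) = true)
    (i : ℕ) (hi : i ∈ ptsOf (applyMoves ch₀ l₁).length k) (a b : Curve) (hn : nodeAt (applyMoves ch₀ l₁) i = some (a, b)) :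
    a.w3 = 0 ∧ b.w3 = 0 := by
  obtain ⟨h1, h2⟩ := isLegalPlay_append l₁ (Move.AL k :: l₂) ch₀ hl
  obtain ⟨hm, _⟩ := isLegalPlay_cons h2
  have hp : proj (gApplyMoves (lift ch₀) l₁) = applyMoves ch₀ l₁ := by rw [proj_gApplyMoves, proj_lift]
  have hG : AllG (gApplyMoves (lift ch₀) l₁) :=
    AllG_play_bd topj l₁ (lift ch₀) (by rw [proj_lift]; exact hbd) (AllG_lift ch₀ hlen h0) (by rw [proj_lift]; exact h1)
  have hbd' : ∀ c ∈ applyMoves ch₀ l₁, c.bd = true := bd_applyMoves topj l₁ ch₀ hbd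
  rw [← hp] at hm hi hn hbd'
  exact prop5_state hG (F2facts_of_bd topj _ hbd') (AccFacts_of_bd topj _ hbd') hm i hi a b hn

/-- ★ MONIC NEIGHBOURS AT EVERY ACCEPT, EVERY POINT (THEOREM 9.15 (4) complete; S6's cubic-weight hypothesis in full), mode
`G_mult`: from every cubic-free initial chain of length ≤ 2, along every legal play, at every accept `D k / A k / AL k` both branches
at every point of the centre `k` have `w₃ = 0`. -/
theorem monic_neighbours_all_gmult {topj : ℕ} (htop : 2 ≤ topj) (ch₀ : Chain) (hlen : ch₀.length ≤ 2) (h0 : ∀ c ∈ ch₀, c.w3 = 0)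
    (l₁ : List Move) (m : Move) (l₂ : List Move) (hl : isLegalPlay topj ch₀ (l₁ ++ m :: l₂) = true) (k : ℕ)
    (hk : m = .D k ∨ m = .A k ∨ m = .AL k) (i : ℕ) (hi : i ∈ ptsOf (applyMoves ch₀ l₁).length k) (a b : Curve)
    (hn : nodeAt (applyMoves ch₀ l₁) i = some (a, b)) : a.w3 = 0 ∧ b.w3 = 0 := by
  rcases hk with hk | hk | hk
  · exact (monic_neighbours_gmult htop ch₀ h0 l₁ m l₂ hl k).1 (Or.inl hk) i hi a b hn
  · exact (monic_neighbours_gmult htop ch₀ h0 l₁ m l₂ hl k).1 (Or.inr hk) i hi a b hn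
  · subst hk; exact prop5_gmult htop ch₀ hlen h0 l₁ k l₂ hl i hi a b hn

/-- ★ the same in mode `uv`, any rule set. -/
theorem monic_neighbours_all_uv (topj : ℕ) (ch₀ : Chain) (hbd : ∀ c ∈ ch₀, c.bd = true) (hlen : ch₀.length ≤ 2)
    (h0 : ∀ c ∈ ch₀, c.w3 = 0) (l₁ : List Move) (m : Move) (l₂ : List Move) (hl : isLegalPlay topj ch₀ (l₁ ++ m :: l₂) = true)
    (k : ℕ) (hk : m = .D k ∨ m = .A k ∨ m = .AL k) (i : ℕ) (hi : i ∈ ptsOf (applyMoves ch₀ l₁).length k) (a b : Curve)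
    (hn : nodeAt (applyMoves ch₀ l₁) i = some (a, b)) : a.w3 = 0 ∧ b.w3 = 0 := by
  rcases hk with hk | hk | hk
  · exact (monic_neighbours_uv topj ch₀ hbd h0 l₁ m l₂ hl k).1 (Or.inl hk) i hi a b hn
  · exact (monic_neighbours_uv topj ch₀ hbd h0 l₁ m l₂ hl k).1 (Or.inr hk) i hi a b hn
  · subst hk; exact prop5_uv topj ch₀ hbd hlen h0 l₁ k l₂ hl i hi a b hn

/-- sanity: every initial chain `[⟨wt, 0, uv⟩, ⟨ws, 0, true⟩]` of the boxes satisfies the hypotheses (length ≤ 2, cubic-free). -/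
example (uv : Bool) (ws wt : W3) :
    ([⟨wt, 0, uv⟩, ⟨ws, 0, true⟩] : Chain).length ≤ 2 ∧ ∀ c ∈ ([⟨wt, 0, uv⟩, ⟨ws, 0, true⟩] : Chain), c.w3 = 0 :=
  ⟨by simp, by intro c hc; simp at hc; rcases hc with rfl | rfl <;> rfl⟩


/-- the box seeds `[⟨wt, 0, uv⟩, ⟨ws, 0, true⟩]` (= `initChain uv ws wt` of `Lines/toric_sgame.lean`) satisfy the hypotheses of
`prop5_*` / `monic_neighbours_all_*`. -/
theorem initChain_seed_ok (uv : Bool) (ws wt : W3) :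
    ([⟨wt, 0, uv⟩, ⟨ws, 0, true⟩] : Chain).length ≤ 2 ∧ ∀ c ∈ ([⟨wt, 0, uv⟩, ⟨ws, 0, true⟩] : Chain), c.w3 = 0 :=
  ⟨by simp, by intro c hc; simp at hc; rcases hc with rfl | rfl <;> rfl⟩

/-! ## §B⁷. Corollary: census counter a6 — no multiplicity-3 point off S at the distinguished points over the end nodes of an
accept (E-S6(iv) IN THE MODEL) — for every seed (rev 2 of this file, g8)
The census predicate `mult3AtEnd` (copied VERBATIM from `Lines/toric_sgame.lean` §B, with `dbl`) needs cubic weight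
`2·w₃(c) + w₃(nb) + 1 ≥ α`; at every accept the centre and both branches at each of its points have `w₃ = 0`
(`monic_centres_*`, `monic_neighbours_all_*`), so with `α ∈ {2, 3}` it is `false` — for every legal play from every cubic-free initial
chain of length ≤ 2, modes `G_mult` / `uv`. (The chart computation behind the predicate — orders `3 − α + 2w₃ + e₃` resp.
`4 − α + 2w₃ + e₃` of the cubic term at `q_z`, `q_a` — is the by-hand part of E-S6(iv) and stays outside the kernel.) -/

/-! ### §B (copy, census predicate) -/

/-- `2·w + e` on grade weights (`∞` absorbing). -/
def dbl (w e : Wt) : Wt := wadd (w.map (2 * ·)) e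

/-- MULTIPLICITY-3 TEST at the two distinguished points of the free-direction charts over an END NODE of an accept (exceptional
exponent `α`) of the curve `c` against the partner datum `nb` (exponents `e = nb.w`, cubic weight `e₃ = nb.w3`; the residual branch has
`e = c`, `e₃ = 0`). In the `z`-chart (`y = zy′`, `u = zu′`) the class-`b` term has order `2b + 2w_b + e_b − α` at `q_z = (1:0:0)` and the
cubic `z^{3−α+w₃}u′^{w₃}v^{e₃}(1+y′³)/3` has order `3 − α + 2w₃ + e₃`; in the `y`-chart at `q_a = (a:1:0)`, `a³ = −1`, the orders are
`b + 2w_b + e_b − α` and `4 − α + 2w₃ + e₃` (the cubic factor `z′³ + 1` is a local parameter there). Distinct monomials with unit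
coefficients: the multiplicity IS the least order, for all unit values. Returns `mult(q_z) ≥ 3 ∨ mult(q_a) ≥ 3`.
(Check: `α = 2`, `w₃ = e₃ = 0` gives `mult(q_a) = 2 ⟺ (w₁ = 1 ⇒ e₁ ≥ 1) ∧ (w₂ = 0 ⇒ e₂ ≥ 2)` = the node-end double points of S6 (iii),
and `mult(q_z) = 3 ⟺ 2w₁ + c₁ ≥ 3 ∧ 2w₀ + c₀ ≥ 5` when `w₃ ≥ 1`, `w₂ = 0`, `c₂ = 1` = E-S6(iv).) -/
def mult3AtEnd (α : ℕ) (c nb : Curve) : Bool :=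
  let t3 := 2 * c.w3 + nb.w3
  let d0 := dbl c.w.w0 nb.w.w0
  let d1 := dbl c.w.w1 nb.w.w1
  let d2 := dbl c.w.w2 nb.w.w2
  (Nat.ble α t3 && wge d0 (3 + α) && wge d1 (1 + α) && wge d2 (α - 1)) ||
  (Nat.ble α (t3 + 1) && wge d0 (3 + α) && wge d1 (2 + α) && wge d2 (1 + α))

theorem ble_false_of_lt {a b : ℕ} (h : b < a) : Nat.ble a b = false := by
  cases hb : Nat.ble a b with
  | false => rfl
  | true => exact absurd (Nat.le_of_ble_eq_true hb) (by omega)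

/-- the census test is negative as soon as the cubic weights vanish (`α ≥ 2`) -/
theorem mult3AtEnd_false {α : ℕ} (hα : 2 ≤ α) {c nb : Curve} (hc : c.w3 = 0) (hn : nb.w3 = 0) : mult3AtEnd α c nb = false := by
  unfold mult3AtEnd
  dsimp only
  rw [hc, hn, ble_false_of_lt (by omega : 2 * 0 + 0 < α), ble_false_of_lt (by omega : 2 * 0 + 0 + 1 < α)]
  simp

/-- ★ census counter a6 = 0 for every seed, mode `G_mult`: at every accept `D k / A k / AL k` of every legal play from every cubic-free
initial chain of length ≤ 2, for every point of the centre with branches `(a, b)` and every exponent `α ≥ 2` (the census uses `α = 3`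
for `D`, `α = 2` for `A/AL`), `mult3AtEnd α a b = false` and `mult3AtEnd α b a = false`. -/
theorem no_mult3AtEnd_gmult {topj : ℕ} (htop : 2 ≤ topj) (ch₀ : Chain) (hlen : ch₀.length ≤ 2) (h0 : ∀ c ∈ ch₀, c.w3 = 0)
    (l₁ : List Move) (m : Move) (l₂ : List Move) (hl : isLegalPlay topj ch₀ (l₁ ++ m :: l₂) = true) (k : ℕ)
    (hk : m = .D k ∨ m = .A k ∨ m = .AL k) (i : ℕ) (hi : i ∈ ptsOf (applyMoves ch₀ l₁).length k) (a b : Curve)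
    (hn : nodeAt (applyMoves ch₀ l₁) i = some (a, b)) {α : ℕ} (hα : 2 ≤ α) :
    mult3AtEnd α a b = false ∧ mult3AtEnd α b a = false := by
  obtain ⟨ha, hb⟩ := monic_neighbours_all_gmult htop ch₀ hlen h0 l₁ m l₂ hl k hk i hi a b hn
  exact ⟨mult3AtEnd_false hα ha hb, mult3AtEnd_false hα hb ha⟩

/-- ★ the same in mode `uv`, any rule set. -/
theorem no_mult3AtEnd_uv (topj : ℕ) (ch₀ : Chain) (hbd : ∀ c ∈ ch₀, c.bd = true) (hlen : ch₀.length ≤ 2)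
    (h0 : ∀ c ∈ ch₀, c.w3 = 0) (l₁ : List Move) (m : Move) (l₂ : List Move) (hl : isLegalPlay topj ch₀ (l₁ ++ m :: l₂) = true)
    (k : ℕ) (hk : m = .D k ∨ m = .A k ∨ m = .AL k) (i : ℕ) (hi : i ∈ ptsOf (applyMoves ch₀ l₁).length k) (a b : Curve)
    (hn : nodeAt (applyMoves ch₀ l₁) i = some (a, b)) {α : ℕ} (hα : 2 ≤ α) :
    mult3AtEnd α a b = false ∧ mult3AtEnd α b a = false := by
  obtain ⟨ha, hb⟩ := monic_neighbours_all_uv topj ch₀ hbd hlen h0 l₁ m l₂ hl k hk i hi a b hn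
  exact ⟨mult3AtEnd_false hα ha hb, mult3AtEnd_false hα hb ha⟩


end Summit.ResolutionOfSingularities.ResolutionOfSingularities.Cruxes.DescentPerfectToAll.GiraudWeakNormalForm.ToricSGame.AllChains
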